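import Literature.Analysis.FluidPDE.NSRobustnessOfRegularity
import Literature.Analysis.FluidPDE.TaoEnstrophyLocalisationProofs
import Literature.Analysis.FluidPDE.SpaceTimeCalculus
import Literature.Analysis.FluidPDE.ConstantinFeffermanEnstrophySlab
import Literature.Analysis.ODE.ForcedPowerComparison
import HarnessLib

/-!
# Robustness of regularity on `ℝ³`, the `H²` level (Dashti–Robinson 2008, Thm 2) in strain
# form: the slice inequality for `∫|D²(v − u)|²_F` with explicit constants

Analysis/FluidPDE proof file (theorems only; no definitions, no named facts, no `sorry`);
companion of `NSRobustnessOfRegularity` (the `H¹` level, RRS 2016 Thm 9.1 / Dashti–Robinson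
Thm 1), whose private slice calculus (Young, Cauchy–Schwarz for convective pairings, the two
integrations by parts onto quadratic forms in `Du`) is repeated here verbatim as private lemmas.

Dashti–Robinson 2008 (arXiv:math/0701341), Thm 2 (p. 6): "Let `f ∈ L¹(0,T;V²) ∩ L²(0,T;V)`,
`u₀ ∈ V²` and `u ∈ L^∞(0,T;V²) ∩ L²(0,T;V³)` be a strong solution … If
`|A(u₀ − v₀)| + ∫₀ᵀ|A(f − g)| dt < (1/c)√(2ν/T) exp(−∫₀ᵀ(c + c′)‖u‖₃ dt)`, then the solution of
[the equations with data `(v₀, g)`] is also a strong solution on `[0, T]` with the same regularity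
as `u`." Printed proof (pp. 6–7): for `w = u − v`, pair the difference equation with `A²w` and
use Kato's whole-space inequalities (triform21/22) `|(B(w,u), A²w)|, |(B(u,w), A²w)| ≤ c‖u‖₃‖w‖₂²`
and `|(B(w,w), A²w)| ≤ c‖w‖₂^{5/2}‖w‖₃^{1/2}`-type bounds, giving
`d/dt‖w‖₂ ≤ (c + c′)‖u‖₃‖w‖₂ + (c²/4ν)‖w‖₂³ + ‖f − g‖₂`, then Lemma 1 (the tree's
`Literature.Analysis.ODE.ForcedPowerComparison`).

THIS FILE proves the SLICE INEQUALITY of that proof at the `H²` level on `ℝ³` in STRAIN form —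
the rate carried by the reference `u` is its maximal compression rate `G` (`−⟪Du ξ, ξ⟫ ≤ G‖ξ‖²`)
and the sup majorants `σ₂ ≥ ‖D²u‖`, `σ₃ ≥ ‖D³u‖`, never `‖u‖_∞` or the `H³` norm — for smooth
fields `u` (reference), `w` (the difference; `v = u + w`) and a `C¹` field `h` (the difference of
the forces):

* `robustness_flux_H2_le_strain_R3` — with `wᵢ = ∂ᵢw`, `N = (v·∇)w + (w·∇)u`,
  `Z = Σᵢ∫|∇wᵢ|²_F` (`= ∫|D²w|²_F`), `X₁ = ∫|∇w|²_F`, `Y₂ = ∫‖Δw‖²`, `‖w‖_{L²} ≤ L`,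
  `H₁ = ∫‖Dh‖²`, `A = agmonConst`, `κ > 0` a free length, the `H²` flux
  `Σᵢ[−2ν∫‖Δwᵢ‖² + 2∫⟪∂ᵢN, Δwᵢ⟫ + 2∫⟪∂ᵢh, Δwᵢ⟫]` is at most
  `(6G + 9κσ₂ + 3κ²σ₃ + 2A²√(X₁Y₂)/ν + 27A⁴X₁²/(16ν³))·Z + (27σ₂/κ)X₁ + (9σ₃/κ²)L² + (6/ν)H₁`.
  Mechanism, per direction `i` (private `r3rob_H2_pairings`): `∂ᵢN = (u·∇)wᵢ + (w·∇)wᵢ +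
  (wᵢ·∇)u + (w·∇)∂ᵢu + Dw(∂ᵢu) + Dw(wᵢ)`; the transport by `u` and the stretching of `wᵢ` are the
  two quadratic-form integrations by parts of the `H¹` file applied to `wᵢ` (`≤ G`, `≤ G + 3σ₂…`);
  `(w·∇)∂ᵢu` and `Dw(∂ᵢu)` are integrated by parts once more (three-field identity, private
  `r3rob_integral_inner_laplacian_convect3`), producing cross terms `σ₂√X₁√Xᵢ`, `σ₃L√Xᵢ` and —
  after the Schwarz symmetry `∂ⱼwᵢ = ∂ᵢwⱼ` summed over directions (private
  `r3rob_H2_symmetric_le`) — a third quadratic form `≤ G·Z`; the two cubic terms are bounded by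
  Agmon (`‖w‖_∞ ≤ A(X₁Y₂)^{1/4}`, `‖wᵢ‖_∞ ≤ A(XᵢYᵢ)^{1/4}`) and Young against the dissipation.
  The only super-linearity in `Z` is the transport-by-`w` coefficient `2A²√(X₁Y₂)/ν` (`Y₂ ≤ 3Z`),
  i.e. the printed `dy/dt ≤ δ + αy³` for `y = ‖w‖_{H²}`.

* `IsClassicalNSSolutionOn.flux_identity_H2_sub_forces` — along two classical solutions
  `(u, p)` (force `f`), `(v, q)` (force `g`) of the `L²`-Sobolev class on `[0, T] × ℝ³` with
  `Df(t), Dg(t) ∈ L²`, for each direction `i` and `t ∈ [0, T]`: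
  `∫ 2Σⱼ⟪∂ⱼwᵢ, ∂ⱼ∂ₜwᵢ⟫ = −2ν∫‖Δwᵢ‖² + 2∫⟪∂ᵢN, Δwᵢ⟫ + 2∫⟪∂ᵢ(f − g), Δwᵢ⟫` (the tree's slice
  identity `integral_sum_inner_fderiv_fderiv_eq_of_eq_laplacian` applied to the differentiated
  difference equation `∂ₜwᵢ = νΔwᵢ − ∇∂ᵢ(q − p) + ∂ᵢ(g − f) − ∂ᵢN`, with `∂ₜ∂ᵢ = ∂ᵢ∂ₜ`
  (`IsSmoothSpaceTimeOn.timeDerivWithin_fderiv_slice_apply`), `∂ᵢΔ = Δ∂ᵢ`, `∂ᵢ∇ = ∇∂ᵢ`).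
* `IsClassicalNSSolutionOn.hessian_sub_balance_forces` — the `H²` balance
  `Z(b) = Z(0) + ∫₀ᵇ F` with the flux `F = Σᵢ[…]` identified, `F` integrable and `Z` continuous on
  `[0, T]` (`IsSmoothSpaceTimeOn.enstrophy_balance` on the three families `∂ᵢ(v − u)`).
* `classicalNS_robustness_H2_strain_R3` — **robustness of regularity at the `H²` level in strain
  form, a priori**: given continuous majorants on `[0, T]` of `G, σ₂ = ‖D²u‖_∞, σ₃ = ‖D³u‖_∞`,
  of the `L²` and `H¹` distances `L ≥ ‖(v − u)(s)‖_{L²}`, `X₁ ≥ ∫|∇(v − u)(s)|²_F` (the lower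
  levels, e.g. from `classicalNS_robustness_strain_R3`) and of `H₁ ≥ ∫‖D(f − g)(s)‖²`, free
  lengths `κ, μ > 0`, rate `l = 6G + 9κσ₂ + 3κ²σ₃ + 3A²X₁/(νμ) + 27A⁴X₁²/(16ν³)`, `β = A²μ/ν`,
  `ψ = 27σ₂X₁/κ + 9σ₃L²/κ² + 6H₁/ν`, `Λ' = l`, `Φ' ≥ e^{−Λ}ψ`, `η = Z(0) + Φ(T)`: if
  `βe^{Λ(T)}ηT < 1` then `Z(t) ≤ e^{Λ(t)}η/(1 − βe^{Λ(T)}ηt)` on `[0, T]` — the Riccati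
  comparison `Literature.Analysis.ODE.pow_le_of_integral_balance_le_linear_add_pow_succ_add`
  (`n = 1`) after `∫‖Δw‖² ≤ 3Z` and `2A²√(3X₁Z)Z/ν ≤ (A²μ/ν)Z² + (3A²X₁/(νμ))Z`.

* `norm_le_agmonConst_mul_rpow_of_le`, `classicalNS_norm_sub_le_of_H1_H2_R3` — the sup-norm
  readout `‖(v − u)(t, x)‖ ≤ A(3X₁Z)^{1/4}` from majorants `X₁ ≥ ∫|∇(v − u)(t)|²_F`,
  `Z ≥ Σᵢ∫|∇∂ᵢ(v − u)(t)|²_F` (Agmon and `∫‖Δw‖² ≤ 3Z`).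
* `classicalNS_robustness_H2_strain_window_R3` — the window-generic form on `[t₀, t₁]` with the
  envelopes as integrals: `Λ(t) = ∫_{t₀}^{t} l`, `η = Z(t₀) + ∫_{t₀}^{t₁}ψ` for a continuous
  `ψ ≥ 27σ₂X₁/κ + 9σ₃L²/κ² + 6H₁/ν`; `βe^{Λ(t₁)}η(t₁ − t₀) < 1 ⇒
  Z(t) ≤ e^{Λ(t)}η/(1 − βe^{Λ(t₁)}η(t − t₀))` (time translation
  `IsClassicalNSSolutionOn.comp_add_right`).

Scope (faithfulness): Dashti–Robinson's Thm 2 is the full robustness statement (existence of the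
perturbed strong solution) with unspecified constants `c, c′` (Kato 1972) and the `H³` norm of the
reference in the rate; here the a-priori estimate between two given classical solutions of the
class, with explicit constants, in the currency `(G, σ₂, σ₃)` of the reference's gradient, the
lower levels entering as majorants. The sup-norm readout `‖v − u‖_∞ ≤ A(X₁Z)^{1/4}` is the
tree's `norm_le_agmonConst_mul_rpow`; the existence half is not here.

Consumer: cell `ns-blowup`, route `PalasekTowerBreakdown`, crux `EpisodeBase`
(stmt-NavierStokesRegularity-19179), strain-currency door `Cruxes/EpisodeBase/Lines/straindoor`
(`StrainBudgetOn`: rate `6σ + 12κσ₂ + 4κ²σ₃`, functional `E_κ`). WHAT THIS IS NOT: not a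
statement about Navier–Stokes regularity or blow-up — slice calculus for two given smooth fields.

## Mathlib / tree search

Tree: everything of `NSRobustnessOfRegularity` (`norm_le_agmonConst_mul_rpow`, …),
`fderiv_fderiv_apply_comm_of_contDiff_two` (`EnstrophySplitting`, Schwarz),
`integral_sum_inner_fderiv_fderiv_eq_neg_integral_inner_laplacian` (`EnstrophyGronwall`),
`norm_iteratedFDeriv_fderiv_apply_basisFun_le`, `integral_norm_mul_norm_le_sqrt_mul_sqrt`.
`IsSmoothSpaceTimeOn.timeDerivWithin_fderiv_slice_apply`, `VectorCalculus.IsDivFree.fderiv_apply`,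
`fderiv_laplacian_apply_of_contDiff_three`, `exists_forall_norm_fderiv_fderiv_le_of_hasBoundedSobolevNormsOn`,
`IsSmoothSpaceTimeOn.enstrophy_balance`, `Literature.Analysis.ODE.ForcedPowerComparison`.
`lean search 'Hessian|levelSq 2|H2.*robust'`: no `ℝ³` second-order robustness bound.

## References

* M. Dashti, J. C. Robinson, *An a posteriori condition on the numerical approximations of the
  Navier–Stokes equations for the existence of a strong solution*, SIAM J. Numer. Anal. 46 (2008)
  3136–3150 (arXiv:math/0701341), §3 (triform inequalities), Thm 2 and its proof (pp. 6–7).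
  [DashtiRobinson2008]
* J. C. Robinson, J. L. Rodrigo, W. Sadowski, *The Three-Dimensional Navier–Stokes Equations*,
  CUP 2016, Thm 9.1 (proof, Step 1), pp. 180–182. [RobinsonRodrigoSadowskiCUP2016]
-/

noncomputable section

open MeasureTheory Set Function Filter Topology InnerProductSpace
open scoped ENNReal NNReal ContDiff RealInnerProductSpace Laplacian

namespace Literature.Analysis.FluidPDE

/-! ## §A Slice calculus repeated from the `H¹` file (private) -/

section Helpers

/-- `M √X √Y ≤ (ν/4) Y + M²X/ν` (`(νb − 2Ma)² ≥ 0`). [folklore] -/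
private theorem r3rob_young_two {ν M X Y : ℝ} (hν : 0 < ν) (hX : 0 ≤ X) (hY : 0 ≤ Y) :
    M * Real.sqrt X * Real.sqrt Y ≤ ν / 4 * Y + M ^ 2 * X / ν := by
  have ha := Real.sq_sqrt hX
  have hb := Real.sq_sqrt hY
  set a := Real.sqrt X
  set b := Real.sqrt Y
  rw [← ha, ← hb]
  have key : 0 ≤ (ν * b - 2 * M * a) ^ 2 := sq_nonneg _
  rw [show ν / 4 * b ^ 2 + M ^ 2 * a ^ 2 / ν = (ν ^ 2 * b ^ 2 + 4 * M ^ 2 * a ^ 2) / (4 * ν) by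
    field_simp]
  rw [le_div_iff₀ (by positivity)]
  nlinarith [key]

/-- **The polynomial Young step** (RRS: "Young's inequality with exponents `4` and `4/3`"):
if `s ≥ 0` and `s⁴ ≤ K Y³` with `K, Y ≥ 0`, then `s ≤ εY + 27K/(256ε³)` for every `ε > 0`
(`(3p + c)⁴ − 256p³c = (p − c)²(81p² + 14pc + c²) ≥ 0`). [folklore] -/
private theorem r3rob_young_quartic {s K Y ε : ℝ} (hs : 0 ≤ s) (hK : 0 ≤ K) (hY : 0 ≤ Y)
    (hε : 0 < ε) (h : s ^ 4 ≤ K * Y ^ 3) : s ≤ ε * Y + 27 * K / (256 * ε ^ 3) := by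
  set c : ℝ := 27 * K / (256 * ε ^ 3) with hc
  have hc0 : 0 ≤ c := by positivity
  set p : ℝ := ε * Y / 3 with hp
  have hp0 : 0 ≤ p := by positivity
  have hamgm : 256 * p ^ 3 * c ≤ (3 * p + c) ^ 4 := by
    have hid : (3 * p + c) ^ 4 - 256 * p ^ 3 * c =
        (p - c) ^ 2 * (81 * p ^ 2 + 14 * p * c + c ^ 2) := by ring
    have hnn : 0 ≤ (p - c) ^ 2 * (81 * p ^ 2 + 14 * p * c + c ^ 2) := by positivity
    linarith
  have he : 256 * p ^ 3 * c = K * Y ^ 3 := by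
    rw [hp, hc]; field_simp; ring
  have h3p : 3 * p + c = ε * Y + c := by rw [hp]; ring
  have hle4 : s ^ 4 ≤ (ε * Y + c) ^ 4 := by
    rw [← h3p]
    exact h.trans (he ▸ hamgm)
  have hrhs : 0 ≤ ε * Y + c := by positivity
  exact (pow_le_pow_iff_left₀ hs hrhs (by norm_num)).1 hle4


/-- `∫⁻‖c‖a‖‖² < ∞` from `∫⁻‖a‖² < ∞` (real-valued majorant form). [folklore] -/
private theorem r3rob_lintegral_sq_mul_norm_lt_top {G : Type*} [NormedAddCommGroup G]
    {a : EuclideanSpace ℝ (Fin 3) → G}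
    (c : ℝ) (ha : ∫⁻ x, ‖a x‖ₑ ^ 2 < ⊤) : ∫⁻ x, ‖c * ‖a x‖‖ₑ ^ 2 < ⊤ := by
  have e : ∀ x, ‖c * ‖a x‖‖ₑ ^ 2 = ‖c‖ₑ ^ 2 * ‖a x‖ₑ ^ 2 := fun x => by
    rw [enorm_mul, mul_pow, enorm_norm]
  simp_rw [e]
  rw [lintegral_const_mul' _ _ (ENNReal.pow_ne_top enorm_ne_top)]
  exact ENNReal.mul_lt_top (lt_top_iff_ne_top.2 (ENNReal.pow_ne_top enorm_ne_top)) ha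


/-- A continuous field with `∫‖k‖² < ∞` is in `L²`. [folklore] -/
private theorem r3rob_memLp_two {G : Type*} [NormedAddCommGroup G]
    {k : EuclideanSpace ℝ (Fin 3) → G}
    (hk : Continuous k) (hk0 : ∫⁻ x, ‖k x‖ₑ ^ 2 < ⊤) : MemLp k 2 volume :=
  (memLp_two_iff_integrable_sq_norm hk.aestronglyMeasurable).2
    (FluidPDE.integrable_sq_norm_of_lintegral_lt_top hk hk0)

/-- Pointwise: `‖(f·∇)h (x)‖ ≤ ‖f(x)‖ (|∇h(x)|²_F)^{1/2}` (`‖Dh(x)a‖ ≤ ‖Dh(x)‖‖a‖` and the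
operator norm is at most the Frobenius norm, `sq_opNorm_le_frobeniusNormSq`). [folklore] -/
private theorem norm_convect_le_mul_sqrt_frobeniusNormSq
    (f h : EuclideanSpace ℝ (Fin 3) → EuclideanSpace ℝ (Fin 3)) (x : EuclideanSpace ℝ (Fin 3)) :
    ‖convect f h x‖ ≤ ‖f x‖ * Real.sqrt (frobeniusNormSq (fderiv ℝ h x)) := by
  have h1 : ‖convect f h x‖ ≤ ‖fderiv ℝ h x‖ * ‖f x‖ := by
    rw [convect]
    exact (fderiv ℝ h x).le_opNorm (f x)
  have h2 : ‖fderiv ℝ h x‖ ≤ Real.sqrt (frobeniusNormSq (fderiv ℝ h x)) := by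
    refine Real.le_sqrt_of_sq_le ?_
    exact FluidPDE.sq_opNorm_le_frobeniusNormSq _
  calc ‖convect f h x‖ ≤ ‖fderiv ℝ h x‖ * ‖f x‖ := h1
    _ ≤ Real.sqrt (frobeniusNormSq (fderiv ℝ h x)) * ‖f x‖ :=
        mul_le_mul_of_nonneg_right h2 (norm_nonneg _)
    _ = ‖f x‖ * Real.sqrt (frobeniusNormSq (fderiv ℝ h x)) := mul_comm _ _

/-- Integrability of a convective pairing: for continuous `f` with `‖f‖ ≤ M`, `h ∈ C¹` with
`∫|∇h|²_F < ∞` and continuous `k ∈ L²`, `⟪(f·∇)h, k⟫ ∈ L¹(ℝ³)`. [folklore] -/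
private theorem integrable_inner_convect_of_norm_le
    {f h k : EuclideanSpace ℝ (Fin 3) → EuclideanSpace ℝ (Fin 3)} (hf : Continuous f)
    (hh : ContDiff ℝ 1 h) (hk : Continuous k) {M : ℝ} (hM0 : 0 ≤ M) (hM : ∀ x, ‖f x‖ ≤ M)
    (hh1 : ∫⁻ x, ENNReal.ofReal (frobeniusNormSq (fderiv ℝ h x)) < ⊤)
    (hk0 : ∫⁻ x, ‖k x‖ₑ ^ 2 < ⊤) :
    Integrable (fun x => ⟪convect f h x, k x⟫) volume := by
  set gF : EuclideanSpace ℝ (Fin 3) → ℝ :=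
    fun x => M * Real.sqrt (frobeniusNormSq (fderiv ℝ h x)) with hgF
  have cfrob : Continuous fun x => frobeniusNormSq (fderiv ℝ h x) :=
    FluidPDE.continuous_frobeniusNormSq_fderiv hh one_ne_zero
  have cgF : Continuous gF := continuous_const.mul cfrob.sqrt
  have hgF0 : ∀ x, 0 ≤ gF x := fun x => mul_nonneg hM0 (Real.sqrt_nonneg _)
  have hgF2 : ∫⁻ x, ‖gF x‖ₑ ^ 2 < ⊤ := by
    have e : ∀ x, ‖gF x‖ₑ ^ 2 =
        ENNReal.ofReal (M ^ 2) * ENNReal.ofReal (frobeniusNormSq (fderiv ℝ h x)) := by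
      intro x
      rw [Real.enorm_eq_ofReal (hgF0 x), ← ENNReal.ofReal_pow (hgF0 x), hgF, mul_pow,
        Real.sq_sqrt (frobeniusNormSq_nonneg _), ENNReal.ofReal_mul (sq_nonneg _)]
    simp_rw [e]
    rw [lintegral_const_mul' _ _ ENNReal.ofReal_ne_top]
    exact ENNReal.mul_lt_top ENNReal.ofReal_lt_top hh1
  have cconv : Continuous (convect f h) := (hh.continuous_fderiv one_ne_zero).clm_apply hf
  refine integrable_of_norm_le_mul_of_lintegral_sq (cconv.inner hk).aestronglyMeasurable cgF hk
    hgF2 hk0 (fun x => ?_)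
  calc ‖⟪convect f h x, k x⟫‖ ≤ ‖convect f h x‖ * ‖k x‖ := norm_inner_le_norm _ _
    _ ≤ (‖f x‖ * Real.sqrt (frobeniusNormSq (fderiv ℝ h x))) * ‖k x‖ :=
        mul_le_mul_of_nonneg_right (norm_convect_le_mul_sqrt_frobeniusNormSq f h x) (norm_nonneg _)
    _ ≤ gF x * ‖k x‖ :=
        mul_le_mul_of_nonneg_right (mul_le_mul_of_nonneg_right (hM x) (Real.sqrt_nonneg _))
          (norm_nonneg _)
    _ = ‖gF x‖ * ‖k x‖ := by rw [Real.norm_of_nonneg (hgF0 x)]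

/-- **Cauchy–Schwarz for a convective pairing on `ℝ³`** (RRS 2016, proof of Thm 9.1, Step 1,
the Hölder step): for continuous `f` with `‖f‖ ≤ M`, `h ∈ C¹` with `∫|∇h|²_F < ∞` and continuous
`k ∈ L²`, `∫⟪(f·∇)h, k⟫ ≤ M (∫|∇h|²_F)^{1/2} (∫‖k‖²)^{1/2}`. [folklore] -/
private theorem integral_inner_convect_le_of_norm_le
    {f h k : EuclideanSpace ℝ (Fin 3) → EuclideanSpace ℝ (Fin 3)} (hh : ContDiff ℝ 1 h)
    (hk : Continuous k) {M : ℝ} (hM0 : 0 ≤ M) (hM : ∀ x, ‖f x‖ ≤ M)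
    (hh1 : ∫⁻ x, ENNReal.ofReal (frobeniusNormSq (fderiv ℝ h x)) < ⊤)
    (hk0 : ∫⁻ x, ‖k x‖ₑ ^ 2 < ⊤) :
    ∫ x, ⟪convect f h x, k x⟫ ≤
      M * Real.sqrt (∫ x, frobeniusNormSq (fderiv ℝ h x)) * Real.sqrt (∫ x, ‖k x‖ ^ 2) := by
  set gF : EuclideanSpace ℝ (Fin 3) → ℝ :=
    fun x => Real.sqrt (frobeniusNormSq (fderiv ℝ h x)) with hgF
  have cfrob : Continuous fun x => frobeniusNormSq (fderiv ℝ h x) :=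
    FluidPDE.continuous_frobeniusNormSq_fderiv hh one_ne_zero
  have cgF : Continuous gF := cfrob.sqrt
  have hgF0 : ∀ x, 0 ≤ gF x := fun x => Real.sqrt_nonneg _
  have hgFsq : ∀ x, gF x ^ 2 = frobeniusNormSq (fderiv ℝ h x) := fun x =>
    Real.sq_sqrt (frobeniusNormSq_nonneg _)
  -- `gF ∈ L²`
  have hgF2 : ∫⁻ x, ‖gF x‖ₑ ^ 2 < ⊤ := by
    refine lt_of_le_of_lt (le_of_eq (lintegral_congr fun x => ?_)) hh1
    rw [Real.enorm_eq_ofReal (hgF0 x), ← ENNReal.ofReal_pow (hgF0 x), hgFsq]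
  have mgF : MemLp gF 2 volume := r3rob_memLp_two cgF hgF2
  have mk : MemLp k 2 volume := r3rob_memLp_two hk hk0
  have hcs := integral_norm_mul_norm_le_sqrt_mul_sqrt mgF mk
  have e1 : ∫ x, ‖gF x‖ ^ 2 = ∫ x, frobeniusNormSq (fderiv ℝ h x) :=
    integral_congr_ae (Eventually.of_forall fun x => by
      dsimp only; rw [Real.norm_of_nonneg (hgF0 x), hgFsq])
  rw [e1] at hcs
  -- the pointwise bound
  have hpt : ∀ x, ⟪convect f h x, k x⟫ ≤ M * (‖gF x‖ * ‖k x‖) := by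
    intro x
    calc ⟪convect f h x, k x⟫ ≤ ‖convect f h x‖ * ‖k x‖ := real_inner_le_norm _ _
      _ ≤ (‖f x‖ * gF x) * ‖k x‖ :=
          mul_le_mul_of_nonneg_right (norm_convect_le_mul_sqrt_frobeniusNormSq f h x) (norm_nonneg _)
      _ ≤ (M * gF x) * ‖k x‖ :=
          mul_le_mul_of_nonneg_right (mul_le_mul_of_nonneg_right (hM x) (hgF0 x)) (norm_nonneg _)
      _ = M * (‖gF x‖ * ‖k x‖) := by rw [Real.norm_of_nonneg (hgF0 x)]; ring
  have hrhs0 : 0 ≤ M * Real.sqrt (∫ x, frobeniusNormSq (fderiv ℝ h x)) *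
      Real.sqrt (∫ x, ‖k x‖ ^ 2) := by positivity
  by_cases hint : Integrable (fun x => ⟪convect f h x, k x⟫) volume
  · have hint2 : Integrable (fun x => M * (‖gF x‖ * ‖k x‖)) volume := by
      refine Integrable.const_mul ?_ M
      exact integrable_of_norm_le_mul_of_lintegral_sq
        ((cgF.norm.mul hk.norm).aestronglyMeasurable) cgF hk hgF2 hk0
        (fun x => by rw [Real.norm_of_nonneg (mul_nonneg (norm_nonneg _) (norm_nonneg _))])
    calc ∫ x, ⟪convect f h x, k x⟫ ≤ ∫ x, M * (‖gF x‖ * ‖k x‖) := integral_mono hint hint2 hpt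
      _ = M * ∫ x, ‖gF x‖ * ‖k x‖ := integral_const_mul _ _
      _ ≤ M * (Real.sqrt (∫ x, frobeniusNormSq (fderiv ℝ h x)) * Real.sqrt (∫ x, ‖k x‖ ^ 2)) :=
          mul_le_mul_of_nonneg_left hcs hM0
      _ = M * Real.sqrt (∫ x, frobeniusNormSq (fderiv ℝ h x)) * Real.sqrt (∫ x, ‖k x‖ ^ 2) := by
          ring
  · rw [integral_undef hint]
    exact hrhs0


/-- Linear algebra on `ℝ³`: `Σₖ ⟪B eₖ, B (A eₖ)⟫ = Σⱼ ⟪B†eⱼ, A (B†eⱼ)⟫` (both are the trace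
`tr(B†BA) = tr(BAB†)`). [folklore] -/
private theorem r3rob_sum_inner_comp_eq
    (A B : EuclideanSpace ℝ (Fin 3) →L[ℝ] EuclideanSpace ℝ (Fin 3)) :
    ∑ k, ⟪B (EuclideanSpace.basisFun (Fin 3) ℝ k), B (A (EuclideanSpace.basisFun (Fin 3) ℝ k))⟫ =
      ∑ j, ⟪(ContinuousLinearMap.adjoint B) (EuclideanSpace.basisFun (Fin 3) ℝ j),
        A ((ContinuousLinearMap.adjoint B) (EuclideanSpace.basisFun (Fin 3) ℝ j))⟫ := by
  set e := EuclideanSpace.basisFun (Fin 3) ℝ with he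
  set Bd := ContinuousLinearMap.adjoint B with hBd
  have h1 : ∑ k, ⟪B (e k), B (A (e k))⟫ =
      LinearMap.trace ℝ (EuclideanSpace ℝ (Fin 3))
        ((Bd : EuclideanSpace ℝ (Fin 3) →ₗ[ℝ] EuclideanSpace ℝ (Fin 3)) ∘ₗ
          ((B : EuclideanSpace ℝ (Fin 3) →ₗ[ℝ] EuclideanSpace ℝ (Fin 3)) ∘ₗ
            (A : EuclideanSpace ℝ (Fin 3) →ₗ[ℝ] EuclideanSpace ℝ (Fin 3)))) := by
    rw [LinearMap.trace_eq_sum_inner _ e]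
    refine Finset.sum_congr rfl fun k _ => ?_
    simp only [LinearMap.coe_comp, Function.comp_apply, ContinuousLinearMap.coe_coe]
    rw [hBd, ContinuousLinearMap.adjoint_inner_right]
  have h2 : ∑ j, ⟪Bd (e j), A (Bd (e j))⟫ =
      LinearMap.trace ℝ (EuclideanSpace ℝ (Fin 3))
        (((B : EuclideanSpace ℝ (Fin 3) →ₗ[ℝ] EuclideanSpace ℝ (Fin 3)) ∘ₗ
            (A : EuclideanSpace ℝ (Fin 3) →ₗ[ℝ] EuclideanSpace ℝ (Fin 3))) ∘ₗ
          (Bd : EuclideanSpace ℝ (Fin 3) →ₗ[ℝ] EuclideanSpace ℝ (Fin 3))) := by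
    rw [LinearMap.trace_eq_sum_inner _ e]
    refine Finset.sum_congr rfl fun j _ => ?_
    simp only [LinearMap.coe_comp, Function.comp_apply, ContinuousLinearMap.coe_coe]
    rw [hBd, ContinuousLinearMap.adjoint_inner_left]
  rw [h1, h2, LinearMap.trace_comp_comm']

/-- `frobeniusNormSq B† = frobeniusNormSq B` on `ℝ³` (Parseval twice). [folklore] -/
private theorem r3rob_frobeniusNormSq_adjoint
    (B : EuclideanSpace ℝ (Fin 3) →L[ℝ] EuclideanSpace ℝ (Fin 3)) :
    frobeniusNormSq (ContinuousLinearMap.adjoint B) = frobeniusNormSq B := by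
  set e := EuclideanSpace.basisFun (Fin 3) ℝ with he
  have hsq : ∀ x : EuclideanSpace ℝ (Fin 3), ‖x‖ ^ 2 = ∑ k, ⟪x, e k⟫ ^ 2 := fun x => by
    rw [EuclideanSpace.real_norm_sq_eq]
    refine Finset.sum_congr rfl fun k _ => ?_
    rw [he, EuclideanSpace.basisFun_apply, EuclideanSpace.inner_single_right]
    simp
  rw [frobeniusNormSq_eq_sum e, frobeniusNormSq_eq_sum e]
  simp_rw [hsq]
  rw [Finset.sum_comm]
  refine Finset.sum_congr rfl fun k _ => Finset.sum_congr rfl fun j _ => ?_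
  rw [ContinuousLinearMap.adjoint_inner_left, real_inner_comm]

/-- The first quadratic form: `−Σₖ ⟪B eₖ, B (A eₖ)⟫ ≤ G |B|²_F` if `−⟪Aξ, ξ⟫ ≤ G‖ξ‖²` for all `ξ`
(`A = Du`, `B = Dw`: the form `−Σᵢ ⟪∇wᵢ, Du ∇wᵢ⟫` of the transport term after integration by
parts). [folklore] -/
private theorem r3rob_neg_sum_inner_comp_le
    (A B : EuclideanSpace ℝ (Fin 3) →L[ℝ] EuclideanSpace ℝ (Fin 3)) {G : ℝ}
    (hG : ∀ ξ : EuclideanSpace ℝ (Fin 3), -⟪A ξ, ξ⟫ ≤ G * ‖ξ‖ ^ 2) :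
    -∑ k, ⟪B (EuclideanSpace.basisFun (Fin 3) ℝ k), B (A (EuclideanSpace.basisFun (Fin 3) ℝ k))⟫ ≤
      G * frobeniusNormSq B := by
  set e := EuclideanSpace.basisFun (Fin 3) ℝ with he
  set Bd := ContinuousLinearMap.adjoint B with hBd
  rw [r3rob_sum_inner_comp_eq A B, ← r3rob_frobeniusNormSq_adjoint B, frobeniusNormSq_eq_sum e,
    Finset.mul_sum, ← Finset.sum_neg_distrib]
  refine Finset.sum_le_sum fun j _ => ?_
  rw [real_inner_comm]
  exact hG _

/-- The second quadratic form: `−Σₖ ⟪B eₖ, A (B eₖ)⟫ ≤ G |B|²_F` if `−⟪Aξ, ξ⟫ ≤ G‖ξ‖²` (the form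
`−Σₖ ⟪∂ₖw, Du ∂ₖw⟫` of the stretching term). [folklore] -/
private theorem r3rob_neg_sum_inner_le
    (A B : EuclideanSpace ℝ (Fin 3) →L[ℝ] EuclideanSpace ℝ (Fin 3)) {G : ℝ}
    (hG : ∀ ξ : EuclideanSpace ℝ (Fin 3), -⟪A ξ, ξ⟫ ≤ G * ‖ξ‖ ^ 2) :
    -∑ k, ⟪B (EuclideanSpace.basisFun (Fin 3) ℝ k), A (B (EuclideanSpace.basisFun (Fin 3) ℝ k))⟫ ≤
      G * frobeniusNormSq B := by
  set e := EuclideanSpace.basisFun (Fin 3) ℝ with he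
  rw [frobeniusNormSq_eq_sum e, Finset.mul_sum, ← Finset.sum_neg_distrib]
  refine Finset.sum_le_sum fun k _ => ?_
  rw [real_inner_comm]
  exact hG _

variable {u w : EuclideanSpace ℝ (Fin 3) → EuclideanSpace ℝ (Fin 3)}

/-- **The product rule for the convective term** on `ℝ³` (smooth fields):
`∂ₑ((a·∇)b) = Db(∂ₑa) + (a·∇)(∂ₑb)` (the tree's `fderiv_convect_apply_eqOn` on `univ`). [folklore] -/
private theorem fderiv_convect_apply_of_contDiff
    {a b : EuclideanSpace ℝ (Fin 3) → EuclideanSpace ℝ (Fin 3)} (ha : ContDiff ℝ ∞ a)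
    (hb : ContDiff ℝ ∞ b)
    (x ξ : EuclideanSpace ℝ (Fin 3)) :
    fderiv ℝ (convect a b) x ξ =
      fderiv ℝ b x (fderiv ℝ a x ξ) + convect a (fun y => fderiv ℝ b y ξ) x := by
  have h := fderiv_convect_apply_eqOn isOpen_univ ha.contDiffOn hb.contDiffOn ξ (mem_univ x)
  simpa [convect] using h

/-- **The transport trilinear term, integrated by parts** (cstrat-19179's (I1); Beirão da Veiga /
Berselli–Galdi's `∫Δu·(u·∇)u = −Σ∂ₖuⱼ∂ⱼuᵢ∂ₖuᵢ` with two different fields): for `C^∞` fields `u, w`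
on `ℝ³` with `div u = 0`, `u, Du` bounded and `Dw, D²w ∈ L²`,
`∫ ⟪Δw, (u·∇)w⟫ = −Σᵢ ∫ ⟪∂ᵢw, Dw(∂ᵢu)⟫` — the transport term `∫⟪∂ᵢw, (u·∇)∂ᵢw⟫` vanishes
(`integral_inner_convect_transport_eq_zero`). [folklore] -/
private theorem integral_inner_laplacian_convect_left_eq_neg_sum (hu : ContDiff ℝ ∞ u) (hw : ContDiff ℝ ∞ w)
    (hdiv : VectorCalculus.IsDivFree u) {B : ℝ} (hB : ∀ x, ‖u x‖ ≤ B)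
    {B₁ : ℝ} (hB₁ : ∀ x, ‖fderiv ℝ u x‖ ≤ B₁)
    (hw1 : ∫⁻ x, ‖iteratedFDeriv ℝ 1 w x‖ₑ ^ 2 < ⊤) (hw2 : ∫⁻ x, ‖iteratedFDeriv ℝ 2 w x‖ₑ ^ 2 < ⊤) :
    (Integrable (fun x => ∑ i, ⟪fderiv ℝ w x (EuclideanSpace.basisFun (Fin 3) ℝ i),
        fderiv ℝ w x (fderiv ℝ u x (EuclideanSpace.basisFun (Fin 3) ℝ i))⟫) volume) ∧
    ∫ x, ⟪(Δ w) x, convect u w x⟫ =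
      - ∫ x, ∑ i, ⟪fderiv ℝ w x (EuclideanSpace.basisFun (Fin 3) ℝ i),
          fderiv ℝ w x (fderiv ℝ u x (EuclideanSpace.basisFun (Fin 3) ℝ i))⟫ := by
  set e := EuclideanSpace.basisFun (Fin 3) ℝ with he
  have he1 : ∀ i, ‖e i‖ = 1 := fun i => by simp [he]
  have hB0 : 0 ≤ B := (norm_nonneg _).trans (hB 0)
  have hB₁0 : 0 ≤ B₁ := (norm_nonneg _).trans (hB₁ 0)
  have hw2' : ContDiff ℝ 2 w := hw.of_le (by norm_cast)
  have hw1' : ContDiff ℝ 1 w := hw.of_le (by norm_cast)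
  have hu1' : ContDiff ℝ 1 u := hu.of_le (by norm_cast)
  obtain ⟨F, hFdef⟩ : ∃ F : EuclideanSpace ℝ (Fin 3) → EuclideanSpace ℝ (Fin 3),
      F = convect u w := ⟨_, rfl⟩
  have hF : ContDiff ℝ 1 F := by
    rw [hFdef]; exact (hw.fderiv_right (m := 1) (by norm_cast)).clm_apply hu1'
  -- slices
  obtain ⟨ws, hws⟩ : ∃ ws : Fin 3 → EuclideanSpace ℝ (Fin 3) → EuclideanSpace ℝ (Fin 3),
      ws = fun i y => fderiv ℝ w y (e i) := ⟨_, rfl⟩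
  have hws2 : ∀ i, ContDiff ℝ 2 (ws i) := fun i => by
    rw [hws]; exact (hw.fderiv_right (m := 2) (by norm_cast)).clm_apply contDiff_const
  have hws1 : ∀ i, ContDiff ℝ 1 (ws i) := fun i => (hws2 i).of_le (by norm_num)
  have hwsinf : ∀ i, ContDiff ℝ ∞ (ws i) := fun i => by
    rw [hws]; exact (hw.fderiv_right (m := ∞) (by norm_cast)).clm_apply contDiff_const
  -- continuity
  have cu : Continuous u := hu.continuous
  have cDu : Continuous (fderiv ℝ u) := hu1'.continuous_fderiv one_ne_zero
  have cDw : Continuous (fderiv ℝ w) := hw1'.continuous_fderiv one_ne_zero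
  have cws : ∀ i, Continuous (ws i) := fun i => (hws1 i).continuous
  have cDws : ∀ i, Continuous (fderiv ℝ (ws i)) := fun i => (hws1 i).continuous_fderiv one_ne_zero
  have cddw : ∀ i, Continuous fun x => fderiv ℝ (ws i) x (e i) := fun i =>
    (cDws i).clm_apply continuous_const
  have cF : Continuous F := by rw [hFdef]; exact cDw.clm_apply cu
  have cDF : Continuous (fderiv ℝ F) := hF.continuous_fderiv one_ne_zero
  -- pointwise norm bounds
  have hDw_eq : ∀ x, ‖fderiv ℝ w x‖ = ‖iteratedFDeriv ℝ 1 w x‖ := fun x => by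
    rw [← norm_iteratedFDeriv_fderiv, norm_iteratedFDeriv_zero]
  have n_ws : ∀ i x, ‖ws i x‖ ≤ ‖fderiv ℝ w x‖ := fun i x => by
    rw [hws]; simpa [he1] using (fderiv ℝ w x).le_opNorm (e i)
  have n_Dws : ∀ i x, ‖fderiv ℝ (ws i) x‖ ≤ ‖iteratedFDeriv ℝ 2 w x‖ := fun i x => by
    have h : ‖fderiv ℝ (ws i) x‖ = ‖iteratedFDeriv ℝ 1 (ws i) x‖ := by
      rw [← norm_iteratedFDeriv_fderiv, norm_iteratedFDeriv_zero]
    rw [h, hws]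
    exact norm_iteratedFDeriv_fderiv_apply_basisFun_le hw 1 (by norm_cast) x i
  have n_ddw : ∀ i x, ‖fderiv ℝ (ws i) x (e i)‖ ≤ ‖iteratedFDeriv ℝ 2 w x‖ := fun i x => by
    have h1 : ‖fderiv ℝ (ws i) x (e i)‖ ≤ ‖fderiv ℝ (ws i) x‖ := by
      simpa [he1] using (fderiv ℝ (ws i) x).le_opNorm (e i)
    exact h1.trans (n_Dws i x)
  have n_F : ∀ x, ‖F x‖ ≤ ‖B * ‖fderiv ℝ w x‖‖ := fun x => by
    rw [hFdef, convect, Real.norm_of_nonneg (mul_nonneg hB0 (norm_nonneg _)), mul_comm]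
    exact (fderiv ℝ w x).le_opNorm_of_le (hB x)
  -- finite `L²` norms
  have l2Dw : ∫⁻ x, ‖fderiv ℝ w x‖ₑ ^ 2 < ⊤ :=
    lintegral_enorm_sq_lt_top_of_norm_le (fun x => (hDw_eq x).le) hw1
  have l2ws : ∀ i, ∫⁻ x, ‖ws i x‖ₑ ^ 2 < ⊤ := fun i => lintegral_enorm_sq_lt_top_of_norm_le (n_ws i) l2Dw
  have l2Dws : ∀ i, ∫⁻ x, ‖fderiv ℝ (ws i) x‖ₑ ^ 2 < ⊤ := fun i =>
    lintegral_enorm_sq_lt_top_of_norm_le (n_Dws i) hw2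
  have l2ddw : ∀ i, ∫⁻ x, ‖fderiv ℝ (ws i) x (e i)‖ₑ ^ 2 < ⊤ := fun i =>
    lintegral_enorm_sq_lt_top_of_norm_le (n_ddw i) hw2
  have l2F : ∫⁻ x, ‖F x‖ₑ ^ 2 < ⊤ :=
    lintegral_enorm_sq_lt_top_of_norm_le n_F (r3rob_lintegral_sq_mul_norm_lt_top B l2Dw)
  -- the derivative of `F`: `∂ᵢF = Dw(∂ᵢu) + (u·∇)(∂ᵢw)`
  have hdF : ∀ i x, fderiv ℝ F x (e i) = fderiv ℝ w x (fderiv ℝ u x (e i)) + convect u (ws i) x := by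
    intro i x
    rw [hFdef, fderiv_convect_apply_of_contDiff hu hw x (e i), hws]
  -- the two pieces of `⟪wsᵢ, ∂ᵢF⟫` and their integrability
  have n_a : ∀ i x, ‖fderiv ℝ w x (fderiv ℝ u x (e i))‖ ≤ ‖B₁ * ‖fderiv ℝ w x‖‖ := fun i x => by
    rw [Real.norm_of_nonneg (mul_nonneg hB₁0 (norm_nonneg _)), mul_comm]
    refine (fderiv ℝ w x).le_opNorm_of_le ?_
    calc ‖fderiv ℝ u x (e i)‖ ≤ ‖fderiv ℝ u x‖ * ‖e i‖ := (fderiv ℝ u x).le_opNorm _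
      _ ≤ B₁ := by rw [he1, mul_one]; exact hB₁ x
  have n_b : ∀ i x, ‖convect u (ws i) x‖ ≤ ‖B * ‖fderiv ℝ (ws i) x‖‖ := fun i x => by
    rw [convect, Real.norm_of_nonneg (mul_nonneg hB0 (norm_nonneg _)), mul_comm]
    exact (fderiv ℝ (ws i) x).le_opNorm_of_le (hB x)
  have ca : ∀ i, Continuous fun x => fderiv ℝ w x (fderiv ℝ u x (e i)) := fun i =>
    cDw.clm_apply (cDu.clm_apply continuous_const)
  have cb : ∀ i, Continuous (convect u (ws i)) := fun i => (cDws i).clm_apply cu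
  have l2a : ∀ i, ∫⁻ x, ‖fderiv ℝ w x (fderiv ℝ u x (e i))‖ₑ ^ 2 < ⊤ := fun i =>
    lintegral_enorm_sq_lt_top_of_norm_le (n_a i) (r3rob_lintegral_sq_mul_norm_lt_top B₁ l2Dw)
  have l2b : ∀ i, ∫⁻ x, ‖convect u (ws i) x‖ₑ ^ 2 < ⊤ := fun i =>
    lintegral_enorm_sq_lt_top_of_norm_le (n_b i) (r3rob_lintegral_sq_mul_norm_lt_top B (l2Dws i))
  have i2a : ∀ i, Integrable (fun x => ⟪ws i x, fderiv ℝ w x (fderiv ℝ u x (e i))⟫) volume := fun i =>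
    integrable_of_norm_le_mul_of_lintegral_sq ((cws i).inner (ca i)).aestronglyMeasurable (cws i) (ca i)
      (l2ws i) (l2a i) fun x => norm_inner_le_norm _ _
  have i2b : ∀ i, Integrable (fun x => ⟪ws i x, convect u (ws i) x⟫) volume := fun i =>
    integrable_of_norm_le_mul_of_lintegral_sq ((cws i).inner (cb i)).aestronglyMeasurable (cws i) (cb i)
      (l2ws i) (l2b i) fun x => norm_inner_le_norm _ _
  -- integrability for the integration by parts
  have i1 : ∀ i, Integrable (fun x => ⟪fderiv ℝ (fun y => fderiv ℝ w y (e i)) x (e i), F x⟫)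
      volume := fun i => by
    have h : Integrable (fun x => ⟪fderiv ℝ (ws i) x (e i), F x⟫) volume :=
      integrable_of_norm_le_mul_of_lintegral_sq ((cddw i).inner cF).aestronglyMeasurable (cddw i)
        cF (l2ddw i) l2F fun x => norm_inner_le_norm _ _
    rw [hws] at h
    exact h
  have i2 : ∀ i, Integrable (fun x => ⟪fderiv ℝ w x (e i), fderiv ℝ F x (e i)⟫) volume := fun i => by
    have h := (i2a i).add (i2b i)
    refine h.congr (Eventually.of_forall fun x => ?_)
    simp only [Pi.add_apply, hdF i x, inner_add_right, hws]
  have i3 : ∀ i, Integrable (fun x => ⟪fderiv ℝ w x (e i), F x⟫) volume := fun i => by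
    have h : Integrable (fun x => ⟪ws i x, F x⟫) volume :=
      integrable_of_norm_le_mul_of_lintegral_sq ((cws i).inner cF).aestronglyMeasurable (cws i)
        cF (l2ws i) l2F fun x => norm_inner_le_norm _ _
    rw [hws] at h
    exact h
  -- integration by parts
  have hL := integral_sum_inner_fderiv_fderiv_eq_neg_integral_inner_laplacian hw2' hF i1 i2 i3
  -- the transport terms vanish
  have htr : ∀ i, ∫ x, ⟪ws i x, convect u (ws i) x⟫ = 0 := by
    intro i
    have hswap : (fun x => ⟪ws i x, convect u (ws i) x⟫) = fun x => ⟪convect u (ws i) x, ws i x⟫ :=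
      funext fun x => real_inner_comm _ _
    rw [hswap]
    exact integral_inner_convect_transport_eq_zero hu1' hdiv hB (hws1 i)
      (r3rob_memLp_two (cws i) (l2ws i)) (r3rob_memLp_two (cDws i) (l2Dws i))
  have hsplit : ∀ i, ∫ x, ⟪fderiv ℝ w x (e i), fderiv ℝ F x (e i)⟫ =
      ∫ x, ⟪ws i x, fderiv ℝ w x (fderiv ℝ u x (e i))⟫ := by
    intro i
    have h1 : (fun x => ⟪fderiv ℝ w x (e i), fderiv ℝ F x (e i)⟫) =
        fun x => ⟪ws i x, fderiv ℝ w x (fderiv ℝ u x (e i))⟫ + ⟪ws i x, convect u (ws i) x⟫ :=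
      funext fun x => by rw [hdF i x, inner_add_right, hws]
    rw [h1, integral_add (i2a i) (i2b i), htr i, add_zero]
  have hL' : ∫ x, ⟪(Δ w) x, F x⟫ = - ∫ x, ∑ i, ⟪fderiv ℝ w x (e i), fderiv ℝ F x (e i)⟫ := by
    rw [hL, neg_neg]
  have i2a' : ∀ i, Integrable (fun x => ⟪fderiv ℝ w x (e i), fderiv ℝ w x (fderiv ℝ u x (e i))⟫)
      volume := fun i => by
    have h := i2a i
    rw [hws] at h
    exact h
  refine ⟨integrable_finsetSum _ fun i _ => i2a' i, ?_⟩
  rw [← hFdef, hL', integral_finsetSum _ fun i _ => i2 i, Finset.sum_congr rfl fun i _ => hsplit i,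
    ← integral_finsetSum _ fun i _ => i2a i, hws]

/-- **The stretching trilinear term, integrated by parts** (cstrat-19179's (I2)): for `C^∞` fields
`u, w` on `ℝ³` with `Du, D²u` bounded and `w, Dw, D²w ∈ L²`,
`∫ ⟪Δw, (w·∇)u⟫ = −Σᵢ ∫ ⟪∂ᵢw, Du(∂ᵢw)⟫ − Σᵢ ∫ ⟪∂ᵢw, (w·∇)∂ᵢu⟫`. [folklore] -/
private theorem integral_inner_laplacian_convect_right_eq_neg_sum (hu : ContDiff ℝ ∞ u) (hw : ContDiff ℝ ∞ w)
    {B₁ : ℝ} (hB₁ : ∀ x, ‖fderiv ℝ u x‖ ≤ B₁) {B₂ : ℝ} (hB₂ : ∀ x, ‖iteratedFDeriv ℝ 2 u x‖ ≤ B₂)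
    (hw0 : ∫⁻ x, ‖w x‖ₑ ^ 2 < ⊤)
    (hw1 : ∫⁻ x, ‖iteratedFDeriv ℝ 1 w x‖ₑ ^ 2 < ⊤) (hw2 : ∫⁻ x, ‖iteratedFDeriv ℝ 2 w x‖ₑ ^ 2 < ⊤) :
    (Integrable (fun x => ∑ i, ⟪fderiv ℝ w x (EuclideanSpace.basisFun (Fin 3) ℝ i),
        fderiv ℝ u x (fderiv ℝ w x (EuclideanSpace.basisFun (Fin 3) ℝ i))⟫) volume) ∧
    (Integrable (fun x => ∑ i, ⟪fderiv ℝ w x (EuclideanSpace.basisFun (Fin 3) ℝ i),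
        convect w (fun y => fderiv ℝ u y (EuclideanSpace.basisFun (Fin 3) ℝ i)) x⟫) volume) ∧
    ∫ x, ⟪(Δ w) x, convect w u x⟫ =
      - (∫ x, ∑ i, ⟪fderiv ℝ w x (EuclideanSpace.basisFun (Fin 3) ℝ i),
          fderiv ℝ u x (fderiv ℝ w x (EuclideanSpace.basisFun (Fin 3) ℝ i))⟫)
      - ∫ x, ∑ i, ⟪fderiv ℝ w x (EuclideanSpace.basisFun (Fin 3) ℝ i),
          convect w (fun y => fderiv ℝ u y (EuclideanSpace.basisFun (Fin 3) ℝ i)) x⟫ := by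
  set e := EuclideanSpace.basisFun (Fin 3) ℝ with he
  have he1 : ∀ i, ‖e i‖ = 1 := fun i => by simp [he]
  have hB₁0 : 0 ≤ B₁ := (norm_nonneg _).trans (hB₁ 0)
  have hB₂0 : 0 ≤ B₂ := (norm_nonneg _).trans (hB₂ 0)
  have hw2' : ContDiff ℝ 2 w := hw.of_le (by norm_cast)
  have hw1' : ContDiff ℝ 1 w := hw.of_le (by norm_cast)
  have hu1' : ContDiff ℝ 1 u := hu.of_le (by norm_cast)
  have hu2' : ContDiff ℝ 2 u := hu.of_le (by norm_cast)
  obtain ⟨F, hFdef⟩ : ∃ F : EuclideanSpace ℝ (Fin 3) → EuclideanSpace ℝ (Fin 3),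
      F = convect w u := ⟨_, rfl⟩
  have hF : ContDiff ℝ 1 F := by
    rw [hFdef]; exact (hu.fderiv_right (m := 1) (by norm_cast)).clm_apply hw1'
  -- slices
  obtain ⟨ws, hws⟩ : ∃ ws : Fin 3 → EuclideanSpace ℝ (Fin 3) → EuclideanSpace ℝ (Fin 3),
      ws = fun i y => fderiv ℝ w y (e i) := ⟨_, rfl⟩
  obtain ⟨us, hus⟩ : ∃ us : Fin 3 → EuclideanSpace ℝ (Fin 3) → EuclideanSpace ℝ (Fin 3),
      us = fun i y => fderiv ℝ u y (e i) := ⟨_, rfl⟩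
  have hws2 : ∀ i, ContDiff ℝ 2 (ws i) := fun i => by
    rw [hws]; exact (hw.fderiv_right (m := 2) (by norm_cast)).clm_apply contDiff_const
  have hws1 : ∀ i, ContDiff ℝ 1 (ws i) := fun i => (hws2 i).of_le (by norm_num)
  have hus1 : ∀ i, ContDiff ℝ 1 (us i) := fun i => by
    rw [hus]; exact (hu.fderiv_right (m := 1) (by norm_cast)).clm_apply contDiff_const
  -- continuity
  have cu : Continuous u := hu.continuous
  have cw : Continuous w := hw.continuous
  have cDu : Continuous (fderiv ℝ u) := hu1'.continuous_fderiv one_ne_zero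
  have cDw : Continuous (fderiv ℝ w) := hw1'.continuous_fderiv one_ne_zero
  have cws : ∀ i, Continuous (ws i) := fun i => (hws1 i).continuous
  have cDws : ∀ i, Continuous (fderiv ℝ (ws i)) := fun i => (hws1 i).continuous_fderiv one_ne_zero
  have cDus : ∀ i, Continuous (fderiv ℝ (us i)) := fun i => (hus1 i).continuous_fderiv one_ne_zero
  have cddw : ∀ i, Continuous fun x => fderiv ℝ (ws i) x (e i) := fun i =>
    (cDws i).clm_apply continuous_const
  have cF : Continuous F := by rw [hFdef]; exact cDu.clm_apply cw
  -- pointwise norm bounds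
  have hDw_eq : ∀ x, ‖fderiv ℝ w x‖ = ‖iteratedFDeriv ℝ 1 w x‖ := fun x => by
    rw [← norm_iteratedFDeriv_fderiv, norm_iteratedFDeriv_zero]
  have n_ws : ∀ i x, ‖ws i x‖ ≤ ‖fderiv ℝ w x‖ := fun i x => by
    rw [hws]; simpa [he1] using (fderiv ℝ w x).le_opNorm (e i)
  have n_Dws : ∀ i x, ‖fderiv ℝ (ws i) x‖ ≤ ‖iteratedFDeriv ℝ 2 w x‖ := fun i x => by
    have h : ‖fderiv ℝ (ws i) x‖ = ‖iteratedFDeriv ℝ 1 (ws i) x‖ := by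
      rw [← norm_iteratedFDeriv_fderiv, norm_iteratedFDeriv_zero]
    rw [h, hws]
    exact norm_iteratedFDeriv_fderiv_apply_basisFun_le hw 1 (by norm_cast) x i
  have n_ddw : ∀ i x, ‖fderiv ℝ (ws i) x (e i)‖ ≤ ‖iteratedFDeriv ℝ 2 w x‖ := fun i x => by
    have h1 : ‖fderiv ℝ (ws i) x (e i)‖ ≤ ‖fderiv ℝ (ws i) x‖ := by
      simpa [he1] using (fderiv ℝ (ws i) x).le_opNorm (e i)
    exact h1.trans (n_Dws i x)
  have n_Dus : ∀ i x, ‖fderiv ℝ (us i) x‖ ≤ B₂ := fun i x => by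
    have h : ‖fderiv ℝ (us i) x‖ = ‖iteratedFDeriv ℝ 1 (us i) x‖ := by
      rw [← norm_iteratedFDeriv_fderiv, norm_iteratedFDeriv_zero]
    rw [h, hus]
    exact (norm_iteratedFDeriv_fderiv_apply_basisFun_le hu 1 (by norm_cast) x i).trans (hB₂ x)
  have n_F : ∀ x, ‖F x‖ ≤ ‖B₁ * ‖w x‖‖ := fun x => by
    rw [hFdef, convect, Real.norm_of_nonneg (mul_nonneg hB₁0 (norm_nonneg _))]
    exact (fderiv ℝ u x).le_of_opNorm_le (hB₁ x) (w x)
  -- finite `L²` norms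
  have l2Dw : ∫⁻ x, ‖fderiv ℝ w x‖ₑ ^ 2 < ⊤ :=
    lintegral_enorm_sq_lt_top_of_norm_le (fun x => (hDw_eq x).le) hw1
  have l2ws : ∀ i, ∫⁻ x, ‖ws i x‖ₑ ^ 2 < ⊤ := fun i => lintegral_enorm_sq_lt_top_of_norm_le (n_ws i) l2Dw
  have l2Dws : ∀ i, ∫⁻ x, ‖fderiv ℝ (ws i) x‖ₑ ^ 2 < ⊤ := fun i =>
    lintegral_enorm_sq_lt_top_of_norm_le (n_Dws i) hw2
  have l2ddw : ∀ i, ∫⁻ x, ‖fderiv ℝ (ws i) x (e i)‖ₑ ^ 2 < ⊤ := fun i =>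
    lintegral_enorm_sq_lt_top_of_norm_le (n_ddw i) hw2
  have l2F : ∫⁻ x, ‖F x‖ₑ ^ 2 < ⊤ :=
    lintegral_enorm_sq_lt_top_of_norm_le n_F (r3rob_lintegral_sq_mul_norm_lt_top B₁ hw0)
  -- the derivative of `F`: `∂ᵢF = Du(∂ᵢw) + (w·∇)(∂ᵢu)`
  have hdF : ∀ i x, fderiv ℝ F x (e i) = fderiv ℝ u x (ws i x) + convect w (us i) x := by
    intro i x
    rw [hFdef, fderiv_convect_apply_of_contDiff hw hu x (e i), hws, hus]
  -- the two pieces and their integrability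
  have n_a : ∀ i x, ‖fderiv ℝ u x (ws i x)‖ ≤ ‖B₁ * ‖fderiv ℝ w x‖‖ := fun i x => by
    rw [Real.norm_of_nonneg (mul_nonneg hB₁0 (norm_nonneg _))]
    exact ((fderiv ℝ u x).le_of_opNorm_le (hB₁ x) (ws i x)).trans
      (mul_le_mul_of_nonneg_left (n_ws i x) hB₁0)
  have n_b : ∀ i x, ‖convect w (us i) x‖ ≤ ‖B₂ * ‖w x‖‖ := fun i x => by
    rw [convect, Real.norm_of_nonneg (mul_nonneg hB₂0 (norm_nonneg _))]
    exact (fderiv ℝ (us i) x).le_of_opNorm_le (n_Dus i x) (w x)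
  have ca : ∀ i, Continuous fun x => fderiv ℝ u x (ws i x) := fun i => cDu.clm_apply (cws i)
  have cb : ∀ i, Continuous (convect w (us i)) := fun i => (cDus i).clm_apply cw
  have l2a : ∀ i, ∫⁻ x, ‖fderiv ℝ u x (ws i x)‖ₑ ^ 2 < ⊤ := fun i =>
    lintegral_enorm_sq_lt_top_of_norm_le (n_a i) (r3rob_lintegral_sq_mul_norm_lt_top B₁ l2Dw)
  have l2b : ∀ i, ∫⁻ x, ‖convect w (us i) x‖ₑ ^ 2 < ⊤ := fun i =>
    lintegral_enorm_sq_lt_top_of_norm_le (n_b i) (r3rob_lintegral_sq_mul_norm_lt_top B₂ hw0)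
  have i2a : ∀ i, Integrable (fun x => ⟪ws i x, fderiv ℝ u x (ws i x)⟫) volume := fun i =>
    integrable_of_norm_le_mul_of_lintegral_sq ((cws i).inner (ca i)).aestronglyMeasurable (cws i) (ca i)
      (l2ws i) (l2a i) fun x => norm_inner_le_norm _ _
  have i2b : ∀ i, Integrable (fun x => ⟪ws i x, convect w (us i) x⟫) volume := fun i =>
    integrable_of_norm_le_mul_of_lintegral_sq ((cws i).inner (cb i)).aestronglyMeasurable (cws i) (cb i)
      (l2ws i) (l2b i) fun x => norm_inner_le_norm _ _
  -- integrability for the integration by parts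
  have i1 : ∀ i, Integrable (fun x => ⟪fderiv ℝ (fun y => fderiv ℝ w y (e i)) x (e i), F x⟫)
      volume := fun i => by
    have h : Integrable (fun x => ⟪fderiv ℝ (ws i) x (e i), F x⟫) volume :=
      integrable_of_norm_le_mul_of_lintegral_sq ((cddw i).inner cF).aestronglyMeasurable (cddw i)
        cF (l2ddw i) l2F fun x => norm_inner_le_norm _ _
    rw [hws] at h
    exact h
  have i2 : ∀ i, Integrable (fun x => ⟪fderiv ℝ w x (e i), fderiv ℝ F x (e i)⟫) volume := fun i => by
    have h := (i2a i).add (i2b i)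
    refine h.congr (Eventually.of_forall fun x => ?_)
    simp only [Pi.add_apply, hdF i x, inner_add_right, hws]
  have i3 : ∀ i, Integrable (fun x => ⟪fderiv ℝ w x (e i), F x⟫) volume := fun i => by
    have h : Integrable (fun x => ⟪ws i x, F x⟫) volume :=
      integrable_of_norm_le_mul_of_lintegral_sq ((cws i).inner cF).aestronglyMeasurable (cws i)
        cF (l2ws i) l2F fun x => norm_inner_le_norm _ _
    rw [hws] at h
    exact h
  -- integration by parts
  have hL := integral_sum_inner_fderiv_fderiv_eq_neg_integral_inner_laplacian hw2' hF i1 i2 i3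
  have hsplit : ∀ i, ∫ x, ⟪fderiv ℝ w x (e i), fderiv ℝ F x (e i)⟫ =
      (∫ x, ⟪ws i x, fderiv ℝ u x (ws i x)⟫) + ∫ x, ⟪ws i x, convect w (us i) x⟫ := by
    intro i
    have h1 : (fun x => ⟪fderiv ℝ w x (e i), fderiv ℝ F x (e i)⟫) =
        fun x => ⟪ws i x, fderiv ℝ u x (ws i x)⟫ + ⟪ws i x, convect w (us i) x⟫ :=
      funext fun x => by rw [hdF i x, inner_add_right, hws]
    rw [h1, integral_add (i2a i) (i2b i)]
  have hL' : ∫ x, ⟪(Δ w) x, F x⟫ = - ∫ x, ∑ i, ⟪fderiv ℝ w x (e i), fderiv ℝ F x (e i)⟫ := by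
    rw [hL, neg_neg]
  have i2a' : ∀ i, Integrable (fun x => ⟪fderiv ℝ w x (e i), fderiv ℝ u x (fderiv ℝ w x (e i))⟫)
      volume := fun i => by
    have h := i2a i
    rw [hws] at h
    exact h
  have i2b' : ∀ i, Integrable (fun x => ⟪fderiv ℝ w x (e i),
      convect w (fun y => fderiv ℝ u y (e i)) x⟫) volume := fun i => by
    have h := i2b i
    rw [hws, hus] at h
    exact h
  refine ⟨integrable_finsetSum _ fun i _ => i2a' i, integrable_finsetSum _ fun i _ => i2b' i, ?_⟩
  rw [← hFdef, hL', integral_finsetSum _ fun i _ => i2 i, Finset.sum_congr rfl fun i _ => hsplit i,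
    Finset.sum_add_distrib, ← integral_finsetSum _ fun i _ => i2a i,
    ← integral_finsetSum _ fun i _ => i2b i, hws, hus]
  ring

/-- `2Ls ≤ κ s² + L²/κ` for `κ > 0`. [folklore] -/
private theorem r3rob_two_mul_le_kappa {L s κ : ℝ} (hκ : 0 < κ) : 2 * L * s ≤ κ * s ^ 2 + L ^ 2 / κ := by
  have h : 2 * L * s - κ * s ^ 2 ≤ L ^ 2 / κ := by
    rw [le_div_iff₀ hκ]
    nlinarith [sq_nonneg (κ * s - L)]
  linarith


/-- `∫⁻‖a + b‖² < ∞` from `∫⁻‖a‖², ∫⁻‖b‖² < ∞`. [folklore] -/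
private theorem r3rob_lintegral_sq_add_lt_top {G : Type*} [NormedAddCommGroup G]
    {a b : EuclideanSpace ℝ (Fin 3) → G}
    (ham : AEStronglyMeasurable a volume) (ha : ∫⁻ x, ‖a x‖ₑ ^ 2 < ⊤)
    (hb : ∫⁻ x, ‖b x‖ₑ ^ 2 < ⊤) : ∫⁻ x, ‖a x + b x‖ₑ ^ 2 < ⊤ := by
  have h := lintegral_enorm_sq_sub_le (g := fun x => -b x) ham (μ := volume)
  have e : ∀ x, a x + b x = a x - -b x := fun x => by rw [sub_neg_eq_add]
  simp_rw [e]
  refine lt_of_le_of_lt h ?_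
  simp_rw [enorm_neg]
  exact ENNReal.add_lt_top.2 ⟨ENNReal.mul_lt_top (by simp) ha, ENNReal.mul_lt_top (by simp) hb⟩

/-- `∫⁻‖a − b‖² < ∞` from `∫⁻‖a‖², ∫⁻‖b‖² < ∞`. [folklore] -/
private theorem r3rob_lintegral_sq_sub_lt_top {G : Type*} [NormedAddCommGroup G]
    {a b : EuclideanSpace ℝ (Fin 3) → G}
    (ham : AEStronglyMeasurable a volume) (ha : ∫⁻ x, ‖a x‖ₑ ^ 2 < ⊤)
    (hb : ∫⁻ x, ‖b x‖ₑ ^ 2 < ⊤) : ∫⁻ x, ‖a x - b x‖ₑ ^ 2 < ⊤ :=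
  lt_of_le_of_lt (lintegral_enorm_sq_sub_le (g := b) ham (μ := volume))
    (ENNReal.add_lt_top.2 ⟨ENNReal.mul_lt_top (by simp) ha, ENNReal.mul_lt_top (by simp) hb⟩)

/-- `∫⁻‖c • a‖² < ∞` from `∫⁻‖a‖² < ∞`. [folklore] -/
private theorem r3rob_lintegral_sq_smul_lt_top {G : Type*} [NormedAddCommGroup G] [NormedSpace ℝ G]
    {a : EuclideanSpace ℝ (Fin 3) → G} (c : ℝ) (ha : ∫⁻ x, ‖a x‖ₑ ^ 2 < ⊤) : ∫⁻ x, ‖c • a x‖ₑ ^ 2 <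
    ⊤ := by
  have e : ∀ x, ‖c • a x‖ₑ ^ 2 = ‖c‖ₑ ^ 2 * ‖a x‖ₑ ^ 2 := fun x => by rw [enorm_smul, mul_pow]
  simp_rw [e]
  rw [lintegral_const_mul' _ _ (ENNReal.pow_ne_top enorm_ne_top)]
  exact ENNReal.mul_lt_top (lt_top_iff_ne_top.2 (ENNReal.pow_ne_top enorm_ne_top)) ha

/-- Uniform `L²`-Sobolev bounds pass to slicewise differences: if `c(t) = a(t) − b(t)` on `S` with
smooth slices and `a, b` have all `L²` Sobolev norms bounded on `S`, so does `c`. [folklore] -/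
private theorem r3rob_sobolev_sub {F : Type*} [NormedAddCommGroup F] [NormedSpace ℝ F]
    {S : Set ℝ} {a b c : ℝ → EuclideanSpace ℝ (Fin 3) → F}
    (habc : ∀ t ∈ S, ∀ x, c t x = a t x - b t x) (ha : ∀ t ∈ S, ContDiff ℝ ∞ (a t))
    (hb : ∀ t ∈ S, ContDiff ℝ ∞ (b t))
    (hA : ∀ n : ℕ, ∃ C : ℝ≥0, ∀ t ∈ S, ∫⁻ x, ‖iteratedFDeriv ℝ n (a t) x‖ₑ ^ 2 ≤ C)
    (hB : ∀ n : ℕ, ∃ C : ℝ≥0, ∀ t ∈ S, ∫⁻ x, ‖iteratedFDeriv ℝ n (b t) x‖ₑ ^ 2 ≤ C) (n : ℕ) :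
    ∃ C : ℝ≥0, ∀ t ∈ S, ∫⁻ x, ‖iteratedFDeriv ℝ n (c t) x‖ₑ ^ 2 ≤ C := by
  obtain ⟨Ca, hCa⟩ := hA n
  obtain ⟨Cb, hCb⟩ := hB n
  refine ⟨2 * Ca + 2 * Cb, fun t ht => ?_⟩
  have hc : c t = a t - b t := funext fun x => by rw [Pi.sub_apply, habc t ht x]
  have hsub : ∀ x, iteratedFDeriv ℝ n (c t) x = iteratedFDeriv ℝ n (a t) x - iteratedFDeriv ℝ n (b t) x :=
    fun x => by
      rw [hc]
      exact iteratedFDeriv_sub_apply ((ha t ht).of_le (by exact_mod_cast le_top)).contDiffAt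
        ((hb t ht).of_le (by exact_mod_cast le_top)).contDiffAt
  have hm : AEStronglyMeasurable (fun x => iteratedFDeriv ℝ n (a t) x) volume :=
    ((ha t ht).continuous_iteratedFDeriv (by exact_mod_cast le_top)).aestronglyMeasurable
  calc ∫⁻ x, ‖iteratedFDeriv ℝ n (c t) x‖ₑ ^ 2
      = ∫⁻ x, ‖iteratedFDeriv ℝ n (a t) x - iteratedFDeriv ℝ n (b t) x‖ₑ ^ 2 :=
        lintegral_congr fun x => by rw [hsub]
    _ ≤ 2 * (∫⁻ x, ‖iteratedFDeriv ℝ n (a t) x‖ₑ ^ 2) + 2 * ∫⁻ x, ‖iteratedFDeriv ℝ n (b t) x‖ₑ ^ 2 :=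
        lintegral_enorm_sq_sub_le hm
    _ ≤ 2 * (Ca : ℝ≥0∞) + 2 * (Cb : ℝ≥0∞) := by
        gcongr
        · exact hCa t ht
        · exact hCb t ht
    _ = ((2 * Ca + 2 * Cb : ℝ≥0) : ℝ≥0∞) := by push_cast; rfl

/-- Order-zero Sobolev bound, unfolded: `∫⁻‖g‖² < ∞`. [folklore] -/
private theorem r3rob_l2_of_order_zero {F : Type*} [NormedAddCommGroup F] [NormedSpace ℝ F]
    {g : EuclideanSpace ℝ (Fin 3) → F} {C : ℝ≥0} (h : ∫⁻ x, ‖iteratedFDeriv ℝ 0 g x‖ₑ ^ 2 ≤ C) :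
    ∫⁻ x, ‖g x‖ₑ ^ 2 < ⊤ := by
  refine lt_of_le_of_lt ((le_of_eq (lintegral_congr fun x => ?_)).trans h) ENNReal.coe_lt_top
  rw [← ofReal_norm, ← ofReal_norm, norm_iteratedFDeriv_zero]

/-- Uniform-in-time Sobolev bound, at one time: `∫⁻‖Dⁿ(c t)‖² < ∞`. [folklore] -/
private theorem r3rob_fin {F : Type*} [NormedAddCommGroup F] [NormedSpace ℝ F] {S : Set ℝ}
    {c : ℝ → EuclideanSpace ℝ (Fin 3) → F} {t : ℝ} (ht : t ∈ S) (n : ℕ)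
    (hC : ∃ C : ℝ≥0, ∀ s ∈ S, ∫⁻ x, ‖iteratedFDeriv ℝ n (c s) x‖ₑ ^ 2 ≤ C) :
    ∫⁻ x, ‖iteratedFDeriv ℝ n (c t) x‖ₑ ^ 2 < ⊤ := by
  obtain ⟨C, hC⟩ := hC
  exact lt_of_le_of_lt (hC t ht) ENNReal.coe_lt_top

/-- The difference of two classical solutions (with any two forces) is divergence free. [folklore] -/
private theorem r3rob_isDivFree_sub {S : Set ℝ} {ν : ℝ}
    {f g u v : ℝ → EuclideanSpace ℝ (Fin 3) → EuclideanSpace ℝ (Fin 3)}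
    {p q : ℝ → EuclideanSpace ℝ (Fin 3) → ℝ}
    (hv : IsClassicalNSSolutionOn S ν g v q) (hu : IsClassicalNSSolutionOn S ν f u p) {t : ℝ}
    (ht : t ∈ S) : VectorCalculus.IsDivFree ((v - u) t) := by
  intro x
  have hu1 : ContDiff ℝ 1 (u t) := (hu.contDiff_velocity ht).of_le (by norm_cast)
  have hv1 : ContDiff ℝ 1 (v t) := (hv.contDiff_velocity ht).of_le (by norm_cast)
  simp only [VectorCalculus.divergence, Pi.sub_apply]
  rw [fderiv_sub (hv1.differentiable one_ne_zero x) (hu1.differentiable one_ne_zero x)]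
  have := hu.divFree t ht x
  have := hv.divFree t ht x
  simp only [VectorCalculus.divergence] at *
  simp [map_sub, *]

/-- **`∂ᵥ∇π = ∇∂ᵥπ`** for a `C²` scalar field on `ℝ³` (Schwarz). [folklore] -/
private theorem r3rob_fderiv_gradient_apply {π : EuclideanSpace ℝ (Fin 3) → ℝ} (hπ : ContDiff ℝ 2 π)
    (x v : EuclideanSpace ℝ (Fin 3)) :
    fderiv ℝ (gradient π) x v = gradient (fun y => fderiv ℝ π y v) x := by
  have hd : DifferentiableAt ℝ (fderiv ℝ π) x :=
    ((hπ.fderiv_right (m := 1) (by norm_num)).differentiable one_ne_zero) x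
  have hdg : DifferentiableAt ℝ (gradient π) x := by
    show DifferentiableAt ℝ
      (fun y => (InnerProductSpace.toDual ℝ (EuclideanSpace ℝ (Fin 3))).symm (fderiv ℝ π y)) x
    exact ((InnerProductSpace.toDual ℝ (EuclideanSpace ℝ (Fin 3))).symm.differentiable.differentiableAt).comp
      x hd
  refine ext_inner_right ℝ fun a => ?_
  have key : ∀ (φ : EuclideanSpace ℝ (Fin 3) → ℝ) (y : EuclideanSpace ℝ (Fin 3)),
      ⟪gradient φ y, a⟫ = fderiv ℝ φ y a := fun φ y => by
    rw [gradient, InnerProductSpace.toDual_symm_apply]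
  have h1 : fderiv ℝ (fun y => ⟪gradient π y, a⟫) x v = ⟪fderiv ℝ (gradient π) x v, a⟫ := by
    rw [fderiv_inner_apply ℝ hdg (differentiableAt_const a)]
    simp
  have h2 : (fun y => ⟪gradient π y, a⟫) = fun y => fderiv ℝ π y a := funext fun y => key π y
  rw [← h1, h2, key, fderiv_fderiv_apply_comm_of_contDiff_two hπ x a v]

/-- `∫‖Δw‖² ≤ 3 Σᵢ ∫|∇(∂ᵢw)|²_F` (pointwise `Δw = Σᵢ ∂ᵢ(∂ᵢw)` and Cauchy–Schwarz). [folklore] -/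
private theorem r3rob_integral_laplacian_sq_le_three_mul_sum
    {w : EuclideanSpace ℝ (Fin 3) → EuclideanSpace ℝ (Fin 3)} (hw : ContDiff ℝ ∞ w)
    (hX : ∀ i, Integrable (fun x => frobeniusNormSq
      (fderiv ℝ (fun y => fderiv ℝ w y (EuclideanSpace.basisFun (Fin 3) ℝ i)) x)) volume) :
    ∫ x, ‖(Δ w) x‖ ^ 2 ≤
      3 * ∑ i, ∫ x, frobeniusNormSq
        (fderiv ℝ (fun y => fderiv ℝ w y (EuclideanSpace.basisFun (Fin 3) ℝ i)) x) := by
  set e := EuclideanSpace.basisFun (Fin 3) ℝ with he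
  have hw2 : ContDiff ℝ 2 w := hw.of_le (by norm_cast)
  -- `(a + b + c)² ≤ 3(a² + b² + c²)`
  have h3 : ∀ a b c : ℝ, (a + b + c) ^ 2 ≤ 3 * (a ^ 2 + b ^ 2 + c ^ 2) := fun a b c => by
    nlinarith [sq_nonneg (a - b), sq_nonneg (b - c), sq_nonneg (a - c)]
  -- pointwise bound
  have hpt : ∀ x, ‖(Δ w) x‖ ^ 2 ≤
      3 * ∑ i, frobeniusNormSq (fderiv ℝ (fun y => fderiv ℝ w y (e i)) x) := by
    intro x
    have hd : DifferentiableAt ℝ (fderiv ℝ w) x :=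
      ((hw2.fderiv_right (m := 1) le_rfl).differentiable one_ne_zero) x
    have hΔ : (Δ w) x = ∑ i, fderiv ℝ (fun y => fderiv ℝ w y (e i)) x (e i) := by
      rw [laplacian_eq_iteratedFDeriv_orthonormalBasis w e]
      refine Finset.sum_congr rfl fun i _ => ?_
      rw [iteratedFDeriv_two_apply, FluidPDE.fderiv_apply_const_apply hd (e i) (e i)]
      rfl
    have hi : ∀ i, ‖fderiv ℝ (fun y => fderiv ℝ w y (e i)) x (e i)‖ ^ 2 ≤
        frobeniusNormSq (fderiv ℝ (fun y => fderiv ℝ w y (e i)) x) := fun i => by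
      rw [frobeniusNormSq_eq_sum e]
      exact Finset.single_le_sum
        (f := fun k => ‖fderiv ℝ (fun y => fderiv ℝ w y (e i)) x (e k)‖ ^ 2)
        (fun k _ => sq_nonneg _) (Finset.mem_univ i)
    rw [hΔ]
    have hns := norm_sum_le (Finset.univ : Finset (Fin 3))
      (fun i => fderiv ℝ (fun y => fderiv ℝ w y (e i)) x (e i))
    generalize hq : (fun i => fderiv ℝ (fun y => fderiv ℝ w y (e i)) x) = q at *
    have hq' : ∀ i, fderiv ℝ (fun y => fderiv ℝ w y (e i)) x = q i := fun i => by rw [← hq]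
    simp only [hq'] at hns hi ⊢
    rw [Fin.sum_univ_three, Fin.sum_univ_three] at hns
    rw [Fin.sum_univ_three, Fin.sum_univ_three]
    have h0 := norm_nonneg (q 0 (e 0) + q 1 (e 1) + q 2 (e 2))
    calc ‖q 0 (e 0) + q 1 (e 1) + q 2 (e 2)‖ ^ 2
        ≤ (‖q 0 (e 0)‖ + ‖q 1 (e 1)‖ + ‖q 2 (e 2)‖) ^ 2 := pow_le_pow_left₀ h0 hns 2
      _ ≤ 3 * (‖q 0 (e 0)‖ ^ 2 + ‖q 1 (e 1)‖ ^ 2 + ‖q 2 (e 2)‖ ^ 2) := h3 _ _ _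
      _ ≤ 3 * (frobeniusNormSq (q 0) + frobeniusNormSq (q 1) + frobeniusNormSq (q 2)) := by
          linarith [hi 0, hi 1, hi 2]
  have iS : Integrable (fun x => ∑ i, frobeniusNormSq (fderiv ℝ (fun y => fderiv ℝ w y (e i)) x))
      volume := integrable_finsetSum _ fun i _ => hX i
  have hR : (∫ x, 3 * ∑ i, frobeniusNormSq (fderiv ℝ (fun y => fderiv ℝ w y (e i)) x)) =
      3 * ∑ i, ∫ x, frobeniusNormSq (fderiv ℝ (fun y => fderiv ℝ w y (e i)) x) := by
    rw [integral_const_mul, integral_finsetSum _ fun i _ => hX i]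
  by_cases hint : Integrable (fun x => ‖(Δ w) x‖ ^ 2) volume
  · rw [← hR]
    exact integral_mono hint (iS.const_mul 3) fun x => hpt x
  · rw [integral_undef hint]
    exact mul_nonneg (by norm_num) (Finset.sum_nonneg fun i _ =>
      integral_nonneg fun x => frobeniusNormSq_nonneg _)


/-- `∫|∇z|²_F < ∞` for a `C¹` field with `Dz ∈ L²` (`|·|²_F ≤ 3‖·‖²` on `ℝ³`). [folklore] -/
private theorem r3rob_integrable_frobeniusNormSq
    {z : EuclideanSpace ℝ (Fin 3) → EuclideanSpace ℝ (Fin 3)} (hz : ContDiff ℝ 1 z)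
    (hz1 : ∫⁻ x, ‖iteratedFDeriv ℝ 1 z x‖ₑ ^ 2 < ⊤) :
    Integrable (fun x => frobeniusNormSq (fderiv ℝ z x)) volume := by
  refine integrable_of_continuous_of_nonneg
    (FluidPDE.continuous_frobeniusNormSq_fderiv hz one_ne_zero) (fun x => frobeniusNormSq_nonneg _) ?_
  calc ∫⁻ x, ENNReal.ofReal (frobeniusNormSq (fderiv ℝ z x))
      ≤ ∫⁻ x, 3 * ‖iteratedFDeriv ℝ 1 z x‖ₑ ^ 2 :=
        lintegral_mono fun x => by
          rw [← ofReal_norm, norm_iteratedFDeriv_one, ofReal_norm]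
          exact ofReal_frobeniusNormSq_le_three_mul_enorm_sq _
    _ = 3 * ∫⁻ x, ‖iteratedFDeriv ℝ 1 z x‖ₑ ^ 2 := lintegral_const_mul' _ _ (by norm_num)
    _ < ⊤ := ENNReal.mul_lt_top (by norm_num) hz1

/-- A bound `G` of the compression rate of a divergence-free field on `ℝ³` is nonnegative (the
trace `Σᵢ⟪Du eᵢ, eᵢ⟫ = div u` vanishes). [folklore] -/
private theorem r3rob_compressionRate_nonneg
    {u₀ : EuclideanSpace ℝ (Fin 3) → EuclideanSpace ℝ (Fin 3)} (hdiv : VectorCalculus.IsDivFree u₀)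
    {G : ℝ} (hG : ∀ (x ξ : EuclideanSpace ℝ (Fin 3)), -⟪fderiv ℝ u₀ x ξ, ξ⟫ ≤ G * ‖ξ‖ ^ 2) :
    0 ≤ G := by
  have hd := hdiv 0
  rw [divergence_eq_sum_inner_fderiv (EuclideanSpace.basisFun (Fin 3) ℝ), Fin.sum_univ_three] at hd
  have he : ∀ i, ‖EuclideanSpace.basisFun (Fin 3) ℝ i‖ = 1 := fun i => by simp
  have h0 := hG 0 (EuclideanSpace.basisFun (Fin 3) ℝ 0)
  have h1 := hG 0 (EuclideanSpace.basisFun (Fin 3) ℝ 1)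
  have h2 := hG 0 (EuclideanSpace.basisFun (Fin 3) ℝ 2)
  rw [he, one_pow, mul_one, real_inner_comm] at h0 h1 h2
  linarith

end Helpers

/-! ## §B The `H²` level (Dashti–Robinson 2008, Thm 2, in strain form): slice calculus -/

section H2

/-- **Three-field integration by parts for a convective pairing**: for `C^∞` fields `a, b, c` on
`ℝ³` with `Da, D²a ∈ L²`, `b, Db ∈ L²` and `Dc, D²c` bounded,
`∫⟪Δa, (b·∇)c⟫ = −Σⱼ∫⟪∂ⱼa, Dc(∂ⱼb)⟫ − Σⱼ∫⟪∂ⱼa, (b·∇)∂ⱼc⟫` (the case `a = b` is the stretching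
identity of §4b). [folklore] -/
private theorem r3rob_integral_inner_laplacian_convect3
    {a b c : EuclideanSpace ℝ (Fin 3) → EuclideanSpace ℝ (Fin 3)} (ha : ContDiff ℝ ∞ a)
    (hb : ContDiff ℝ ∞ b) (hc : ContDiff ℝ ∞ c)
    {C₁ : ℝ} (hC₁ : ∀ x, ‖fderiv ℝ c x‖ ≤ C₁) {C₂ : ℝ} (hC₂ : ∀ x, ‖iteratedFDeriv ℝ 2 c x‖ ≤ C₂)
    (hb0 : ∫⁻ x, ‖b x‖ₑ ^ 2 < ⊤) (hb1 : ∫⁻ x, ‖fderiv ℝ b x‖ₑ ^ 2 < ⊤)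
    (ha1 : ∫⁻ x, ‖fderiv ℝ a x‖ₑ ^ 2 < ⊤) (ha2 : ∫⁻ x, ‖iteratedFDeriv ℝ 2 a x‖ₑ ^ 2 < ⊤) :
    (Integrable (fun x => ∑ j, ⟪fderiv ℝ a x (EuclideanSpace.basisFun (Fin 3) ℝ j),
        fderiv ℝ c x (fderiv ℝ b x (EuclideanSpace.basisFun (Fin 3) ℝ j))⟫) volume) ∧
    (Integrable (fun x => ∑ j, ⟪fderiv ℝ a x (EuclideanSpace.basisFun (Fin 3) ℝ j),
        convect b (fun y => fderiv ℝ c y (EuclideanSpace.basisFun (Fin 3) ℝ j)) x⟫) volume) ∧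
    ∫ x, ⟪(Δ a) x, convect b c x⟫ =
      - (∫ x, ∑ j, ⟪fderiv ℝ a x (EuclideanSpace.basisFun (Fin 3) ℝ j),
          fderiv ℝ c x (fderiv ℝ b x (EuclideanSpace.basisFun (Fin 3) ℝ j))⟫)
      - ∫ x, ∑ j, ⟪fderiv ℝ a x (EuclideanSpace.basisFun (Fin 3) ℝ j),
          convect b (fun y => fderiv ℝ c y (EuclideanSpace.basisFun (Fin 3) ℝ j)) x⟫ := by
  set e := EuclideanSpace.basisFun (Fin 3) ℝ with he
  have he1 : ∀ i, ‖e i‖ = 1 := fun i => by simp [he]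
  have hC₁0 : 0 ≤ C₁ := (norm_nonneg _).trans (hC₁ 0)
  have hC₂0 : 0 ≤ C₂ := (norm_nonneg _).trans (hC₂ 0)
  have ha2' : ContDiff ℝ 2 a := ha.of_le (by norm_cast)
  have ha1' : ContDiff ℝ 1 a := ha.of_le (by norm_cast)
  have hb1' : ContDiff ℝ 1 b := hb.of_le (by norm_cast)
  have hc1' : ContDiff ℝ 1 c := hc.of_le (by norm_cast)
  obtain ⟨F, hFdef⟩ : ∃ F : EuclideanSpace ℝ (Fin 3) → EuclideanSpace ℝ (Fin 3),
      F = convect b c := ⟨_, rfl⟩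
  have hF : ContDiff ℝ 1 F := by
    rw [hFdef]; exact (hc.fderiv_right (m := 1) (by norm_cast)).clm_apply hb1'
  -- slices
  obtain ⟨as, has⟩ : ∃ as : Fin 3 → EuclideanSpace ℝ (Fin 3) → EuclideanSpace ℝ (Fin 3),
      as = fun j y => fderiv ℝ a y (e j) := ⟨_, rfl⟩
  obtain ⟨bs, hbs⟩ : ∃ bs : Fin 3 → EuclideanSpace ℝ (Fin 3) → EuclideanSpace ℝ (Fin 3),
      bs = fun j y => fderiv ℝ b y (e j) := ⟨_, rfl⟩
  obtain ⟨cs, hcs⟩ : ∃ cs : Fin 3 → EuclideanSpace ℝ (Fin 3) → EuclideanSpace ℝ (Fin 3),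
      cs = fun j y => fderiv ℝ c y (e j) := ⟨_, rfl⟩
  have has2 : ∀ j, ContDiff ℝ 2 (as j) := fun j => by
    rw [has]; exact (ha.fderiv_right (m := 2) (by norm_cast)).clm_apply contDiff_const
  have has1 : ∀ j, ContDiff ℝ 1 (as j) := fun j => (has2 j).of_le (by norm_num)
  have hcs1 : ∀ j, ContDiff ℝ 1 (cs j) := fun j => by
    rw [hcs]; exact (hc.fderiv_right (m := 1) (by norm_cast)).clm_apply contDiff_const
  -- continuity
  have cb : Continuous b := hb.continuous
  have cDa : Continuous (fderiv ℝ a) := ha1'.continuous_fderiv one_ne_zero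
  have cDb : Continuous (fderiv ℝ b) := hb1'.continuous_fderiv one_ne_zero
  have cDc : Continuous (fderiv ℝ c) := hc1'.continuous_fderiv one_ne_zero
  have cas : ∀ j, Continuous (as j) := fun j => (has1 j).continuous
  have cbs : ∀ j, Continuous (bs j) := fun j => by rw [hbs]; exact cDb.clm_apply continuous_const
  have cDas : ∀ j, Continuous (fderiv ℝ (as j)) := fun j => (has1 j).continuous_fderiv one_ne_zero
  have cDcs : ∀ j, Continuous (fderiv ℝ (cs j)) := fun j => (hcs1 j).continuous_fderiv one_ne_zero
  have cdda : ∀ j, Continuous fun x => fderiv ℝ (as j) x (e j) := fun j =>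
    (cDas j).clm_apply continuous_const
  have cF : Continuous F := by rw [hFdef]; exact cDc.clm_apply cb
  -- pointwise norm bounds
  have n_as : ∀ j x, ‖as j x‖ ≤ ‖fderiv ℝ a x‖ := fun j x => by
    rw [has]; simpa [he1] using (fderiv ℝ a x).le_opNorm (e j)
  have n_bs : ∀ j x, ‖bs j x‖ ≤ ‖fderiv ℝ b x‖ := fun j x => by
    rw [hbs]; simpa [he1] using (fderiv ℝ b x).le_opNorm (e j)
  have n_Das : ∀ j x, ‖fderiv ℝ (as j) x‖ ≤ ‖iteratedFDeriv ℝ 2 a x‖ := fun j x => by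
    have h : ‖fderiv ℝ (as j) x‖ = ‖iteratedFDeriv ℝ 1 (as j) x‖ := by
      rw [← norm_iteratedFDeriv_fderiv, norm_iteratedFDeriv_zero]
    rw [h, has]
    exact norm_iteratedFDeriv_fderiv_apply_basisFun_le ha 1 (by norm_cast) x j
  have n_dda : ∀ j x, ‖fderiv ℝ (as j) x (e j)‖ ≤ ‖iteratedFDeriv ℝ 2 a x‖ := fun j x => by
    have h1 : ‖fderiv ℝ (as j) x (e j)‖ ≤ ‖fderiv ℝ (as j) x‖ := by
      simpa [he1] using (fderiv ℝ (as j) x).le_opNorm (e j)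
    exact h1.trans (n_Das j x)
  have n_Dcs : ∀ j x, ‖fderiv ℝ (cs j) x‖ ≤ C₂ := fun j x => by
    have h : ‖fderiv ℝ (cs j) x‖ = ‖iteratedFDeriv ℝ 1 (cs j) x‖ := by
      rw [← norm_iteratedFDeriv_fderiv, norm_iteratedFDeriv_zero]
    rw [h, hcs]
    exact (norm_iteratedFDeriv_fderiv_apply_basisFun_le hc 1 (by norm_cast) x j).trans (hC₂ x)
  have n_F : ∀ x, ‖F x‖ ≤ ‖C₁ * ‖b x‖‖ := fun x => by
    rw [hFdef, convect, Real.norm_of_nonneg (mul_nonneg hC₁0 (norm_nonneg _))]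
    exact (fderiv ℝ c x).le_of_opNorm_le (hC₁ x) (b x)
  -- finite `L²` norms
  have l2as : ∀ j, ∫⁻ x, ‖as j x‖ₑ ^ 2 < ⊤ := fun j =>
    lintegral_enorm_sq_lt_top_of_norm_le (n_as j) ha1
  have l2dda : ∀ j, ∫⁻ x, ‖fderiv ℝ (as j) x (e j)‖ₑ ^ 2 < ⊤ := fun j =>
    lintegral_enorm_sq_lt_top_of_norm_le (n_dda j) ha2
  have l2F : ∫⁻ x, ‖F x‖ₑ ^ 2 < ⊤ :=
    lintegral_enorm_sq_lt_top_of_norm_le n_F (r3rob_lintegral_sq_mul_norm_lt_top C₁ hb0)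
  -- the derivative of `F`: `∂ⱼF = Dc(∂ⱼb) + (b·∇)(∂ⱼc)`
  have hdF : ∀ j x, fderiv ℝ F x (e j) = fderiv ℝ c x (bs j x) + convect b (cs j) x := by
    intro j x
    rw [hFdef, fderiv_convect_apply_of_contDiff hb hc x (e j), hbs, hcs]
  have n_pa : ∀ j x, ‖fderiv ℝ c x (bs j x)‖ ≤ ‖C₁ * ‖fderiv ℝ b x‖‖ := fun j x => by
    rw [Real.norm_of_nonneg (mul_nonneg hC₁0 (norm_nonneg _))]
    exact ((fderiv ℝ c x).le_of_opNorm_le (hC₁ x) (bs j x)).trans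
      (mul_le_mul_of_nonneg_left (n_bs j x) hC₁0)
  have n_pb : ∀ j x, ‖convect b (cs j) x‖ ≤ ‖C₂ * ‖b x‖‖ := fun j x => by
    rw [convect, Real.norm_of_nonneg (mul_nonneg hC₂0 (norm_nonneg _))]
    exact (fderiv ℝ (cs j) x).le_of_opNorm_le (n_Dcs j x) (b x)
  have cpa : ∀ j, Continuous fun x => fderiv ℝ c x (bs j x) := fun j => cDc.clm_apply (cbs j)
  have cpb : ∀ j, Continuous (convect b (cs j)) := fun j => (cDcs j).clm_apply cb
  have l2pa : ∀ j, ∫⁻ x, ‖fderiv ℝ c x (bs j x)‖ₑ ^ 2 < ⊤ := fun j =>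
    lintegral_enorm_sq_lt_top_of_norm_le (n_pa j) (r3rob_lintegral_sq_mul_norm_lt_top C₁ hb1)
  have l2pb : ∀ j, ∫⁻ x, ‖convect b (cs j) x‖ₑ ^ 2 < ⊤ := fun j =>
    lintegral_enorm_sq_lt_top_of_norm_le (n_pb j) (r3rob_lintegral_sq_mul_norm_lt_top C₂ hb0)
  have i2a : ∀ j, Integrable (fun x => ⟪as j x, fderiv ℝ c x (bs j x)⟫) volume := fun j =>
    integrable_of_norm_le_mul_of_lintegral_sq ((cas j).inner (cpa j)).aestronglyMeasurable (cas j)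
      (cpa j) (l2as j) (l2pa j) fun x => norm_inner_le_norm _ _
  have i2b : ∀ j, Integrable (fun x => ⟪as j x, convect b (cs j) x⟫) volume := fun j =>
    integrable_of_norm_le_mul_of_lintegral_sq ((cas j).inner (cpb j)).aestronglyMeasurable (cas j)
      (cpb j) (l2as j) (l2pb j) fun x => norm_inner_le_norm _ _
  -- integrability for the integration by parts
  have i1 : ∀ j, Integrable (fun x => ⟪fderiv ℝ (fun y => fderiv ℝ a y (e j)) x (e j), F x⟫)
      volume := fun j => by
    have h : Integrable (fun x => ⟪fderiv ℝ (as j) x (e j), F x⟫) volume :=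
      integrable_of_norm_le_mul_of_lintegral_sq ((cdda j).inner cF).aestronglyMeasurable (cdda j)
        cF (l2dda j) l2F fun x => norm_inner_le_norm _ _
    rw [has] at h
    exact h
  have i2 : ∀ j, Integrable (fun x => ⟪fderiv ℝ a x (e j), fderiv ℝ F x (e j)⟫) volume :=
    fun j => by
    have h := (i2a j).add (i2b j)
    refine h.congr (Eventually.of_forall fun x => ?_)
    simp only [Pi.add_apply, hdF j x, inner_add_right, has]
  have i3 : ∀ j, Integrable (fun x => ⟪fderiv ℝ a x (e j), F x⟫) volume := fun j => by
    have h : Integrable (fun x => ⟪as j x, F x⟫) volume :=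
      integrable_of_norm_le_mul_of_lintegral_sq ((cas j).inner cF).aestronglyMeasurable (cas j)
        cF (l2as j) l2F fun x => norm_inner_le_norm _ _
    rw [has] at h
    exact h
  -- integration by parts
  have hL := integral_sum_inner_fderiv_fderiv_eq_neg_integral_inner_laplacian ha2' hF i1 i2 i3
  have hsplit : ∀ j, ∫ x, ⟪fderiv ℝ a x (e j), fderiv ℝ F x (e j)⟫ =
      (∫ x, ⟪as j x, fderiv ℝ c x (bs j x)⟫) + ∫ x, ⟪as j x, convect b (cs j) x⟫ := by
    intro j
    have h1 : (fun x => ⟪fderiv ℝ a x (e j), fderiv ℝ F x (e j)⟫) =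
        fun x => ⟪as j x, fderiv ℝ c x (bs j x)⟫ + ⟪as j x, convect b (cs j) x⟫ :=
      funext fun x => by rw [hdF j x, inner_add_right, has]
    rw [h1, integral_add (i2a j) (i2b j)]
  have hL' : ∫ x, ⟪(Δ a) x, F x⟫ = - ∫ x, ∑ j, ⟪fderiv ℝ a x (e j), fderiv ℝ F x (e j)⟫ := by
    rw [hL, neg_neg]
  have i2a' : ∀ j, Integrable (fun x => ⟪fderiv ℝ a x (e j),
      fderiv ℝ c x (fderiv ℝ b x (e j))⟫) volume := fun j => by
    have h := i2a j
    rw [has, hbs] at h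
    exact h
  have i2b' : ∀ j, Integrable (fun x => ⟪fderiv ℝ a x (e j),
      convect b (fun y => fderiv ℝ c y (e j)) x⟫) volume := fun j => by
    have h := i2b j
    rw [has, hcs] at h
    exact h
  refine ⟨integrable_finsetSum _ fun j _ => i2a' j, integrable_finsetSum _ fun j _ => i2b' j, ?_⟩
  rw [← hFdef, hL', integral_finsetSum _ fun j _ => i2 j, Finset.sum_congr rfl fun j _ => hsplit j,
    Finset.sum_add_distrib, ← integral_finsetSum _ fun j _ => i2a j,
    ← integral_finsetSum _ fun j _ => i2b j, has, hbs, hcs]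
  ring

/-- `∫ ‖a‖‖b‖ ≤ √(∫|·|²_F-majorant) …`: Cauchy–Schwarz with operator norms bounded by Frobenius
norms, the shape used for every cross term below. [folklore] -/
private theorem r3rob_integral_opNorm_mul_le {a c : EuclideanSpace ℝ (Fin 3) → EuclideanSpace ℝ (Fin 3)}
    (ha : ContDiff ℝ 1 a) (hc : ContDiff ℝ 1 c)
    (ha1 : ∫⁻ x, ‖fderiv ℝ a x‖ₑ ^ 2 < ⊤) (hc1 : ∫⁻ x, ‖fderiv ℝ c x‖ₑ ^ 2 < ⊤)
    (haF : ∫⁻ x, ENNReal.ofReal (frobeniusNormSq (fderiv ℝ a x)) < ⊤)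
    (hcF : ∫⁻ x, ENNReal.ofReal (frobeniusNormSq (fderiv ℝ c x)) < ⊤) :
    Integrable (fun x => ‖fderiv ℝ a x‖ * ‖fderiv ℝ c x‖) volume ∧
    ∫ x, ‖fderiv ℝ a x‖ * ‖fderiv ℝ c x‖ ≤
      Real.sqrt (∫ x, frobeniusNormSq (fderiv ℝ a x)) *
        Real.sqrt (∫ x, frobeniusNormSq (fderiv ℝ c x)) := by
  have cDa : Continuous (fderiv ℝ a) := ha.continuous_fderiv one_ne_zero
  have cDc : Continuous (fderiv ℝ c) := hc.continuous_fderiv one_ne_zero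
  have mDa : MemLp (fderiv ℝ a) 2 volume := r3rob_memLp_two cDa ha1
  have mDc : MemLp (fderiv ℝ c) 2 volume := r3rob_memLp_two cDc hc1
  have hcs := integral_norm_mul_norm_le_sqrt_mul_sqrt mDa mDc
  have iprod : Integrable (fun x => ‖fderiv ℝ a x‖ * ‖fderiv ℝ c x‖) volume :=
    integrable_of_norm_le_mul_of_lintegral_sq ((cDa.norm.mul cDc.norm).aestronglyMeasurable) cDa cDc
      ha1 hc1 (fun x => by rw [Real.norm_of_nonneg (mul_nonneg (norm_nonneg _) (norm_nonneg _))])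
  have ifa : Integrable (fun x => frobeniusNormSq (fderiv ℝ a x)) volume :=
    integrable_of_continuous_of_nonneg (FluidPDE.continuous_frobeniusNormSq_fderiv ha one_ne_zero)
      (fun x => frobeniusNormSq_nonneg _) haF
  have ifc : Integrable (fun x => frobeniusNormSq (fderiv ℝ c x)) volume :=
    integrable_of_continuous_of_nonneg (FluidPDE.continuous_frobeniusNormSq_fderiv hc one_ne_zero)
      (fun x => frobeniusNormSq_nonneg _) hcF
  have hXa : Real.sqrt (∫ x, ‖fderiv ℝ a x‖ ^ 2) ≤ Real.sqrt (∫ x, frobeniusNormSq (fderiv ℝ a x)) :=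
    Real.sqrt_le_sqrt (integral_mono (FluidPDE.integrable_sq_norm_of_lintegral_lt_top cDa ha1) ifa
      fun x => FluidPDE.sq_opNorm_le_frobeniusNormSq _)
  have hXc : Real.sqrt (∫ x, ‖fderiv ℝ c x‖ ^ 2) ≤ Real.sqrt (∫ x, frobeniusNormSq (fderiv ℝ c x)) :=
    Real.sqrt_le_sqrt (integral_mono (FluidPDE.integrable_sq_norm_of_lintegral_lt_top cDc hc1) ifc
      fun x => FluidPDE.sq_opNorm_le_frobeniusNormSq _)
  exact ⟨iprod, hcs.trans (mul_le_mul hXa hXc (Real.sqrt_nonneg _) (Real.sqrt_nonneg _))⟩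

/-- **The six `H²`-level pairings in one direction** (Dashti–Robinson 2008, proof of Thm 2, in
strain form). For `C^∞` fields on `ℝ³`: `u` (reference, `div u = 0`, strain rate `G`, `‖D²u‖ ≤ σ₂`),
`w` (the difference), `a` (playing `∂ᵢw`) and `b` (playing `∂ᵢu`, `‖Db‖ ≤ σ₂`, `‖D²b‖ ≤ σ₃`),
with `Xa = ∫|∇a|²_F`, `Ya = ∫‖Δa‖²`, `X₁ = ∫|∇w|²_F`, `‖w‖ ≤ M_w`, `‖w‖_{L²} ≤ L`:
`∫⟪(u·∇)a + (w·∇)a + (a·∇)u + (w·∇)b + Dw(b) + Dw(a), Δa⟫ + ∫Σⱼ⟪∂ⱼa, D(∂ⱼw)(b)⟫`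
`  ≤ 2G·Xa + 9σ₂√X₁√Xa + 3σ₃L√Xa + M_w√Xa√Ya + A(XaYa)^{1/4}√X₁√Ya`
(the last integral is the part of `∫⟪Dw(b), Δa⟫` that only the sum over directions controls,
by the symmetry of second derivatives). [folklore] -/
private theorem r3rob_H2_pairings {u w a b : EuclideanSpace ℝ (Fin 3) → EuclideanSpace ℝ (Fin 3)}
    (hu : ContDiff ℝ ∞ u) (hw : ContDiff ℝ ∞ w) (ha : ContDiff ℝ ∞ a) (hb : ContDiff ℝ ∞ b)
    (hdivu : VectorCalculus.IsDivFree u)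
    {B : ℝ} (hB : ∀ x, ‖u x‖ ≤ B) {B₁ : ℝ} (hB₁ : ∀ x, ‖fderiv ℝ u x‖ ≤ B₁)
    {G : ℝ} (hG : ∀ x (ξ : EuclideanSpace ℝ (Fin 3)), -⟪fderiv ℝ u x ξ, ξ⟫ ≤ G * ‖ξ‖ ^ 2)
    {σ₂ : ℝ} (hσ₂ : ∀ x, ‖iteratedFDeriv ℝ 2 u x‖ ≤ σ₂)
    {σ₃ : ℝ} (hb1 : ∀ x, ‖fderiv ℝ b x‖ ≤ σ₂) (hb2 : ∀ x, ‖iteratedFDeriv ℝ 2 b x‖ ≤ σ₃)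
    (hbl0 : ∫⁻ x, ‖b x‖ₑ ^ 2 < ⊤) (hbl1 : ∫⁻ x, ‖fderiv ℝ b x‖ₑ ^ 2 < ⊤)
    (hw0 : ∫⁻ x, ‖w x‖ₑ ^ 2 < ⊤) (hw1 : ∫⁻ x, ‖iteratedFDeriv ℝ 1 w x‖ₑ ^ 2 < ⊤)
    {Bw₁ : ℝ} (hBw₁ : ∀ x, ‖fderiv ℝ w x‖ ≤ Bw₁) {Bw₂ : ℝ} (hBw₂ : ∀ x, ‖iteratedFDeriv ℝ 2 w x‖ ≤ Bw₂)
    {Mw : ℝ} (hMw0 : 0 ≤ Mw) (hMw : ∀ x, ‖w x‖ ≤ Mw) {L : ℝ} (hL : Real.sqrt (∫ x, ‖w x‖ ^ 2) ≤ L)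
    (ha0 : ∫⁻ x, ‖iteratedFDeriv ℝ 0 a x‖ₑ ^ 2 < ⊤) (ha1 : ∫⁻ x, ‖iteratedFDeriv ℝ 1 a x‖ₑ ^ 2 < ⊤)
    (ha2 : ∫⁻ x, ‖iteratedFDeriv ℝ 2 a x‖ₑ ^ 2 < ⊤) (ha3 : ∫⁻ x, ‖iteratedFDeriv ℝ 3 a x‖ₑ ^ 2 < ⊤)
    (na : ∀ x, ‖a x‖ ≤ ‖fderiv ℝ w x‖) :
    (Integrable (fun x => ∑ j, ⟪fderiv ℝ a x (EuclideanSpace.basisFun (Fin 3) ℝ j),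
        convect b (fun y => fderiv ℝ w y (EuclideanSpace.basisFun (Fin 3) ℝ j)) x⟫) volume) ∧
    (∫ x, ⟪convect u a x + convect w a x + convect a u x + convect w b x + fderiv ℝ w x (b x) +
        fderiv ℝ w x (a x), (Δ a) x⟫) +
      ∫ x, ∑ j, ⟪fderiv ℝ a x (EuclideanSpace.basisFun (Fin 3) ℝ j),
        convect b (fun y => fderiv ℝ w y (EuclideanSpace.basisFun (Fin 3) ℝ j)) x⟫ ≤
      2 * G * (∫ x, frobeniusNormSq (fderiv ℝ a x)) +
        9 * σ₂ * Real.sqrt (∫ x, frobeniusNormSq (fderiv ℝ w x)) *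
          Real.sqrt (∫ x, frobeniusNormSq (fderiv ℝ a x)) +
        3 * σ₃ * L * Real.sqrt (∫ x, frobeniusNormSq (fderiv ℝ a x)) +
        Mw * Real.sqrt (∫ x, frobeniusNormSq (fderiv ℝ a x)) * Real.sqrt (∫ x, ‖(Δ a) x‖ ^ 2) +
        agmonConst * ((∫ x, frobeniusNormSq (fderiv ℝ a x)) * (∫ x, ‖(Δ a) x‖ ^ 2)) ^ (1 / 4 : ℝ) *
          Real.sqrt (∫ x, frobeniusNormSq (fderiv ℝ w x)) * Real.sqrt (∫ x, ‖(Δ a) x‖ ^ 2) := by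
  set e := EuclideanSpace.basisFun (Fin 3) ℝ with he
  have he1 : ∀ i, ‖e i‖ = 1 := fun i => by simp [he]
  -- regularity
  have ha1' : ContDiff ℝ 1 a := ha.of_le (by norm_cast)
  have hw1' : ContDiff ℝ 1 w := hw.of_le (by norm_cast)
  have hu1' : ContDiff ℝ 1 u := hu.of_le (by norm_cast)
  have hb1' : ContDiff ℝ 1 b := hb.of_le (by norm_cast)
  have ca : Continuous a := ha.continuous
  have cw : Continuous w := hw.continuous
  have cu : Continuous u := hu.continuous
  have cb : Continuous b := hb.continuous
  have cDa : Continuous (fderiv ℝ a) := ha1'.continuous_fderiv one_ne_zero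
  have cDw : Continuous (fderiv ℝ w) := hw1'.continuous_fderiv one_ne_zero
  have cDu : Continuous (fderiv ℝ u) := hu1'.continuous_fderiv one_ne_zero
  have cDb : Continuous (fderiv ℝ b) := hb1'.continuous_fderiv one_ne_zero
  have cΔ : Continuous fun x => (Δ a) x :=
    (contDiff_one_laplacian_of_contDiff_three (ha.of_le (by norm_cast))).continuous
  have hσ₂0 : 0 ≤ σ₂ := (norm_nonneg _).trans (hσ₂ 0)
  have hσ₃0 : 0 ≤ σ₃ := (norm_nonneg _).trans (hb2 0)
  have hL0 : 0 ≤ L := (Real.sqrt_nonneg _).trans hL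
  -- `L²` data of `a` and `w`
  have ha0' : ∫⁻ x, ‖a x‖ₑ ^ 2 < ⊤ := by
    refine lt_of_le_of_lt (le_of_eq (lintegral_congr fun x => ?_)) ha0
    rw [← ofReal_norm, ← ofReal_norm, norm_iteratedFDeriv_zero]
  have hDa_eq : ∀ x, ‖fderiv ℝ a x‖ = ‖iteratedFDeriv ℝ 1 a x‖ := fun x => by
    rw [← norm_iteratedFDeriv_fderiv, norm_iteratedFDeriv_zero]
  have l2Da : ∫⁻ x, ‖fderiv ℝ a x‖ₑ ^ 2 < ⊤ :=
    lintegral_enorm_sq_lt_top_of_norm_le (fun x => (hDa_eq x).le) ha1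
  have hDw_eq : ∀ x, ‖fderiv ℝ w x‖ = ‖iteratedFDeriv ℝ 1 w x‖ := fun x => by
    rw [← norm_iteratedFDeriv_fderiv, norm_iteratedFDeriv_zero]
  have l2Dw : ∫⁻ x, ‖fderiv ℝ w x‖ₑ ^ 2 < ⊤ :=
    lintegral_enorm_sq_lt_top_of_norm_le (fun x => (hDw_eq x).le) hw1
  have haF : ∫⁻ x, ENNReal.ofReal (frobeniusNormSq (fderiv ℝ a x)) < ⊤ := by
    calc ∫⁻ x, ENNReal.ofReal (frobeniusNormSq (fderiv ℝ a x))
        ≤ ∫⁻ x, 3 * ‖iteratedFDeriv ℝ 1 a x‖ₑ ^ 2 := lintegral_mono fun x => by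
          rw [← ofReal_norm, norm_iteratedFDeriv_one, ofReal_norm]
          exact ofReal_frobeniusNormSq_le_three_mul_enorm_sq _
      _ = 3 * ∫⁻ x, ‖iteratedFDeriv ℝ 1 a x‖ₑ ^ 2 := lintegral_const_mul' _ _ (by norm_num)
      _ < ⊤ := ENNReal.mul_lt_top (by norm_num) ha1
  have hwF : ∫⁻ x, ENNReal.ofReal (frobeniusNormSq (fderiv ℝ w x)) < ⊤ := by
    calc ∫⁻ x, ENNReal.ofReal (frobeniusNormSq (fderiv ℝ w x))
        ≤ ∫⁻ x, 3 * ‖iteratedFDeriv ℝ 1 w x‖ₑ ^ 2 := lintegral_mono fun x => by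
          rw [← ofReal_norm, norm_iteratedFDeriv_one, ofReal_norm]
          exact ofReal_frobeniusNormSq_le_three_mul_enorm_sq _
      _ = 3 * ∫⁻ x, ‖iteratedFDeriv ℝ 1 w x‖ₑ ^ 2 := lintegral_const_mul' _ _ (by norm_num)
      _ < ⊤ := ENNReal.mul_lt_top (by norm_num) hw1
  have hΔ2 : ∫⁻ x, ‖(Δ a) x‖ₑ ^ 2 < ⊤ := by
    have hle : ∀ x, ‖(Δ a) x‖ ≤ ‖(3 : ℝ) • iteratedFDeriv ℝ 2 a x‖ := fun x => by
      rw [norm_smul, Real.norm_of_nonneg (by norm_num : (0 : ℝ) ≤ 3)]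
      exact norm_laplacian_le_three_mul_norm_iteratedFDeriv_two (ha.of_le (by norm_cast)) x
    have h9 : ∫⁻ x, ‖(3 : ℝ) • iteratedFDeriv ℝ 2 a x‖ₑ ^ 2 < ⊤ := by
      have e3 : ∀ x, ‖(3 : ℝ) • iteratedFDeriv ℝ 2 a x‖ₑ ^ 2 =
          ENNReal.ofReal 3 ^ 2 * ‖iteratedFDeriv ℝ 2 a x‖ₑ ^ 2 := fun x => by
        rw [enorm_smul, mul_pow, Real.enorm_eq_ofReal (by norm_num : (0 : ℝ) ≤ 3)]
      simp_rw [e3]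
      rw [lintegral_const_mul' _ _ (ENNReal.pow_ne_top ENNReal.ofReal_ne_top)]
      exact ENNReal.mul_lt_top (lt_top_iff_ne_top.2 (ENNReal.pow_ne_top ENNReal.ofReal_ne_top)) ha2
    exact lintegral_enorm_sq_lt_top_of_norm_le hle h9
  have ifa : Integrable (fun x => frobeniusNormSq (fderiv ℝ a x)) volume :=
    integrable_of_continuous_of_nonneg (FluidPDE.continuous_frobeniusNormSq_fderiv ha1' one_ne_zero)
      (fun x => frobeniusNormSq_nonneg _) haF
  -- freeze the slice quantities
  obtain ⟨Xa, hXa⟩ : ∃ X : ℝ, X = ∫ x, frobeniusNormSq (fderiv ℝ a x) := ⟨_, rfl⟩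
  obtain ⟨Ya, hYa⟩ : ∃ Y : ℝ, Y = ∫ x, ‖(Δ a) x‖ ^ 2 := ⟨_, rfl⟩
  obtain ⟨X₁, hX₁⟩ : ∃ X : ℝ, X = ∫ x, frobeniusNormSq (fderiv ℝ w x) := ⟨_, rfl⟩
  obtain ⟨A, hAdef⟩ : ∃ A : ℝ, A = agmonConst := ⟨_, rfl⟩
  rw [← hXa, ← hYa, ← hX₁, ← hAdef]
  have hA0 : 0 ≤ A := by rw [hAdef]; exact agmonConst_nonneg
  have hXa0 : 0 ≤ Xa := by rw [hXa]; exact integral_nonneg fun x => frobeniusNormSq_nonneg _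
  have hYa0 : 0 ≤ Ya := by rw [hYa]; exact integral_nonneg fun x => sq_nonneg _
  have hX₁0 : 0 ≤ X₁ := by rw [hX₁]; exact integral_nonneg fun x => frobeniusNormSq_nonneg _
  -- the two Cauchy–Schwarz cross inequalities
  have hcsaw : (∫ x, ‖fderiv ℝ a x‖ * ‖fderiv ℝ w x‖) ≤ Real.sqrt Xa * Real.sqrt X₁ := by
    rw [hXa, hX₁]; exact (r3rob_integral_opNorm_mul_le ha1' hw1' l2Da l2Dw haF hwF).2
  have iaw : Integrable (fun x => ‖fderiv ℝ a x‖ * ‖fderiv ℝ w x‖) volume :=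
    (r3rob_integral_opNorm_mul_le ha1' hw1' l2Da l2Dw haF hwF).1
  have hcsa0 : (∫ x, ‖fderiv ℝ a x‖ * ‖w x‖) ≤ Real.sqrt Xa * L := by
    have mDa : MemLp (fderiv ℝ a) 2 volume := r3rob_memLp_two cDa l2Da
    have mw : MemLp w 2 volume := r3rob_memLp_two cw hw0
    have h := integral_norm_mul_norm_le_sqrt_mul_sqrt mDa mw
    have hXop : Real.sqrt (∫ x, ‖fderiv ℝ a x‖ ^ 2) ≤ Real.sqrt Xa := by
      refine Real.sqrt_le_sqrt ?_
      rw [hXa]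
      exact integral_mono (FluidPDE.integrable_sq_norm_of_lintegral_lt_top cDa l2Da) ifa
        fun x => FluidPDE.sq_opNorm_le_frobeniusNormSq _
    exact h.trans (mul_le_mul hXop hL (Real.sqrt_nonneg _) (Real.sqrt_nonneg _ |>.trans hXop))
  have ia0 : Integrable (fun x => ‖fderiv ℝ a x‖ * ‖w x‖) volume :=
    integrable_of_norm_le_mul_of_lintegral_sq ((cDa.norm.mul cw.norm).aestronglyMeasurable) cDa cw
      l2Da hw0 (fun x => by rw [Real.norm_of_nonneg (mul_nonneg (norm_nonneg _) (norm_nonneg _))])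
  -- `‖a‖_{L²} ≤ √X₁`
  have ha_l2 : Real.sqrt (∫ x, ‖a x‖ ^ 2) ≤ Real.sqrt X₁ := by
    refine Real.sqrt_le_sqrt ?_
    rw [hX₁]
    have ifw : Integrable (fun x => frobeniusNormSq (fderiv ℝ w x)) volume :=
      integrable_of_continuous_of_nonneg (FluidPDE.continuous_frobeniusNormSq_fderiv hw1' one_ne_zero)
        (fun x => frobeniusNormSq_nonneg _) hwF
    refine integral_mono (FluidPDE.integrable_sq_norm_of_lintegral_lt_top ca ha0') ifw fun x => ?_
    exact (pow_le_pow_left₀ (norm_nonneg _) (na x) 2).trans (FluidPDE.sq_opNorm_le_frobeniusNormSq _)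
  -- (a) transport by `u`: `∫⟪(u·∇)a, Δa⟫ ≤ G Xa`
  have Pa : ∫ x, ⟪convect u a x, (Δ a) x⟫ ≤ G * Xa := by
    obtain ⟨iS, hid⟩ := integral_inner_laplacian_convect_left_eq_neg_sum hu ha hdivu hB hB₁ ha1 ha2
    have hcomm : ∫ x, ⟪convect u a x, (Δ a) x⟫ = ∫ x, ⟪(Δ a) x, convect u a x⟫ :=
      integral_congr_ae (Eventually.of_forall fun x => real_inner_comm _ _)
    rw [hcomm, hid, ← integral_neg, hXa, ← integral_const_mul]
    refine integral_mono iS.neg (ifa.const_mul G) fun x => ?_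
    exact r3rob_neg_sum_inner_comp_le (fderiv ℝ u x) (fderiv ℝ a x) (hG x)
  -- (b) transport by `w`: Cauchy–Schwarz with the sup of `w`
  have Pb : ∫ x, ⟪convect w a x, (Δ a) x⟫ ≤ Mw * Real.sqrt Xa * Real.sqrt Ya := by
    rw [hXa, hYa]; exact integral_inner_convect_le_of_norm_le ha1' cΔ hMw0 hMw haF hΔ2
  -- (c) stretching of `a` by `Du`
  have Pc : ∫ x, ⟪convect a u x, (Δ a) x⟫ ≤ G * Xa + 3 * σ₂ * Real.sqrt X₁ * Real.sqrt Xa := by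
    obtain ⟨iS, iR, hid⟩ :=
      integral_inner_laplacian_convect_right_eq_neg_sum hu ha hB₁ hσ₂ ha0' ha1 ha2
    have hcomm : ∫ x, ⟪convect a u x, (Δ a) x⟫ = ∫ x, ⟪(Δ a) x, convect a u x⟫ :=
      integral_congr_ae (Eventually.of_forall fun x => real_inner_comm _ _)
    rw [hcomm, hid]
    have h1 : -(∫ x, ∑ i, ⟪fderiv ℝ a x (e i), fderiv ℝ u x (fderiv ℝ a x (e i))⟫) ≤ G * Xa := by
      rw [← integral_neg, hXa, ← integral_const_mul]
      refine integral_mono iS.neg (ifa.const_mul G) fun x => ?_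
      exact r3rob_neg_sum_inner_le (fderiv ℝ u x) (fderiv ℝ a x) (hG x)
    have h2 : -(∫ x, ∑ i, ⟪fderiv ℝ a x (e i), convect a (fun y => fderiv ℝ u y (e i)) x⟫) ≤
        3 * σ₂ * Real.sqrt X₁ * Real.sqrt Xa := by
      have n_Dus : ∀ i x, ‖fderiv ℝ (fun y => fderiv ℝ u y (e i)) x‖ ≤ σ₂ := fun i x => by
        have h : ‖fderiv ℝ (fun y => fderiv ℝ u y (e i)) x‖ =
            ‖iteratedFDeriv ℝ 1 (fun y => fderiv ℝ u y (e i)) x‖ := by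
          rw [← norm_iteratedFDeriv_fderiv, norm_iteratedFDeriv_zero]
        rw [h]
        exact (norm_iteratedFDeriv_fderiv_apply_basisFun_le hu 1 (by norm_cast) x i).trans (hσ₂ x)
      have hpt : ∀ x, -(∑ i, ⟪fderiv ℝ a x (e i), convect a (fun y => fderiv ℝ u y (e i)) x⟫) ≤
          3 * σ₂ * (‖a x‖ * ‖fderiv ℝ a x‖) := by
        intro x
        have hi : ∀ i, -⟪fderiv ℝ a x (e i), convect a (fun y => fderiv ℝ u y (e i)) x⟫ ≤
            σ₂ * (‖a x‖ * ‖fderiv ℝ a x‖) := by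
          intro i
          have hc : ‖convect a (fun y => fderiv ℝ u y (e i)) x‖ ≤ σ₂ * ‖a x‖ := by
            rw [convect]
            exact (fderiv ℝ (fun y => fderiv ℝ u y (e i)) x).le_of_opNorm_le (n_Dus i x) (a x)
          have hd : ‖fderiv ℝ a x (e i)‖ ≤ ‖fderiv ℝ a x‖ := by
            simpa [he1] using (fderiv ℝ a x).le_opNorm (e i)
          calc -⟪fderiv ℝ a x (e i), convect a (fun y => fderiv ℝ u y (e i)) x⟫
              ≤ ‖fderiv ℝ a x (e i)‖ * ‖convect a (fun y => fderiv ℝ u y (e i)) x‖ :=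
                (neg_le_abs _).trans (abs_real_inner_le_norm _ _)
            _ ≤ ‖fderiv ℝ a x‖ * (σ₂ * ‖a x‖) :=
                mul_le_mul hd hc (norm_nonneg _) (norm_nonneg _)
            _ = σ₂ * (‖a x‖ * ‖fderiv ℝ a x‖) := by ring
        rw [← Finset.sum_neg_distrib]
        calc ∑ i, -⟪fderiv ℝ a x (e i), convect a (fun y => fderiv ℝ u y (e i)) x⟫
            ≤ ∑ _i : Fin 3, σ₂ * (‖a x‖ * ‖fderiv ℝ a x‖) := Finset.sum_le_sum fun i _ => hi i
          _ = 3 * σ₂ * (‖a x‖ * ‖fderiv ℝ a x‖) := by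
              rw [Finset.sum_const, Finset.card_univ, Fintype.card_fin, nsmul_eq_mul]
              push_cast
              ring
      have ma : MemLp a 2 volume := r3rob_memLp_two ca ha0'
      have mDa : MemLp (fderiv ℝ a) 2 volume := r3rob_memLp_two cDa l2Da
      have hcs := integral_norm_mul_norm_le_sqrt_mul_sqrt ma mDa
      have iprod : Integrable (fun x => ‖a x‖ * ‖fderiv ℝ a x‖) volume :=
        integrable_of_norm_le_mul_of_lintegral_sq ((ca.norm.mul cDa.norm).aestronglyMeasurable) ca cDa
          ha0' l2Da (fun x => by rw [Real.norm_of_nonneg (mul_nonneg (norm_nonneg _) (norm_nonneg _))])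
      have hXop : Real.sqrt (∫ x, ‖fderiv ℝ a x‖ ^ 2) ≤ Real.sqrt Xa := by
        refine Real.sqrt_le_sqrt ?_
        rw [hXa]
        exact integral_mono (FluidPDE.integrable_sq_norm_of_lintegral_lt_top cDa l2Da) ifa
          fun x => FluidPDE.sq_opNorm_le_frobeniusNormSq _
      rw [← integral_neg]
      calc ∫ x, -(∑ i, ⟪fderiv ℝ a x (e i), convect a (fun y => fderiv ℝ u y (e i)) x⟫)
          ≤ ∫ x, 3 * σ₂ * (‖a x‖ * ‖fderiv ℝ a x‖) := integral_mono iR.neg (iprod.const_mul _) hpt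
        _ = 3 * σ₂ * ∫ x, ‖a x‖ * ‖fderiv ℝ a x‖ := integral_const_mul _ _
        _ ≤ 3 * σ₂ * (Real.sqrt (∫ x, ‖a x‖ ^ 2) * Real.sqrt (∫ x, ‖fderiv ℝ a x‖ ^ 2)) :=
            mul_le_mul_of_nonneg_left hcs (by positivity)
        _ ≤ 3 * σ₂ * (Real.sqrt X₁ * Real.sqrt Xa) :=
            mul_le_mul_of_nonneg_left (mul_le_mul ha_l2 hXop (Real.sqrt_nonneg _)
              (Real.sqrt_nonneg _)) (by positivity)
        _ = 3 * σ₂ * Real.sqrt X₁ * Real.sqrt Xa := by ring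
    linarith [h1, h2]
  -- (d) `∫⟪(w·∇)b, Δa⟫` by parts (three fields `a, w, b`)
  have Pd : ∫ x, ⟪convect w b x, (Δ a) x⟫ ≤
      3 * σ₂ * Real.sqrt X₁ * Real.sqrt Xa + 3 * σ₃ * L * Real.sqrt Xa := by
    obtain ⟨iS, iR, hid⟩ :=
      r3rob_integral_inner_laplacian_convect3 ha hw hb hb1 hb2 hw0 l2Dw l2Da ha2
    have hcomm : ∫ x, ⟪convect w b x, (Δ a) x⟫ = ∫ x, ⟪(Δ a) x, convect w b x⟫ :=
      integral_congr_ae (Eventually.of_forall fun x => real_inner_comm _ _)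
    rw [hcomm, hid]
    -- first sum: `|⟪∂ⱼa, Db(∂ⱼw)⟫| ≤ σ₂ ‖Da‖ ‖Dw‖`
    have h1 : -(∫ x, ∑ j, ⟪fderiv ℝ a x (e j), fderiv ℝ b x (fderiv ℝ w x (e j))⟫) ≤
        3 * σ₂ * Real.sqrt X₁ * Real.sqrt Xa := by
      have hpt : ∀ x, -(∑ j, ⟪fderiv ℝ a x (e j), fderiv ℝ b x (fderiv ℝ w x (e j))⟫) ≤
          3 * σ₂ * (‖fderiv ℝ a x‖ * ‖fderiv ℝ w x‖) := by
        intro x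
        have hi : ∀ j, -⟪fderiv ℝ a x (e j), fderiv ℝ b x (fderiv ℝ w x (e j))⟫ ≤
            σ₂ * (‖fderiv ℝ a x‖ * ‖fderiv ℝ w x‖) := by
          intro j
          have hd : ‖fderiv ℝ a x (e j)‖ ≤ ‖fderiv ℝ a x‖ := by
            simpa [he1] using (fderiv ℝ a x).le_opNorm (e j)
          have hc : ‖fderiv ℝ b x (fderiv ℝ w x (e j))‖ ≤ σ₂ * ‖fderiv ℝ w x‖ := by
            refine ((fderiv ℝ b x).le_of_opNorm_le (hb1 x) _).trans ?_
            exact mul_le_mul_of_nonneg_left (by simpa [he1] using (fderiv ℝ w x).le_opNorm (e j))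
              hσ₂0
          calc -⟪fderiv ℝ a x (e j), fderiv ℝ b x (fderiv ℝ w x (e j))⟫
              ≤ ‖fderiv ℝ a x (e j)‖ * ‖fderiv ℝ b x (fderiv ℝ w x (e j))‖ :=
                (neg_le_abs _).trans (abs_real_inner_le_norm _ _)
            _ ≤ ‖fderiv ℝ a x‖ * (σ₂ * ‖fderiv ℝ w x‖) :=
                mul_le_mul hd hc (norm_nonneg _) (norm_nonneg _)
            _ = σ₂ * (‖fderiv ℝ a x‖ * ‖fderiv ℝ w x‖) := by ring
        rw [← Finset.sum_neg_distrib]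
        calc ∑ j, -⟪fderiv ℝ a x (e j), fderiv ℝ b x (fderiv ℝ w x (e j))⟫
            ≤ ∑ _j : Fin 3, σ₂ * (‖fderiv ℝ a x‖ * ‖fderiv ℝ w x‖) :=
              Finset.sum_le_sum fun j _ => hi j
          _ = 3 * σ₂ * (‖fderiv ℝ a x‖ * ‖fderiv ℝ w x‖) := by
              rw [Finset.sum_const, Finset.card_univ, Fintype.card_fin, nsmul_eq_mul]
              push_cast
              ring
      rw [← integral_neg]
      calc ∫ x, -(∑ j, ⟪fderiv ℝ a x (e j), fderiv ℝ b x (fderiv ℝ w x (e j))⟫)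
          ≤ ∫ x, 3 * σ₂ * (‖fderiv ℝ a x‖ * ‖fderiv ℝ w x‖) :=
            integral_mono iS.neg (iaw.const_mul _) hpt
        _ = 3 * σ₂ * ∫ x, ‖fderiv ℝ a x‖ * ‖fderiv ℝ w x‖ := integral_const_mul _ _
        _ ≤ 3 * σ₂ * (Real.sqrt Xa * Real.sqrt X₁) := mul_le_mul_of_nonneg_left hcsaw (by positivity)
        _ = 3 * σ₂ * Real.sqrt X₁ * Real.sqrt Xa := by ring
    -- second sum: `|⟪∂ⱼa, (w·∇)∂ⱼb⟫| ≤ σ₃ ‖Da‖ ‖w‖`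
    have h2 : -(∫ x, ∑ j, ⟪fderiv ℝ a x (e j), convect w (fun y => fderiv ℝ b y (e j)) x⟫) ≤
        3 * σ₃ * L * Real.sqrt Xa := by
      have n_Dbs : ∀ j x, ‖fderiv ℝ (fun y => fderiv ℝ b y (e j)) x‖ ≤ σ₃ := fun j x => by
        have h : ‖fderiv ℝ (fun y => fderiv ℝ b y (e j)) x‖ =
            ‖iteratedFDeriv ℝ 1 (fun y => fderiv ℝ b y (e j)) x‖ := by
          rw [← norm_iteratedFDeriv_fderiv, norm_iteratedFDeriv_zero]
        rw [h]
        exact (norm_iteratedFDeriv_fderiv_apply_basisFun_le hb 1 (by norm_cast) x j).trans (hb2 x)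
      have hpt : ∀ x, -(∑ j, ⟪fderiv ℝ a x (e j), convect w (fun y => fderiv ℝ b y (e j)) x⟫) ≤
          3 * σ₃ * (‖fderiv ℝ a x‖ * ‖w x‖) := by
        intro x
        have hi : ∀ j, -⟪fderiv ℝ a x (e j), convect w (fun y => fderiv ℝ b y (e j)) x⟫ ≤
            σ₃ * (‖fderiv ℝ a x‖ * ‖w x‖) := by
          intro j
          have hd : ‖fderiv ℝ a x (e j)‖ ≤ ‖fderiv ℝ a x‖ := by
            simpa [he1] using (fderiv ℝ a x).le_opNorm (e j)
          have hc : ‖convect w (fun y => fderiv ℝ b y (e j)) x‖ ≤ σ₃ * ‖w x‖ := by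
            rw [convect]
            exact (fderiv ℝ (fun y => fderiv ℝ b y (e j)) x).le_of_opNorm_le (n_Dbs j x) (w x)
          calc -⟪fderiv ℝ a x (e j), convect w (fun y => fderiv ℝ b y (e j)) x⟫
              ≤ ‖fderiv ℝ a x (e j)‖ * ‖convect w (fun y => fderiv ℝ b y (e j)) x‖ :=
                (neg_le_abs _).trans (abs_real_inner_le_norm _ _)
            _ ≤ ‖fderiv ℝ a x‖ * (σ₃ * ‖w x‖) := mul_le_mul hd hc (norm_nonneg _) (norm_nonneg _)
            _ = σ₃ * (‖fderiv ℝ a x‖ * ‖w x‖) := by ring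
        rw [← Finset.sum_neg_distrib]
        calc ∑ j, -⟪fderiv ℝ a x (e j), convect w (fun y => fderiv ℝ b y (e j)) x⟫
            ≤ ∑ _j : Fin 3, σ₃ * (‖fderiv ℝ a x‖ * ‖w x‖) := Finset.sum_le_sum fun j _ => hi j
          _ = 3 * σ₃ * (‖fderiv ℝ a x‖ * ‖w x‖) := by
              rw [Finset.sum_const, Finset.card_univ, Fintype.card_fin, nsmul_eq_mul]
              push_cast
              ring
      rw [← integral_neg]
      calc ∫ x, -(∑ j, ⟪fderiv ℝ a x (e j), convect w (fun y => fderiv ℝ b y (e j)) x⟫)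
          ≤ ∫ x, 3 * σ₃ * (‖fderiv ℝ a x‖ * ‖w x‖) := integral_mono iR.neg (ia0.const_mul _) hpt
        _ = 3 * σ₃ * ∫ x, ‖fderiv ℝ a x‖ * ‖w x‖ := integral_const_mul _ _
        _ ≤ 3 * σ₃ * (Real.sqrt Xa * L) := mul_le_mul_of_nonneg_left hcsa0 (by positivity)
        _ = 3 * σ₃ * L * Real.sqrt Xa := by ring
    linarith [h1, h2]
  -- (e) `∫⟪Dw(b), Δa⟫` by parts (three fields `a, b, w`): the first sum is a cross term, the
  -- second is handed to the caller
  obtain ⟨iSe, iRe, hide⟩ :=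
    r3rob_integral_inner_laplacian_convect3 ha hb hw hBw₁ hBw₂ hbl0 hbl1 l2Da ha2
  have Pe : (∫ x, ⟪fderiv ℝ w x (b x), (Δ a) x⟫) +
      ∫ x, ∑ j, ⟪fderiv ℝ a x (e j), convect b (fun y => fderiv ℝ w y (e j)) x⟫ ≤
      3 * σ₂ * Real.sqrt X₁ * Real.sqrt Xa := by
    have hcomm : ∫ x, ⟪fderiv ℝ w x (b x), (Δ a) x⟫ = ∫ x, ⟪(Δ a) x, convect b w x⟫ :=
      integral_congr_ae (Eventually.of_forall fun x => real_inner_comm _ _)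
    rw [hcomm, hide]
    have h1 : -(∫ x, ∑ j, ⟪fderiv ℝ a x (e j), fderiv ℝ w x (fderiv ℝ b x (e j))⟫) ≤
        3 * σ₂ * Real.sqrt X₁ * Real.sqrt Xa := by
      have hpt : ∀ x, -(∑ j, ⟪fderiv ℝ a x (e j), fderiv ℝ w x (fderiv ℝ b x (e j))⟫) ≤
          3 * σ₂ * (‖fderiv ℝ a x‖ * ‖fderiv ℝ w x‖) := by
        intro x
        have hi : ∀ j, -⟪fderiv ℝ a x (e j), fderiv ℝ w x (fderiv ℝ b x (e j))⟫ ≤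
            σ₂ * (‖fderiv ℝ a x‖ * ‖fderiv ℝ w x‖) := by
          intro j
          have hd : ‖fderiv ℝ a x (e j)‖ ≤ ‖fderiv ℝ a x‖ := by
            simpa [he1] using (fderiv ℝ a x).le_opNorm (e j)
          have hbj : ‖fderiv ℝ b x (e j)‖ ≤ σ₂ := by
            have := (fderiv ℝ b x).le_opNorm (e j)
            rw [he1, mul_one] at this
            exact this.trans (hb1 x)
          have hc : ‖fderiv ℝ w x (fderiv ℝ b x (e j))‖ ≤ ‖fderiv ℝ w x‖ * σ₂ :=
            ((fderiv ℝ w x).le_opNorm _).trans (mul_le_mul_of_nonneg_left hbj (norm_nonneg _))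
          calc -⟪fderiv ℝ a x (e j), fderiv ℝ w x (fderiv ℝ b x (e j))⟫
              ≤ ‖fderiv ℝ a x (e j)‖ * ‖fderiv ℝ w x (fderiv ℝ b x (e j))‖ :=
                (neg_le_abs _).trans (abs_real_inner_le_norm _ _)
            _ ≤ ‖fderiv ℝ a x‖ * (‖fderiv ℝ w x‖ * σ₂) :=
                mul_le_mul hd hc (norm_nonneg _) (norm_nonneg _)
            _ = σ₂ * (‖fderiv ℝ a x‖ * ‖fderiv ℝ w x‖) := by ring
        rw [← Finset.sum_neg_distrib]
        calc ∑ j, -⟪fderiv ℝ a x (e j), fderiv ℝ w x (fderiv ℝ b x (e j))⟫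
            ≤ ∑ _j : Fin 3, σ₂ * (‖fderiv ℝ a x‖ * ‖fderiv ℝ w x‖) :=
              Finset.sum_le_sum fun j _ => hi j
          _ = 3 * σ₂ * (‖fderiv ℝ a x‖ * ‖fderiv ℝ w x‖) := by
              rw [Finset.sum_const, Finset.card_univ, Fintype.card_fin, nsmul_eq_mul]
              push_cast
              ring
      rw [← integral_neg]
      calc ∫ x, -(∑ j, ⟪fderiv ℝ a x (e j), fderiv ℝ w x (fderiv ℝ b x (e j))⟫)
          ≤ ∫ x, 3 * σ₂ * (‖fderiv ℝ a x‖ * ‖fderiv ℝ w x‖) :=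
            integral_mono iSe.neg (iaw.const_mul _) hpt
        _ = 3 * σ₂ * ∫ x, ‖fderiv ℝ a x‖ * ‖fderiv ℝ w x‖ := integral_const_mul _ _
        _ ≤ 3 * σ₂ * (Real.sqrt Xa * Real.sqrt X₁) := mul_le_mul_of_nonneg_left hcsaw (by positivity)
        _ = 3 * σ₂ * Real.sqrt X₁ * Real.sqrt Xa := by ring
    linarith [h1]
  -- (f) `∫⟪Dw(a), Δa⟫`: Cauchy–Schwarz with the sup of `a` (Agmon for `a`)
  obtain ⟨Ma, hMa⟩ : ∃ M : ℝ, M = A * (Xa * Ya) ^ (1 / 4 : ℝ) := ⟨_, rfl⟩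
  have hMa0 : 0 ≤ Ma := by
    rw [hMa]; exact mul_nonneg hA0 (Real.rpow_nonneg (mul_nonneg hXa0 hYa0) _)
  have hMax : ∀ x, ‖a x‖ ≤ Ma := fun x => by
    rw [hMa, hAdef, hXa, hYa]
    exact norm_le_agmonConst_mul_rpow ha ha0 ha1 ha2 ha3 x
  have Pf : ∫ x, ⟪fderiv ℝ w x (a x), (Δ a) x⟫ ≤ Ma * Real.sqrt X₁ * Real.sqrt Ya := by
    rw [hX₁, hYa]
    exact integral_inner_convect_le_of_norm_le hw1' cΔ hMa0 hMax hwF hΔ2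
  -- integrability of the six pairings and the split of the sum
  have l2N : ∀ {N : EuclideanSpace ℝ (Fin 3) → EuclideanSpace ℝ (Fin 3)}, Continuous N →
      (∫⁻ x, ‖N x‖ₑ ^ 2 < ⊤) → Integrable (fun x => ⟪N x, (Δ a) x⟫) volume := fun cN hN =>
    integrable_of_norm_le_mul_of_lintegral_sq (cN.inner cΔ).aestronglyMeasurable cN cΔ hN hΔ2
      fun x => norm_inner_le_norm _ _
  have hB0 : 0 ≤ B := (norm_nonneg _).trans (hB 0)
  have hB₁0 : 0 ≤ B₁ := (norm_nonneg _).trans (hB₁ 0)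
  have hBw₁0 : 0 ≤ Bw₁ := (norm_nonneg _).trans (hBw₁ 0)
  have ia : Integrable (fun x => ⟪convect u a x, (Δ a) x⟫) volume :=
    integrable_inner_convect_of_norm_le cu ha1' cΔ hB0 hB haF hΔ2
  have ib : Integrable (fun x => ⟪convect w a x, (Δ a) x⟫) volume :=
    integrable_inner_convect_of_norm_le cw ha1' cΔ hMw0 hMw haF hΔ2
  have ic : Integrable (fun x => ⟪convect a u x, (Δ a) x⟫) volume := by
    have n : ∀ x, ‖convect a u x‖ ≤ ‖B₁ * ‖a x‖‖ := fun x => by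
      rw [convect, Real.norm_of_nonneg (mul_nonneg hB₁0 (norm_nonneg _))]
      exact (fderiv ℝ u x).le_of_opNorm_le (hB₁ x) (a x)
    exact l2N ((hu1'.continuous_fderiv one_ne_zero).clm_apply ca)
      (lintegral_enorm_sq_lt_top_of_norm_le n (r3rob_lintegral_sq_mul_norm_lt_top B₁ ha0'))
  have id' : Integrable (fun x => ⟪convect w b x, (Δ a) x⟫) volume := by
    have n : ∀ x, ‖convect w b x‖ ≤ ‖σ₂ * ‖w x‖‖ := fun x => by
      rw [convect, Real.norm_of_nonneg (mul_nonneg hσ₂0 (norm_nonneg _))]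
      exact (fderiv ℝ b x).le_of_opNorm_le (hb1 x) (w x)
    exact l2N (cDb.clm_apply cw)
      (lintegral_enorm_sq_lt_top_of_norm_le n (r3rob_lintegral_sq_mul_norm_lt_top σ₂ hw0))
  have ie : Integrable (fun x => ⟪fderiv ℝ w x (b x), (Δ a) x⟫) volume := by
    have n : ∀ x, ‖fderiv ℝ w x (b x)‖ ≤ ‖Bw₁ * ‖b x‖‖ := fun x => by
      rw [Real.norm_of_nonneg (mul_nonneg hBw₁0 (norm_nonneg _))]
      exact (fderiv ℝ w x).le_of_opNorm_le (hBw₁ x) (b x)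
    exact l2N (cDw.clm_apply cb)
      (lintegral_enorm_sq_lt_top_of_norm_le n (r3rob_lintegral_sq_mul_norm_lt_top Bw₁ hbl0))
  have if' : Integrable (fun x => ⟪fderiv ℝ w x (a x), (Δ a) x⟫) volume := by
    have n : ∀ x, ‖fderiv ℝ w x (a x)‖ ≤ ‖Bw₁ * ‖a x‖‖ := fun x => by
      rw [Real.norm_of_nonneg (mul_nonneg hBw₁0 (norm_nonneg _))]
      exact (fderiv ℝ w x).le_of_opNorm_le (hBw₁ x) (a x)
    exact l2N (cDw.clm_apply ca)
      (lintegral_enorm_sq_lt_top_of_norm_le n (r3rob_lintegral_sq_mul_norm_lt_top Bw₁ ha0'))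
  have hsum : ∫ x, ⟪convect u a x + convect w a x + convect a u x + convect w b x +
        fderiv ℝ w x (b x) + fderiv ℝ w x (a x), (Δ a) x⟫ =
      (∫ x, ⟪convect u a x, (Δ a) x⟫) + (∫ x, ⟪convect w a x, (Δ a) x⟫) +
        (∫ x, ⟪convect a u x, (Δ a) x⟫) + (∫ x, ⟪convect w b x, (Δ a) x⟫) +
        (∫ x, ⟪fderiv ℝ w x (b x), (Δ a) x⟫) + ∫ x, ⟪fderiv ℝ w x (a x), (Δ a) x⟫ := by
    have eq : ∀ x, ⟪convect u a x + convect w a x + convect a u x + convect w b x +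
        fderiv ℝ w x (b x) + fderiv ℝ w x (a x), (Δ a) x⟫ =
        ⟪convect u a x, (Δ a) x⟫ + ⟪convect w a x, (Δ a) x⟫ + ⟪convect a u x, (Δ a) x⟫ +
          ⟪convect w b x, (Δ a) x⟫ + ⟪fderiv ℝ w x (b x), (Δ a) x⟫ +
          ⟪fderiv ℝ w x (a x), (Δ a) x⟫ := fun x => by
      simp only [inner_add_left]
    simp_rw [eq]
    have i12 : Integrable (fun x => ⟪convect u a x, (Δ a) x⟫ + ⟪convect w a x, (Δ a) x⟫) volume :=
      ia.add ib
    have i123 : Integrable (fun x => ⟪convect u a x, (Δ a) x⟫ + ⟪convect w a x, (Δ a) x⟫ +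
        ⟪convect a u x, (Δ a) x⟫) volume := i12.add ic
    have i1234 : Integrable (fun x => ⟪convect u a x, (Δ a) x⟫ + ⟪convect w a x, (Δ a) x⟫ +
        ⟪convect a u x, (Δ a) x⟫ + ⟪convect w b x, (Δ a) x⟫) volume := i123.add id'
    have i12345 : Integrable (fun x => ⟪convect u a x, (Δ a) x⟫ + ⟪convect w a x, (Δ a) x⟫ +
        ⟪convect a u x, (Δ a) x⟫ + ⟪convect w b x, (Δ a) x⟫ + ⟪fderiv ℝ w x (b x), (Δ a) x⟫)
        volume := i1234.add ie
    rw [integral_add i12345 if', integral_add i1234 ie, integral_add i123 id', integral_add i12 ic,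
      integral_add ia ib]
  refine ⟨iRe, ?_⟩
  rw [hsum]
  have hMa' : Ma = A * (Xa * Ya) ^ (1 / 4 : ℝ) := hMa
  rw [← hMa']
  linarith [Pa, Pb, Pc, Pd, Pe, Pf]

/-- **The symmetric Hessian term**: with `wᵢ = ∂ᵢw`, `uᵢ = ∂ᵢu`,
`−Σᵢ∫Σⱼ⟪∂ⱼwᵢ, D(∂ⱼw)(uᵢ)⟫ = −∫ΣⱼΣᵢ⟪∂ᵢwⱼ, Dwⱼ(Du eᵢ)⟫ ≤ G·Σⱼ∫|∇wⱼ|²_F` (Schwarz `∂ⱼwᵢ = ∂ᵢwⱼ`,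
then the quadratic form of §4b column by column). [folklore] -/
private theorem r3rob_H2_symmetric_le {u w : EuclideanSpace ℝ (Fin 3) → EuclideanSpace ℝ (Fin 3)}
    (hw : ContDiff ℝ ∞ w) {G : ℝ}
    (hG : ∀ x (ξ : EuclideanSpace ℝ (Fin 3)), -⟪fderiv ℝ u x ξ, ξ⟫ ≤ G * ‖ξ‖ ^ 2)
    (hI : ∀ i, Integrable (fun x => ∑ j,
      ⟪fderiv ℝ (fun y => fderiv ℝ w y (EuclideanSpace.basisFun (Fin 3) ℝ i)) x
          (EuclideanSpace.basisFun (Fin 3) ℝ j),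
        convect (fun y => fderiv ℝ u y (EuclideanSpace.basisFun (Fin 3) ℝ i))
          (fun y => fderiv ℝ w y (EuclideanSpace.basisFun (Fin 3) ℝ j)) x⟫) volume)
    (hF : ∀ j, Integrable (fun x => frobeniusNormSq
      (fderiv ℝ (fun y => fderiv ℝ w y (EuclideanSpace.basisFun (Fin 3) ℝ j)) x)) volume) :
    -(∑ i, ∫ x, ∑ j,
      ⟪fderiv ℝ (fun y => fderiv ℝ w y (EuclideanSpace.basisFun (Fin 3) ℝ i)) x
          (EuclideanSpace.basisFun (Fin 3) ℝ j),
        convect (fun y => fderiv ℝ u y (EuclideanSpace.basisFun (Fin 3) ℝ i))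
          (fun y => fderiv ℝ w y (EuclideanSpace.basisFun (Fin 3) ℝ j)) x⟫) ≤
      G * ∑ j, ∫ x, frobeniusNormSq
        (fderiv ℝ (fun y => fderiv ℝ w y (EuclideanSpace.basisFun (Fin 3) ℝ j)) x) := by
  set e := EuclideanSpace.basisFun (Fin 3) ℝ with he
  have hw2 : ContDiff ℝ 2 w := hw.of_le (by norm_cast)
  -- pointwise: swap the indices by Schwarz and bound column by column
  have hpt : ∀ x, -(∑ i, ∑ j, ⟪fderiv ℝ (fun y => fderiv ℝ w y (e i)) x (e j),
      convect (fun y => fderiv ℝ u y (e i)) (fun y => fderiv ℝ w y (e j)) x⟫) ≤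
      ∑ j, G * frobeniusNormSq (fderiv ℝ (fun y => fderiv ℝ w y (e j)) x) := by
    intro x
    have hswap : ∑ i, ∑ j, ⟪fderiv ℝ (fun y => fderiv ℝ w y (e i)) x (e j),
        convect (fun y => fderiv ℝ u y (e i)) (fun y => fderiv ℝ w y (e j)) x⟫ =
        ∑ j, ∑ i, ⟪fderiv ℝ (fun y => fderiv ℝ w y (e j)) x (e i),
          fderiv ℝ (fun y => fderiv ℝ w y (e j)) x (fderiv ℝ u x (e i))⟫ := by
      rw [Finset.sum_comm]
      refine Finset.sum_congr rfl fun j _ => Finset.sum_congr rfl fun i _ => ?_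
      rw [fderiv_fderiv_apply_comm_of_contDiff_two hw2 x (e i) (e j), convect]
    rw [hswap, ← Finset.sum_neg_distrib]
    exact Finset.sum_le_sum fun j _ =>
      r3rob_neg_sum_inner_comp_le (fderiv ℝ u x) (fderiv ℝ (fun y => fderiv ℝ w y (e j)) x) (hG x)
  rw [← integral_finsetSum _ fun i _ => hI i, ← integral_neg, Finset.mul_sum]
  have hR : ∑ j, G * ∫ x, frobeniusNormSq (fderiv ℝ (fun y => fderiv ℝ w y (e j)) x) =
      ∫ x, ∑ j, G * frobeniusNormSq (fderiv ℝ (fun y => fderiv ℝ w y (e j)) x) := by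
    rw [integral_finsetSum _ fun j _ => (hF j).const_mul G]
    exact Finset.sum_congr rfl fun j _ => (integral_const_mul _ _).symm
  rw [hR]
  exact integral_mono (integrable_finsetSum _ fun i _ => hI i).neg
    (integrable_finsetSum _ fun j _ => (hF j).const_mul G) fun x => hpt x

/-- Scalar bookkeeping for the sum over the three directions. [folklore] -/
private theorem r3rob_H2_sum3 {ν G κ σ₂ σ₃ A X₁ Y₂ L H₁ Y0 Y1 Y2 X0 X1 X2 P0 P1 P2 F0 F1 F2
    S0 S1 S2 : ℝ}
    (k0 : -(2 * ν * Y0) + 2 * P0 + 2 * F0 + 2 * S0 ≤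
      (4 * G + 9 * κ * σ₂ + 3 * κ ^ 2 * σ₃ + 2 * A ^ 2 * Real.sqrt (X₁ * Y₂) / ν +
          27 * A ^ 4 * X₁ ^ 2 / (16 * ν ^ 3)) * X0 +
        9 * σ₂ / κ * X₁ + 3 * σ₃ / κ ^ 2 * L ^ 2 + 2 / ν * H₁)
    (k1 : -(2 * ν * Y1) + 2 * P1 + 2 * F1 + 2 * S1 ≤
      (4 * G + 9 * κ * σ₂ + 3 * κ ^ 2 * σ₃ + 2 * A ^ 2 * Real.sqrt (X₁ * Y₂) / ν +
          27 * A ^ 4 * X₁ ^ 2 / (16 * ν ^ 3)) * X1 +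
        9 * σ₂ / κ * X₁ + 3 * σ₃ / κ ^ 2 * L ^ 2 + 2 / ν * H₁)
    (k2 : -(2 * ν * Y2) + 2 * P2 + 2 * F2 + 2 * S2 ≤
      (4 * G + 9 * κ * σ₂ + 3 * κ ^ 2 * σ₃ + 2 * A ^ 2 * Real.sqrt (X₁ * Y₂) / ν +
          27 * A ^ 4 * X₁ ^ 2 / (16 * ν ^ 3)) * X2 +
        9 * σ₂ / κ * X₁ + 3 * σ₃ / κ ^ 2 * L ^ 2 + 2 / ν * H₁)
    (hsym : -(S0 + S1 + S2) ≤ G * (X0 + X1 + X2)) :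
    -(2 * ν * Y0) + 2 * P0 + 2 * F0 + (-(2 * ν * Y1) + 2 * P1 + 2 * F1) +
        (-(2 * ν * Y2) + 2 * P2 + 2 * F2) ≤
      (6 * G + 9 * κ * σ₂ + 3 * κ ^ 2 * σ₃ + 2 * A ^ 2 * Real.sqrt (X₁ * Y₂) / ν +
            27 * A ^ 4 * X₁ ^ 2 / (16 * ν ^ 3)) * (X0 + X1 + X2) +
        27 * σ₂ / κ * X₁ + 9 * σ₃ / κ ^ 2 * L ^ 2 + 6 / ν * H₁ := by
  have hid : (6 * G + 9 * κ * σ₂ + 3 * κ ^ 2 * σ₃ + 2 * A ^ 2 * Real.sqrt (X₁ * Y₂) / ν +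
        27 * A ^ 4 * X₁ ^ 2 / (16 * ν ^ 3)) * (X0 + X1 + X2) +
        27 * σ₂ / κ * X₁ + 9 * σ₃ / κ ^ 2 * L ^ 2 + 6 / ν * H₁ =
      ((4 * G + 9 * κ * σ₂ + 3 * κ ^ 2 * σ₃ + 2 * A ^ 2 * Real.sqrt (X₁ * Y₂) / ν +
          27 * A ^ 4 * X₁ ^ 2 / (16 * ν ^ 3)) * X0 +
        9 * σ₂ / κ * X₁ + 3 * σ₃ / κ ^ 2 * L ^ 2 + 2 / ν * H₁) +
      ((4 * G + 9 * κ * σ₂ + 3 * κ ^ 2 * σ₃ + 2 * A ^ 2 * Real.sqrt (X₁ * Y₂) / ν +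
          27 * A ^ 4 * X₁ ^ 2 / (16 * ν ^ 3)) * X1 +
        9 * σ₂ / κ * X₁ + 3 * σ₃ / κ ^ 2 * L ^ 2 + 2 / ν * H₁) +
      ((4 * G + 9 * κ * σ₂ + 3 * κ ^ 2 * σ₃ + 2 * A ^ 2 * Real.sqrt (X₁ * Y₂) / ν +
          27 * A ^ 4 * X₁ ^ 2 / (16 * ν ^ 3)) * X2 +
        9 * σ₂ / κ * X₁ + 3 * σ₃ / κ ^ 2 * L ^ 2 + 2 / ν * H₁) +
      2 * (G * (X0 + X1 + X2)) := by
    ring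
  rw [hid]
  linarith [k0, k1, k2, hsym]

/-- **The `H²`-level slice inequality in STRAIN form, explicit constants (Dashti–Robinson 2008,
proof of Thm 2 — the second-order robustness estimate `d/dt‖w‖₂ ≤ (c + c′)‖u‖₃‖w‖₂ + …` — with
Kato's inequalities `|(B(w,u), A²w)|, |(B(u,w), A²w)| ≤ c‖u‖₃‖w‖₂²` replaced by integrations by
parts onto quadratic forms in `Du` and sup majorants of `D²u, D³u`).** Let `u, w : ℝ³ → ℝ³` be
`C^∞`, `div u = 0`, `u, Du, Dw, D²w` bounded, `Du, D²u ∈ L²`, `w, …, D⁴w ∈ L²`, `h ∈ C¹` with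
`Dh ∈ L²`; write `wᵢ = ∂ᵢw`, `N = (v·∇)w + (w·∇)u` (`v = u + w`), `Z = Σᵢ∫|∇wᵢ|²_F` (`= ∫|D²w|²_F`),
`Y₃ = Σᵢ∫‖Δwᵢ‖²`, `X₁ = ∫|∇w|²_F`, `Y₂ = ∫‖Δw‖²`, `H₁ = ∫‖Dh‖²`, `A = agmonConst`, and suppose
`−⟪Du ξ, ξ⟫ ≤ G‖ξ‖²`, `‖D²u‖ ≤ σ₂`, `‖D³u‖ ≤ σ₃`, `‖w‖_{L²} ≤ L`, `κ > 0`. Then the `H²` flux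
`Σᵢ [−2ν∫‖Δwᵢ‖² + 2∫⟪∂ᵢN, Δwᵢ⟫ + 2∫⟪∂ᵢh, Δwᵢ⟫]` is at most
`(6G + 9κσ₂ + 3κ²σ₃ + 2A²√(X₁Y₂)/ν + 27A⁴X₁²/(16ν³))·Z + (27σ₂/κ)X₁ + (9σ₃/κ²)L² + (6/ν)H₁`:
linear in `Z` given the `H¹` level (`X₁`, bounded by `classicalNS_robustness_strain_R3`) except
through the transport-by-`w` coefficient `2A²√(X₁Y₂)/ν` (`Y₂ ≤ 3Z`; Agmon `‖w‖_∞ ≤ A(X₁Y₂)^{1/4}`),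
which makes the `H²` inequality of Riccati type `Z' ≲ λZ + βZ^{3/2}` as in the printed
`dy/dt ≤ δ + αy³` for `y = ‖w‖_{H²}` (the tree's `ForcedPowerComparison` closes such inequalities).
The six pairings per direction are `r3rob_H2_pairings`; the sup of `u` never enters.
[cite: DashtiRobinson2008, Thm 2 (proof); RobinsonRodrigoSadowskiCUP2016, Thm 9.1 (proof, Step 1)] -/
theorem robustness_flux_H2_le_strain_R3 {ν : ℝ} (hν : 0 < ν)
    {u w h : EuclideanSpace ℝ (Fin 3) → EuclideanSpace ℝ (Fin 3)} (hu : ContDiff ℝ ∞ u)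
    (hw : ContDiff ℝ ∞ w) (hh : ContDiff ℝ 1 h) (hdivu : VectorCalculus.IsDivFree u)
    (hw0 : ∫⁻ x, ‖iteratedFDeriv ℝ 0 w x‖ₑ ^ 2 < ⊤) (hw1 : ∫⁻ x, ‖iteratedFDeriv ℝ 1 w x‖ₑ ^ 2 < ⊤)
    (hw2 : ∫⁻ x, ‖iteratedFDeriv ℝ 2 w x‖ₑ ^ 2 < ⊤) (hw3 : ∫⁻ x, ‖iteratedFDeriv ℝ 3 w x‖ₑ ^ 2 < ⊤)
    (hw4 : ∫⁻ x, ‖iteratedFDeriv ℝ 4 w x‖ₑ ^ 2 < ⊤) (hh1 : ∫⁻ x, ‖fderiv ℝ h x‖ₑ ^ 2 < ⊤)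
    {B : ℝ} (hB : ∀ x, ‖u x‖ ≤ B) {B₁ : ℝ} (hB₁ : ∀ x, ‖fderiv ℝ u x‖ ≤ B₁)
    (hu1 : ∫⁻ x, ‖iteratedFDeriv ℝ 1 u x‖ₑ ^ 2 < ⊤) (hu2 : ∫⁻ x, ‖iteratedFDeriv ℝ 2 u x‖ₑ ^ 2 < ⊤)
    {Bw₁ : ℝ} (hBw₁ : ∀ x, ‖fderiv ℝ w x‖ ≤ Bw₁)
    {Bw₂ : ℝ} (hBw₂ : ∀ x, ‖iteratedFDeriv ℝ 2 w x‖ ≤ Bw₂)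
    {G : ℝ} (hG : ∀ x (ξ : EuclideanSpace ℝ (Fin 3)), -⟪fderiv ℝ u x ξ, ξ⟫ ≤ G * ‖ξ‖ ^ 2)
    {σ₂ : ℝ} (hσ₂ : ∀ x, ‖iteratedFDeriv ℝ 2 u x‖ ≤ σ₂)
    {σ₃ : ℝ} (hσ₃ : ∀ x, ‖iteratedFDeriv ℝ 3 u x‖ ≤ σ₃)
    {L : ℝ} (hL : Real.sqrt (∫ x, ‖w x‖ ^ 2) ≤ L) {κ : ℝ} (hκ : 0 < κ) :
    ∑ i, (-(2 * ν * ∫ x, ‖(Δ (fun y => fderiv ℝ w y (EuclideanSpace.basisFun (Fin 3) ℝ i))) x‖ ^ 2) +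
        2 * (∫ x, ⟪fderiv ℝ (fun y => convect (fun z => u z + w z) w y + convect w u y) x
            (EuclideanSpace.basisFun (Fin 3) ℝ i),
          (Δ (fun y => fderiv ℝ w y (EuclideanSpace.basisFun (Fin 3) ℝ i))) x⟫) +
        2 * (∫ x, ⟪fderiv ℝ h x (EuclideanSpace.basisFun (Fin 3) ℝ i),
          (Δ (fun y => fderiv ℝ w y (EuclideanSpace.basisFun (Fin 3) ℝ i))) x⟫)) ≤
      (6 * G + 9 * κ * σ₂ + 3 * κ ^ 2 * σ₃ +
            2 * agmonConst ^ 2 *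
              Real.sqrt ((∫ x, frobeniusNormSq (fderiv ℝ w x)) * (∫ x, ‖(Δ w) x‖ ^ 2)) / ν +
            27 * agmonConst ^ 4 * (∫ x, frobeniusNormSq (fderiv ℝ w x)) ^ 2 / (16 * ν ^ 3)) *
          (∑ i, ∫ x, frobeniusNormSq
            (fderiv ℝ (fun y => fderiv ℝ w y (EuclideanSpace.basisFun (Fin 3) ℝ i)) x)) +
        27 * σ₂ / κ * (∫ x, frobeniusNormSq (fderiv ℝ w x)) + 9 * σ₃ / κ ^ 2 * L ^ 2 +
        6 / ν * (∫ x, ‖fderiv ℝ h x‖ ^ 2) := by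
  set e := EuclideanSpace.basisFun (Fin 3) ℝ with he
  have he1 : ∀ i, ‖e i‖ = 1 := fun i => by simp [he]
  -- regularity basics
  have hw1' : ContDiff ℝ 1 w := hw.of_le (by norm_cast)
  have hu1' : ContDiff ℝ 1 u := hu.of_le (by norm_cast)
  have cw : Continuous w := hw.continuous
  have cu : Continuous u := hu.continuous
  have cDw : Continuous (fderiv ℝ w) := hw1'.continuous_fderiv one_ne_zero
  have cDu : Continuous (fderiv ℝ u) := hu1'.continuous_fderiv one_ne_zero
  have cDh : Continuous (fderiv ℝ h) := hh.continuous_fderiv one_ne_zero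
  have hσ₂0 : 0 ≤ σ₂ := (norm_nonneg _).trans (hσ₂ 0)
  have hσ₃0 : 0 ≤ σ₃ := (norm_nonneg _).trans (hσ₃ 0)
  have hL0 : 0 ≤ L := (Real.sqrt_nonneg _).trans hL
  have hw0' : ∫⁻ x, ‖w x‖ₑ ^ 2 < ⊤ := by
    refine lt_of_le_of_lt (le_of_eq (lintegral_congr fun x => ?_)) hw0
    rw [← ofReal_norm, ← ofReal_norm, norm_iteratedFDeriv_zero]
  have hwF : ∫⁻ x, ENNReal.ofReal (frobeniusNormSq (fderiv ℝ w x)) < ⊤ := by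
    calc ∫⁻ x, ENNReal.ofReal (frobeniusNormSq (fderiv ℝ w x))
        ≤ ∫⁻ x, 3 * ‖iteratedFDeriv ℝ 1 w x‖ₑ ^ 2 := lintegral_mono fun x => by
          rw [← ofReal_norm, norm_iteratedFDeriv_one, ofReal_norm]
          exact ofReal_frobeniusNormSq_le_three_mul_enorm_sq _
      _ = 3 * ∫⁻ x, ‖iteratedFDeriv ℝ 1 w x‖ₑ ^ 2 := lintegral_const_mul' _ _ (by norm_num)
      _ < ⊤ := ENNReal.mul_lt_top (by norm_num) hw1
  have hΔw2 : ∫⁻ x, ‖(Δ w) x‖ₑ ^ 2 < ⊤ := by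
    have hle : ∀ x, ‖(Δ w) x‖ ≤ ‖(3 : ℝ) • iteratedFDeriv ℝ 2 w x‖ := fun x => by
      rw [norm_smul, Real.norm_of_nonneg (by norm_num : (0 : ℝ) ≤ 3)]
      exact norm_laplacian_le_three_mul_norm_iteratedFDeriv_two (hw.of_le (by norm_cast)) x
    have h9 : ∫⁻ x, ‖(3 : ℝ) • iteratedFDeriv ℝ 2 w x‖ₑ ^ 2 < ⊤ := by
      have e3 : ∀ x, ‖(3 : ℝ) • iteratedFDeriv ℝ 2 w x‖ₑ ^ 2 =
          ENNReal.ofReal 3 ^ 2 * ‖iteratedFDeriv ℝ 2 w x‖ₑ ^ 2 := fun x => by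
        rw [enorm_smul, mul_pow, Real.enorm_eq_ofReal (by norm_num : (0 : ℝ) ≤ 3)]
      simp_rw [e3]
      rw [lintegral_const_mul' _ _ (ENNReal.pow_ne_top ENNReal.ofReal_ne_top)]
      exact ENNReal.mul_lt_top (lt_top_iff_ne_top.2 (ENNReal.pow_ne_top ENNReal.ofReal_ne_top)) hw2
    exact lintegral_enorm_sq_lt_top_of_norm_le hle h9
  -- the derivative slices `wᵢ = ∂ᵢw`, `uᵢ = ∂ᵢu` and their data
  have hws : ∀ i, ContDiff ℝ ∞ (fun y => fderiv ℝ w y (e i)) := fun i =>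
    (hw.fderiv_right (m := ∞) (by simp)).clm_apply contDiff_const
  have hus : ∀ i, ContDiff ℝ ∞ (fun y => fderiv ℝ u y (e i)) := fun i =>
    (hu.fderiv_right (m := ∞) (by simp)).clm_apply contDiff_const
  have hwsk : ∀ i (k : ℕ), (∫⁻ x, ‖iteratedFDeriv ℝ (k + 1) w x‖ₑ ^ 2 < ⊤) →
      ∫⁻ x, ‖iteratedFDeriv ℝ k (fun y => fderiv ℝ w y (e i)) x‖ₑ ^ 2 < ⊤ := fun i k hk =>
    lintegral_enorm_sq_lt_top_of_norm_le
      (fun x => norm_iteratedFDeriv_fderiv_apply_basisFun_le hw k le_top x i) hk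
  have na : ∀ i x, ‖fderiv ℝ w x (e i)‖ ≤ ‖fderiv ℝ w x‖ := fun i x => by
    simpa [he1] using (fderiv ℝ w x).le_opNorm (e i)
  have nus : ∀ i x, ‖fderiv ℝ u x (e i)‖ ≤ ‖iteratedFDeriv ℝ 1 u x‖ := fun i x => by
    have hDu_eq : ‖fderiv ℝ u x‖ = ‖iteratedFDeriv ℝ 1 u x‖ := by
      rw [← norm_iteratedFDeriv_fderiv, norm_iteratedFDeriv_zero]
    rw [← hDu_eq]
    simpa [he1] using (fderiv ℝ u x).le_opNorm (e i)
  have hb1 : ∀ i x, ‖fderiv ℝ (fun y => fderiv ℝ u y (e i)) x‖ ≤ σ₂ := fun i x => by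
    have h : ‖fderiv ℝ (fun y => fderiv ℝ u y (e i)) x‖ =
        ‖iteratedFDeriv ℝ 1 (fun y => fderiv ℝ u y (e i)) x‖ := by
      rw [← norm_iteratedFDeriv_fderiv, norm_iteratedFDeriv_zero]
    rw [h]
    exact (norm_iteratedFDeriv_fderiv_apply_basisFun_le hu 1 (by norm_cast) x i).trans (hσ₂ x)
  have hb1' : ∀ i x, ‖fderiv ℝ (fun y => fderiv ℝ u y (e i)) x‖ ≤ ‖iteratedFDeriv ℝ 2 u x‖ :=
    fun i x => by
    have h : ‖fderiv ℝ (fun y => fderiv ℝ u y (e i)) x‖ =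
        ‖iteratedFDeriv ℝ 1 (fun y => fderiv ℝ u y (e i)) x‖ := by
      rw [← norm_iteratedFDeriv_fderiv, norm_iteratedFDeriv_zero]
    rw [h]
    exact norm_iteratedFDeriv_fderiv_apply_basisFun_le hu 1 (by norm_cast) x i
  have hb2 : ∀ i x, ‖iteratedFDeriv ℝ 2 (fun y => fderiv ℝ u y (e i)) x‖ ≤ σ₃ := fun i x =>
    (norm_iteratedFDeriv_fderiv_apply_basisFun_le hu 2 (by norm_cast) x i).trans (hσ₃ x)
  have hbl0 : ∀ i, ∫⁻ x, ‖fderiv ℝ u x (e i)‖ₑ ^ 2 < ⊤ := fun i =>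
    lintegral_enorm_sq_lt_top_of_norm_le (nus i) hu1
  have hbl1 : ∀ i, ∫⁻ x, ‖fderiv ℝ (fun y => fderiv ℝ u y (e i)) x‖ₑ ^ 2 < ⊤ := fun i =>
    lintegral_enorm_sq_lt_top_of_norm_le (hb1' i) hu2
  -- freeze the scalar quantities
  obtain ⟨X₁, hX₁⟩ : ∃ X : ℝ, X = ∫ x, frobeniusNormSq (fderiv ℝ w x) := ⟨_, rfl⟩
  obtain ⟨Y₂, hY₂⟩ : ∃ Y : ℝ, Y = ∫ x, ‖(Δ w) x‖ ^ 2 := ⟨_, rfl⟩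
  obtain ⟨H₁, hH₁⟩ : ∃ H : ℝ, H = ∫ x, ‖fderiv ℝ h x‖ ^ 2 := ⟨_, rfl⟩
  obtain ⟨A, hAdef⟩ : ∃ A : ℝ, A = agmonConst := ⟨_, rfl⟩
  have hA0 : 0 ≤ A := by rw [hAdef]; exact agmonConst_nonneg
  have hX₁0 : 0 ≤ X₁ := by rw [hX₁]; exact integral_nonneg fun x => frobeniusNormSq_nonneg _
  have hY₂0 : 0 ≤ Y₂ := by rw [hY₂]; exact integral_nonneg fun x => sq_nonneg _
  have hH₁0 : 0 ≤ H₁ := by rw [hH₁]; exact integral_nonneg fun x => sq_nonneg _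
  -- Agmon for `w`
  obtain ⟨Mw, hMw⟩ : ∃ M : ℝ, M = A * (X₁ * Y₂) ^ (1 / 4 : ℝ) := ⟨_, rfl⟩
  have hMw0 : 0 ≤ Mw := by
    rw [hMw]; exact mul_nonneg hA0 (Real.rpow_nonneg (mul_nonneg hX₁0 hY₂0) _)
  have hMwx : ∀ x, ‖w x‖ ≤ Mw := fun x => by
    rw [hMw, hAdef, hX₁, hY₂]
    exact norm_le_agmonConst_mul_rpow hw hw0 hw1 hw2 hw3 x
  have hMw2 : Mw ^ 2 = A ^ 2 * Real.sqrt (X₁ * Y₂) := by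
    have h4 : ((X₁ * Y₂) ^ (1 / 4 : ℝ)) ^ 2 = Real.sqrt (X₁ * Y₂) := by
      rw [← Real.rpow_natCast, ← Real.rpow_mul (mul_nonneg hX₁0 hY₂0), Real.sqrt_eq_rpow]
      norm_num
    rw [hMw, mul_pow, h4]
  -- per-direction quantities and the per-direction bound
  have key : ∀ i,
      -(2 * ν * ∫ x, ‖(Δ (fun y => fderiv ℝ w y (e i))) x‖ ^ 2) +
        2 * (∫ x, ⟪fderiv ℝ (fun y => convect (fun z => u z + w z) w y + convect w u y) x (e i),
          (Δ (fun y => fderiv ℝ w y (e i))) x⟫) +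
        2 * (∫ x, ⟪fderiv ℝ h x (e i), (Δ (fun y => fderiv ℝ w y (e i))) x⟫) +
        2 * (∫ x, ∑ j, ⟪fderiv ℝ (fun y => fderiv ℝ w y (e i)) x (e j),
          convect (fun y => fderiv ℝ u y (e i)) (fun y => fderiv ℝ w y (e j)) x⟫) ≤
      (4 * G + 9 * κ * σ₂ + 3 * κ ^ 2 * σ₃ + 2 * A ^ 2 * Real.sqrt (X₁ * Y₂) / ν +
          27 * A ^ 4 * X₁ ^ 2 / (16 * ν ^ 3)) *
          (∫ x, frobeniusNormSq (fderiv ℝ (fun y => fderiv ℝ w y (e i)) x)) +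
        9 * σ₂ / κ * X₁ + 3 * σ₃ / κ ^ 2 * L ^ 2 + 2 / ν * H₁ := by
    intro i
    -- the slice `a = ∂ᵢw`, `b = ∂ᵢu`
    have ha := hws i
    have ha0 := hwsk i 0 hw1
    have ha1 := hwsk i 1 hw2
    have ha2 := hwsk i 2 hw3
    have ha3 := hwsk i 3 hw4
    have ha1' : ContDiff ℝ 1 (fun y => fderiv ℝ w y (e i)) := ha.of_le (by norm_cast)
    have cΔ : Continuous fun x => (Δ (fun y => fderiv ℝ w y (e i))) x :=
      (contDiff_one_laplacian_of_contDiff_three (ha.of_le (by norm_cast))).continuous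
    have hΔ2 : ∫⁻ x, ‖(Δ (fun y => fderiv ℝ w y (e i))) x‖ₑ ^ 2 < ⊤ := by
      have hle : ∀ x, ‖(Δ (fun y => fderiv ℝ w y (e i))) x‖ ≤
          ‖(3 : ℝ) • iteratedFDeriv ℝ 2 (fun y => fderiv ℝ w y (e i)) x‖ := fun x => by
        rw [norm_smul, Real.norm_of_nonneg (by norm_num : (0 : ℝ) ≤ 3)]
        exact norm_laplacian_le_three_mul_norm_iteratedFDeriv_two (ha.of_le (by norm_cast)) x
      have h9 : ∫⁻ x, ‖(3 : ℝ) • iteratedFDeriv ℝ 2 (fun y => fderiv ℝ w y (e i)) x‖ₑ ^ 2 < ⊤ := by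
        have e3 : ∀ x, ‖(3 : ℝ) • iteratedFDeriv ℝ 2 (fun y => fderiv ℝ w y (e i)) x‖ₑ ^ 2 =
            ENNReal.ofReal 3 ^ 2 * ‖iteratedFDeriv ℝ 2 (fun y => fderiv ℝ w y (e i)) x‖ₑ ^ 2 :=
          fun x => by
          rw [enorm_smul, mul_pow, Real.enorm_eq_ofReal (by norm_num : (0 : ℝ) ≤ 3)]
        simp_rw [e3]
        rw [lintegral_const_mul' _ _ (ENNReal.pow_ne_top ENNReal.ofReal_ne_top)]
        exact ENNReal.mul_lt_top (lt_top_iff_ne_top.2 (ENNReal.pow_ne_top ENNReal.ofReal_ne_top)) ha2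
      exact lintegral_enorm_sq_lt_top_of_norm_le hle h9
    obtain ⟨-, hP⟩ := r3rob_H2_pairings hu hw ha (hus i) hdivu hB hB₁ hG hσ₂ (hb1 i) (hb2 i)
      (hbl0 i) (hbl1 i) hw0' hw1 hBw₁ hBw₂ hMw0 hMwx hL ha0 ha1 ha2 ha3 (na i)
    rw [← hX₁, ← hAdef] at hP
    -- the derivative of the nonlinearity in direction `eᵢ`
    have hv : ContDiff ℝ ∞ (fun z => u z + w z) := hu.add hw
    have hdN : ∀ x, fderiv ℝ (fun y => convect (fun z => u z + w z) w y + convect w u y) x (e i) =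
        convect u (fun y => fderiv ℝ w y (e i)) x + convect w (fun y => fderiv ℝ w y (e i)) x +
          convect (fun y => fderiv ℝ w y (e i)) u x + convect w (fun y => fderiv ℝ u y (e i)) x +
          fderiv ℝ w x (fderiv ℝ u x (e i)) + fderiv ℝ w x (fderiv ℝ w x (e i)) := by
      intro x
      have d1 : DifferentiableAt ℝ (convect (fun z => u z + w z) w) x :=
        (((hw.fderiv_right (m := ∞) (by simp)).clm_apply hv).differentiable (by simp)) x
      have d2 : DifferentiableAt ℝ (convect w u) x :=
        (((hu.fderiv_right (m := ∞) (by simp)).clm_apply hw).differentiable (by simp)) x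
      rw [fderiv_fun_add d1 d2, _root_.add_apply,
        fderiv_convect_apply_of_contDiff hv hw x (e i), fderiv_convect_apply_of_contDiff hw hu x (e i)]
      have hDv : fderiv ℝ (fun z => u z + w z) x = fderiv ℝ u x + fderiv ℝ w x :=
        fderiv_fun_add ((hu.differentiable (by simp)) x) ((hw.differentiable (by simp)) x)
      rw [hDv]
      simp only [convect, _root_.add_apply, map_add]
      abel
    have hPN : (∫ x, ⟪fderiv ℝ (fun y => convect (fun z => u z + w z) w y + convect w u y) x (e i),
        (Δ (fun y => fderiv ℝ w y (e i))) x⟫) =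
        ∫ x, ⟪convect u (fun y => fderiv ℝ w y (e i)) x + convect w (fun y => fderiv ℝ w y (e i)) x +
          convect (fun y => fderiv ℝ w y (e i)) u x + convect w (fun y => fderiv ℝ u y (e i)) x +
          fderiv ℝ w x (fderiv ℝ u x (e i)) + fderiv ℝ w x (fderiv ℝ w x (e i)),
          (Δ (fun y => fderiv ℝ w y (e i))) x⟫ :=
      integral_congr_ae (Eventually.of_forall fun x => by
        show ⟪_, _⟫ = ⟪_, _⟫
        rw [hdN x])
    rw [hPN]
    -- the forcing pairing
    have hF : ∫ x, ⟪fderiv ℝ h x (e i), (Δ (fun y => fderiv ℝ w y (e i))) x⟫ ≤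
        Real.sqrt H₁ * Real.sqrt (∫ x, ‖(Δ (fun y => fderiv ℝ w y (e i))) x‖ ^ 2) := by
      have nh : ∀ x, ‖fderiv ℝ h x (e i)‖ ≤ ‖fderiv ℝ h x‖ := fun x => by
        simpa [he1] using (fderiv ℝ h x).le_opNorm (e i)
      have chi : Continuous fun x => fderiv ℝ h x (e i) := cDh.clm_apply continuous_const
      have l2hi : ∫⁻ x, ‖fderiv ℝ h x (e i)‖ₑ ^ 2 < ⊤ := lintegral_enorm_sq_lt_top_of_norm_le nh hh1
      have mh : MemLp (fun x => fderiv ℝ h x (e i)) 2 volume := r3rob_memLp_two chi l2hi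
      have mΔ : MemLp (fun x => (Δ (fun y => fderiv ℝ w y (e i))) x) 2 volume := r3rob_memLp_two cΔ hΔ2
      have hcs := integral_norm_mul_norm_le_sqrt_mul_sqrt mh mΔ
      have hH : Real.sqrt (∫ x, ‖fderiv ℝ h x (e i)‖ ^ 2) ≤ Real.sqrt H₁ := by
        refine Real.sqrt_le_sqrt ?_
        rw [hH₁]
        exact integral_mono (FluidPDE.integrable_sq_norm_of_lintegral_lt_top chi l2hi)
          (FluidPDE.integrable_sq_norm_of_lintegral_lt_top cDh hh1)
          fun x => pow_le_pow_left₀ (norm_nonneg _) (nh x) 2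
      by_cases hint : Integrable (fun x => ⟪fderiv ℝ h x (e i), (Δ (fun y => fderiv ℝ w y (e i))) x⟫)
        volume
      · refine le_trans (integral_mono hint ?_ fun x => real_inner_le_norm _ _)
          (hcs.trans (mul_le_mul_of_nonneg_right hH (Real.sqrt_nonneg _)))
        exact integrable_of_norm_le_mul_of_lintegral_sq ((chi.norm.mul cΔ.norm).aestronglyMeasurable)
          chi cΔ l2hi hΔ2 (fun x => by
            rw [Real.norm_of_nonneg (mul_nonneg (norm_nonneg _) (norm_nonneg _))])
      · rw [integral_undef hint]; positivity
    -- scalar bookkeeping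
    obtain ⟨Xa, hXa⟩ : ∃ X : ℝ, X = ∫ x, frobeniusNormSq (fderiv ℝ (fun y => fderiv ℝ w y (e i)) x) :=
      ⟨_, rfl⟩
    obtain ⟨Ya, hYa⟩ : ∃ Y : ℝ, Y = ∫ x, ‖(Δ (fun y => fderiv ℝ w y (e i))) x‖ ^ 2 := ⟨_, rfl⟩
    rw [← hXa, ← hYa] at hP
    rw [← hYa] at hF
    rw [← hXa, ← hYa]
    have hXa0 : 0 ≤ Xa := by rw [hXa]; exact integral_nonneg fun x => frobeniusNormSq_nonneg _
    have hYa0 : 0 ≤ Ya := by rw [hYa]; exact integral_nonneg fun x => sq_nonneg _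
    -- Young / AM–GM
    have y1 : Mw * Real.sqrt Xa * Real.sqrt Ya ≤ ν / 4 * Ya + Mw ^ 2 * Xa / ν :=
      r3rob_young_two hν hXa0 hYa0
    have y2 : Real.sqrt H₁ * Real.sqrt Ya ≤ ν / 4 * Ya + H₁ / ν := by
      have h := r3rob_young_two (M := 1) hν hH₁0 hYa0
      rw [one_mul, one_pow, one_mul] at h
      exact h
    have hν2 : 0 < ν / 2 := by positivity
    have y3 : A * (Xa * Ya) ^ (1 / 4 : ℝ) * Real.sqrt X₁ * Real.sqrt Ya ≤
        ν / 2 * Ya + 27 * (A ^ 4 * X₁ ^ 2 * Xa) / (256 * (ν / 2) ^ 3) := by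
      refine r3rob_young_quartic (by positivity) (by positivity) hYa0 hν2 ?_
      have h4 : ((Xa * Ya) ^ (1 / 4 : ℝ)) ^ 4 = Xa * Ya := by
        rw [← Real.rpow_natCast, ← Real.rpow_mul (mul_nonneg hXa0 hYa0)]
        norm_num
      have eq : (A * (Xa * Ya) ^ (1 / 4 : ℝ) * Real.sqrt X₁ * Real.sqrt Ya) ^ 4 =
          A ^ 4 * ((Xa * Ya) ^ (1 / 4 : ℝ)) ^ 4 * (Real.sqrt X₁ ^ 2) ^ 2 * (Real.sqrt Ya ^ 2) ^ 2 := by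
        ring
      rw [eq, h4, Real.sq_sqrt hX₁0, Real.sq_sqrt hYa0]
      exact le_of_eq (by ring)
    have y4 : 2 * Real.sqrt X₁ * Real.sqrt Xa ≤ κ * Xa + X₁ / κ := by
      have h := r3rob_two_mul_le_kappa (L := Real.sqrt X₁) (s := Real.sqrt Xa) hκ
      rwa [Real.sq_sqrt hXa0, Real.sq_sqrt hX₁0] at h
    have y5 : 2 * L * Real.sqrt Xa ≤ κ ^ 2 * Xa + L ^ 2 / κ ^ 2 := by
      have h := r3rob_two_mul_le_kappa (L := L) (s := Real.sqrt Xa) (pow_pos hκ 2)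
      rwa [Real.sq_sqrt hXa0] at h
    generalize (∫ x, ⟪convect u (fun y => fderiv ℝ w y (e i)) x +
        convect w (fun y => fderiv ℝ w y (e i)) x + convect (fun y => fderiv ℝ w y (e i)) u x +
        convect w (fun y => fderiv ℝ u y (e i)) x + fderiv ℝ w x (fderiv ℝ u x (e i)) +
        fderiv ℝ w x (fderiv ℝ w x (e i)), (Δ (fun y => fderiv ℝ w y (e i))) x⟫) = P at hP ⊢
    generalize (∫ x, ∑ j, ⟪fderiv ℝ (fun y => fderiv ℝ w y (e i)) x (e j),
        convect (fun y => fderiv ℝ u y (e i)) (fun y => fderiv ℝ w y (e j)) x⟫) = S at hP ⊢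
    generalize (∫ x, ⟪fderiv ℝ h x (e i), (Δ (fun y => fderiv ℝ w y (e i))) x⟫) = F at hF ⊢
    have hid1 : 27 * (A ^ 4 * X₁ ^ 2 * Xa) / (256 * (ν / 2) ^ 3) =
        27 * A ^ 4 * X₁ ^ 2 / (32 * ν ^ 3) * Xa := by
      field_simp
      ring
    rw [hid1] at y3
    have hc1 : 9 * σ₂ * Real.sqrt X₁ * Real.sqrt Xa ≤ 9 / 2 * σ₂ * (κ * Xa + X₁ / κ) := by
      have := mul_le_mul_of_nonneg_left y4 (by positivity : (0 : ℝ) ≤ 9 / 2 * σ₂)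
      linarith [this]
    have hc2 : 3 * σ₃ * L * Real.sqrt Xa ≤ 3 / 2 * σ₃ * (κ ^ 2 * Xa + L ^ 2 / κ ^ 2) := by
      have := mul_le_mul_of_nonneg_left y5 (by positivity : (0 : ℝ) ≤ 3 / 2 * σ₃)
      linarith [this]
    rw [hMw2] at y1
    have hid2 : (4 * G + 9 * κ * σ₂ + 3 * κ ^ 2 * σ₃ + 2 * A ^ 2 * Real.sqrt (X₁ * Y₂) / ν +
          27 * A ^ 4 * X₁ ^ 2 / (16 * ν ^ 3)) * Xa +
        9 * σ₂ / κ * X₁ + 3 * σ₃ / κ ^ 2 * L ^ 2 + 2 / ν * H₁ =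
        -(2 * ν * Ya) +
          2 * (2 * G * Xa + 9 / 2 * σ₂ * (κ * Xa + X₁ / κ) + 3 / 2 * σ₃ * (κ ^ 2 * Xa + L ^ 2 / κ ^ 2) +
            (ν / 4 * Ya + A ^ 2 * Real.sqrt (X₁ * Y₂) * Xa / ν) +
            (ν / 2 * Ya + 27 * A ^ 4 * X₁ ^ 2 / (32 * ν ^ 3) * Xa)) +
          2 * (ν / 4 * Ya + H₁ / ν) := by
      field_simp
      ring
    rw [hid2]
    linarith [hP, hF, y1, y2, y3, hc1, hc2]
  -- the symmetric term over all directions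
  have hI : ∀ i, Integrable (fun x => ∑ j, ⟪fderiv ℝ (fun y => fderiv ℝ w y (e i)) x (e j),
      convect (fun y => fderiv ℝ u y (e i)) (fun y => fderiv ℝ w y (e j)) x⟫) volume := fun i =>
    (r3rob_H2_pairings hu hw (hws i) (hus i) hdivu hB hB₁ hG hσ₂ (hb1 i) (hb2 i)
      (hbl0 i) (hbl1 i) hw0' hw1 hBw₁ hBw₂ hMw0 hMwx hL (hwsk i 0 hw1) (hwsk i 1 hw2)
      (hwsk i 2 hw3) (hwsk i 3 hw4) (na i)).1
  have hFr : ∀ j, Integrable (fun x => frobeniusNormSq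
      (fderiv ℝ (fun y => fderiv ℝ w y (e j)) x)) volume := fun j => by
    have hj1 : ContDiff ℝ 1 (fun y => fderiv ℝ w y (e j)) := (hws j).of_le (by norm_cast)
    refine integrable_of_continuous_of_nonneg
      (FluidPDE.continuous_frobeniusNormSq_fderiv hj1 one_ne_zero) (fun x => frobeniusNormSq_nonneg _) ?_
    calc ∫⁻ x, ENNReal.ofReal (frobeniusNormSq (fderiv ℝ (fun y => fderiv ℝ w y (e j)) x))
        ≤ ∫⁻ x, 3 * ‖iteratedFDeriv ℝ 1 (fun y => fderiv ℝ w y (e j)) x‖ₑ ^ 2 :=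
          lintegral_mono fun x => by
            rw [← ofReal_norm, norm_iteratedFDeriv_one, ofReal_norm]
            exact ofReal_frobeniusNormSq_le_three_mul_enorm_sq _
      _ = 3 * ∫⁻ x, ‖iteratedFDeriv ℝ 1 (fun y => fderiv ℝ w y (e j)) x‖ₑ ^ 2 :=
          lintegral_const_mul' _ _ (by norm_num)
      _ < ⊤ := ENNReal.mul_lt_top (by norm_num) (hwsk j 1 hw2)
  have hsym := r3rob_H2_symmetric_le (u := u) hw hG hI hFr
  -- sum the three directions
  have k0 := key 0
  have k1 := key 1
  have k2 := key 2
  rw [Fin.sum_univ_three, Fin.sum_univ_three] at hsym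
  rw [Fin.sum_univ_three, Fin.sum_univ_three]
  rw [← hX₁, ← hY₂, ← hH₁, ← hAdef]
  exact r3rob_H2_sum3 k0 k1 k2 hsym

end H2


/-! ## §C The `H²` flux identity along two classical solutions of the class, per direction -/

section FluxH2

variable {ν T : ℝ} {f g u v : ℝ → EuclideanSpace ℝ (Fin 3) → EuclideanSpace ℝ (Fin 3)}
variable {p q : ℝ → EuclideanSpace ℝ (Fin 3) → ℝ}

/-- **The derivative density of `∫|∇∂ᵢ(v − u)|²_F` along two classical solutions, identified**
(Dashti–Robinson 2008, proof of Thm 2, first display, on `ℝ³`, one direction at a time): let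
`(u, p)` (force `f`) and `(v, q)` (force `g`) be classical solutions on `[0, T] × ℝ³` in the
`L²`-Sobolev class, the forces with square-integrable first derivatives, `w = v − u`,
`wᵢ = ∂ᵢw`, `N = (v·∇)w + (w·∇)u`. Then at every `t ∈ [0, T]`
`∫ 2Σⱼ⟪∂ⱼwᵢ, ∂ⱼ∂ₜwᵢ⟫ = −2ν∫‖Δwᵢ‖² + 2∫⟪∂ᵢN, Δwᵢ⟫ + 2∫⟪∂ᵢ(f − g), Δwᵢ⟫`
(`integral_sum_inner_fderiv_fderiv_eq_of_eq_laplacian` applied to the differentiated equation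
`∂ₜwᵢ = νΔwᵢ − ∇∂ᵢ(q − p) + ∂ᵢ(g − f) − ∂ᵢN`, with `∂ₜ∂ᵢ = ∂ᵢ∂ₜ`, `∂ᵢΔ = Δ∂ᵢ`, `∂ᵢ∇ = ∇∂ᵢ`).
[cite: DashtiRobinson2008, Thm 2 (proof)] -/
theorem IsClassicalNSSolutionOn.flux_identity_H2_sub_forces (hT : 0 < T)
    (hv : IsClassicalNSSolutionOn (Icc 0 T) ν g v q) (hu : IsClassicalNSSolutionOn (Icc 0 T) ν f u p)
    (hU : HasBoundedSobolevNormsOn (Icc 0 T) u)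
    (hUt : HasBoundedSobolevNormsOn (Icc 0 T) (timeDerivWithin (Icc 0 T) u))
    (hp : ∀ n : ℕ, ∃ C : ℝ≥0, ∀ t ∈ Icc 0 T, ∫⁻ x, ‖iteratedFDeriv ℝ n (p t) x‖ₑ ^ 2 ≤ C)
    (hV : HasBoundedSobolevNormsOn (Icc 0 T) v)
    (hVt : HasBoundedSobolevNormsOn (Icc 0 T) (timeDerivWithin (Icc 0 T) v))
    (hq : ∀ n : ℕ, ∃ C : ℝ≥0, ∀ t ∈ Icc 0 T, ∫⁻ x, ‖iteratedFDeriv ℝ n (q t) x‖ₑ ^ 2 ≤ C)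
    (hfD : ∀ t ∈ Icc 0 T, ∫⁻ x, ‖fderiv ℝ (f t) x‖ₑ ^ 2 < ⊤)
    (hgD : ∀ t ∈ Icc 0 T, ∫⁻ x, ‖fderiv ℝ (g t) x‖ₑ ^ 2 < ⊤)
    {t : ℝ} (ht : t ∈ Icc 0 T) (i : Fin 3) :
    ∫ x, 2 * ∑ j, ⟪fderiv ℝ (fun y => fderiv ℝ ((v - u) t) y (EuclideanSpace.basisFun (Fin 3) ℝ i)) x
          (EuclideanSpace.basisFun (Fin 3) ℝ j),
        fderiv ℝ (timeDerivWithin (Icc 0 T)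
          (fun s y => fderiv ℝ ((v - u) s) y (EuclideanSpace.basisFun (Fin 3) ℝ i)) t) x
          (EuclideanSpace.basisFun (Fin 3) ℝ j)⟫ =
      -(2 * ν * ∫ x, ‖(Δ (fun y => fderiv ℝ ((v - u) t) y (EuclideanSpace.basisFun (Fin 3) ℝ i))) x‖ ^ 2) +
        2 * (∫ x, ⟪fderiv ℝ (fun y => convect (v t) ((v - u) t) y + convect ((v - u) t) (u t) y) x
            (EuclideanSpace.basisFun (Fin 3) ℝ i),
          (Δ (fun y => fderiv ℝ ((v - u) t) y (EuclideanSpace.basisFun (Fin 3) ℝ i))) x⟫) +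
        2 * (∫ x, ⟪fderiv ℝ (fun y => f t y - g t y) x (EuclideanSpace.basisFun (Fin 3) ℝ i),
          (Δ (fun y => fderiv ℝ ((v - u) t) y (EuclideanSpace.basisFun (Fin 3) ℝ i))) x⟫) := by
  have hU' : UniqueDiffOn ℝ (Icc 0 T) := uniqueDiffOn_Icc hT
  have hcl : Icc 0 T ⊆ closure (interior (Icc 0 T)) := by
    rw [interior_Icc, closure_Ioo hT.ne]
  set e := EuclideanSpace.basisFun (Fin 3) ℝ with he
  have he1 : ∀ j, ‖e j‖ = 1 := fun j => by simp [he]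
  -- the slice fields
  have hwsm : IsSmoothSpaceTimeOn (Icc 0 T) (v - u) := hv.smooth_velocity.sub hu.smooth_velocity
  obtain ⟨w', hw'def⟩ : ∃ w' : EuclideanSpace ℝ (Fin 3) → EuclideanSpace ℝ (Fin 3),
      w' = (v - u) t := ⟨_, rfl⟩
  obtain ⟨W', hW'def⟩ : ∃ W' : EuclideanSpace ℝ (Fin 3) → EuclideanSpace ℝ (Fin 3),
      W' = timeDerivWithin (Icc 0 T) (v - u) t := ⟨_, rfl⟩
  obtain ⟨π', hπ'def⟩ : ∃ π' : EuclideanSpace ℝ (Fin 3) → ℝ, π' = (q - p) t := ⟨_, rfl⟩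
  have hfam : timeDerivWithin (Icc 0 T) (fun s y => fderiv ℝ ((v - u) s) y (e i)) t =
      fun x => fderiv ℝ W' x (e i) := by
    funext x
    rw [hW'def]
    exact hwsm.timeDerivWithin_fderiv_slice_apply hU' hcl ht x (e i)
  rw [hfam, ← hw'def]
  obtain ⟨w, hwdef⟩ : ∃ w : EuclideanSpace ℝ (Fin 3) → EuclideanSpace ℝ (Fin 3),
      w = fun y => fderiv ℝ w' y (e i) := ⟨_, rfl⟩
  obtain ⟨W, hWdef⟩ : ∃ W : EuclideanSpace ℝ (Fin 3) → EuclideanSpace ℝ (Fin 3),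
      W = fun x => fderiv ℝ W' x (e i) := ⟨_, rfl⟩
  obtain ⟨π, hπdef⟩ : ∃ π : EuclideanSpace ℝ (Fin 3) → ℝ, π = fun x => fderiv ℝ π' x (e i) :=
    ⟨_, rfl⟩
  obtain ⟨N, hNdef⟩ : ∃ N : EuclideanSpace ℝ (Fin 3) → EuclideanSpace ℝ (Fin 3),
      N = fun x => convect (v t) w' x + convect w' (u t) x := ⟨_, rfl⟩
  obtain ⟨k, hkdef⟩ : ∃ k : EuclideanSpace ℝ (Fin 3) → EuclideanSpace ℝ (Fin 3),
      k = fun x => f t x - g t x := ⟨_, rfl⟩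
  obtain ⟨R, hRdef⟩ : ∃ R : EuclideanSpace ℝ (Fin 3) → EuclideanSpace ℝ (Fin 3),
      R = fun x => -(fderiv ℝ k x (e i)) - fderiv ℝ N x (e i) := ⟨_, rfl⟩
  rw [← hwdef, ← hWdef, ← hNdef, ← hkdef]
  -- smoothness
  have hw' : ContDiff ℝ ∞ w' := by rw [hw'def]; exact hwsm.contDiff_slice ht
  have hw'3 : ContDiff ℝ 3 w' := hw'.of_le (by norm_cast)
  have hw'2 : ContDiff ℝ 2 w' := hw'.of_le (by norm_cast)
  have hw'1 : ContDiff ℝ 1 w' := hw'.of_le (by norm_cast)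
  have hW' : ContDiff ℝ ∞ W' := by rw [hW'def]; exact (hwsm.timeDerivWithin hU').contDiff_slice ht
  have hπsm : IsSmoothSpaceTimeOn (Icc 0 T) (q - p) := hv.smooth_pressure.sub hu.smooth_pressure
  have hπ' : ContDiff ℝ ∞ π' := by rw [hπ'def]; exact hπsm.contDiff_slice ht
  have hπ'2 : ContDiff ℝ 2 π' := hπ'.of_le (by norm_cast)
  have hut : ContDiff ℝ ∞ (u t) := hu.contDiff_velocity ht
  have hvt : ContDiff ℝ ∞ (v t) := hv.contDiff_velocity ht
  have hut1 : ContDiff ℝ 1 (u t) := hut.of_le (by norm_cast)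
  have hfsm : IsSmoothSpaceTimeOn (Icc 0 T) f := hu.isSmoothSpaceTimeOn_force hU'
  have hgsm : IsSmoothSpaceTimeOn (Icc 0 T) g := hv.isSmoothSpaceTimeOn_force hU'
  have hft : ContDiff ℝ ∞ (f t) := hfsm.contDiff_slice ht
  have hgt : ContDiff ℝ ∞ (g t) := hgsm.contDiff_slice ht
  have hk : ContDiff ℝ ∞ k := by rw [hkdef]; exact hft.sub hgt
  have hk1 : ContDiff ℝ 1 k := hk.of_le (by norm_cast)
  have hw : ContDiff ℝ ∞ w := by
    rw [hwdef]; exact (hw'.fderiv_right (m := ∞) (by simp)).clm_apply contDiff_const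
  have hw3 : ContDiff ℝ 3 w := hw.of_le (by norm_cast)
  have hW : ContDiff ℝ ∞ W := by
    rw [hWdef]; exact (hW'.fderiv_right (m := ∞) (by simp)).clm_apply contDiff_const
  have hW1 : ContDiff ℝ 1 W := hW.of_le (by norm_cast)
  have hπ : ContDiff ℝ ∞ π := by
    rw [hπdef]; exact (hπ'.fderiv_right (m := ∞) (by simp)).clm_apply contDiff_const
  have hπ1 : ContDiff ℝ 1 π := hπ.of_le (by norm_cast)
  have hN : ContDiff ℝ ∞ N := by
    rw [hNdef]
    exact ((hw'.fderiv_right (m := ∞) (by simp)).clm_apply hvt).add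
      ((hut.fderiv_right (m := ∞) (by simp)).clm_apply hw')
  have hN1 : ContDiff ℝ 1 N := hN.of_le (by norm_cast)
  have cΔ : Continuous (Δ w) := (contDiff_one_laplacian_of_contDiff_three hw3).continuous
  have cW : Continuous W := hW.continuous
  have cDk : Continuous (fun x => fderiv ℝ k x (e i)) :=
    (hk1.continuous_fderiv one_ne_zero).clm_apply continuous_const
  have cDN : Continuous (fun x => fderiv ℝ N x (e i)) :=
    (hN1.continuous_fderiv one_ne_zero).clm_apply continuous_const
  have cR : Continuous R := by rw [hRdef]; exact cDk.neg.sub cDN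
  have cgπ : Continuous (gradient π) := by
    have : gradient π = fun x => (InnerProductSpace.toDual ℝ _).symm (fderiv ℝ π x) := rfl
    rw [this]
    exact (InnerProductSpace.toDual ℝ (EuclideanSpace ℝ (Fin 3))).symm.continuous.comp
      (hπ1.continuous_fderiv one_ne_zero)
  -- the equation for the difference at the `H¹` level, as a function identity
  have hE1 : W' = fun x => ν • (Δ w') x - N x - gradient π' x - k x := by
    funext x
    have e1 := hv.timeDerivWithin_sub_eq_forces hu ht x
    rw [← hw'def, ← hW'def, ← hπ'def] at e1
    rw [e1, hNdef, hkdef]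
    simp only
    abel
  -- differentiate it in the direction `eᵢ`
  have dΔ : ∀ x, DifferentiableAt ℝ (Δ w') x := fun x =>
    ((contDiff_one_laplacian_of_contDiff_three hw'3).differentiable one_ne_zero) x
  have hEq : ∀ x, W x = ν • (Δ w) x - gradient π x + R x := by
    intro x
    have dN : DifferentiableAt ℝ N x := (hN1.differentiable one_ne_zero) x
    have dG : DifferentiableAt ℝ (gradient π') x := by
      show DifferentiableAt ℝ
        (fun y => (InnerProductSpace.toDual ℝ (EuclideanSpace ℝ (Fin 3))).symm (fderiv ℝ π' y)) x
      exact ((InnerProductSpace.toDual ℝ (EuclideanSpace ℝ (Fin 3))).symm.differentiable.differentiableAt).comp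
        x (((hπ'2.fderiv_right (m := 1) (by norm_num)).differentiable one_ne_zero) x)
    have dk : DifferentiableAt ℝ k x := (hk1.differentiable one_ne_zero) x
    have H : HasFDerivAt (fun y => ν • (Δ w') y - N y - gradient π' y - k y)
        (ν • fderiv ℝ (Δ w') x - fderiv ℝ N x - fderiv ℝ (gradient π') x - fderiv ℝ k x) x :=
      ((((dΔ x).hasFDerivAt.const_smul ν).sub dN.hasFDerivAt).sub dG.hasFDerivAt).sub dk.hasFDerivAt
    have hDW' : fderiv ℝ W' x = ν • fderiv ℝ (Δ w') x - fderiv ℝ N x - fderiv ℝ (gradient π') x -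
        fderiv ℝ k x := by
      rw [hE1]; exact H.fderiv
    have h1 : W x = fderiv ℝ W' x (e i) := by rw [hWdef]
    rw [h1, hDW']
    simp only [FunLike.coe_sub, FunLike.coe_smul, Pi.sub_apply,
      Pi.smul_apply]
    rw [fderiv_laplacian_apply_of_contDiff_three hw'3 x (e i), r3rob_fderiv_gradient_apply hπ'2 x (e i),
      hwdef, hπdef]
    simp only [hRdef]
    abel
  have hdivw' : VectorCalculus.IsDivFree w' := by rw [hw'def]; exact r3rob_isDivFree_sub hv hu ht
  have hdivw : VectorCalculus.IsDivFree w := by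
    rw [hwdef]; exact hdivw'.fderiv_apply hw'2 (e i)
  -- Sobolev bounds of the slices
  have hwsob : ∀ n : ℕ, ∃ C : ℝ≥0, ∀ s ∈ Icc 0 T, ∫⁻ x, ‖iteratedFDeriv ℝ n ((v - u) s) x‖ₑ ^ 2 ≤ C :=
    r3rob_sobolev_sub (fun s _ x => rfl) (fun s hs => hv.contDiff_velocity hs)
      (fun s hs => hu.contDiff_velocity hs) hV hU
  have hWsob : ∀ n : ℕ, ∃ C : ℝ≥0, ∀ s ∈ Icc 0 T,
      ∫⁻ x, ‖iteratedFDeriv ℝ n (timeDerivWithin (Icc 0 T) (v - u) s) x‖ₑ ^ 2 ≤ C :=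
    r3rob_sobolev_sub (fun s hs x => hv.smooth_velocity.timeDerivWithin_sub hu.smooth_velocity hs x)
      (fun s hs => (hv.smooth_velocity.timeDerivWithin hU').contDiff_slice hs)
      (fun s hs => (hu.smooth_velocity.timeDerivWithin hU').contDiff_slice hs) hVt hUt
  have hπsob : ∀ n : ℕ, ∃ C : ℝ≥0, ∀ s ∈ Icc 0 T, ∫⁻ x, ‖iteratedFDeriv ℝ n ((q - p) s) x‖ₑ ^ 2 ≤ C :=
    r3rob_sobolev_sub (fun s _ x => rfl) (fun s hs => hv.contDiff_pressure hs)
      (fun s hs => hu.contDiff_pressure hs) hq hp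
  have hw'k : ∀ k' : ℕ, ∫⁻ x, ‖iteratedFDeriv ℝ k' w' x‖ₑ ^ 2 < ⊤ := fun k' => by
    rw [hw'def]; exact r3rob_fin ht k' (hwsob k')
  have hW'k : ∀ k' : ℕ, ∫⁻ x, ‖iteratedFDeriv ℝ k' W' x‖ₑ ^ 2 < ⊤ := fun k' => by
    rw [hW'def]; exact r3rob_fin ht k' (hWsob k')
  have hπ'k : ∀ k' : ℕ, ∫⁻ x, ‖iteratedFDeriv ℝ k' π' x‖ₑ ^ 2 < ⊤ := fun k' => by
    rw [hπ'def]; exact r3rob_fin ht k' (hπsob k')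
  have hwk : ∀ k' : ℕ, ∫⁻ x, ‖iteratedFDeriv ℝ k' w x‖ₑ ^ 2 < ⊤ := fun k' => by
    rw [hwdef]
    exact lintegral_enorm_sq_lt_top_of_norm_le
      (fun x => norm_iteratedFDeriv_fderiv_apply_basisFun_le hw' k' (by exact_mod_cast le_top) x i)
      (hw'k (k' + 1))
  have hWk : ∀ k' : ℕ, ∫⁻ x, ‖iteratedFDeriv ℝ k' W x‖ₑ ^ 2 < ⊤ := fun k' => by
    rw [hWdef]
    exact lintegral_enorm_sq_lt_top_of_norm_le
      (fun x => norm_iteratedFDeriv_fderiv_apply_basisFun_le hW' k' (by exact_mod_cast le_top) x i)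
      (hW'k (k' + 1))
  have hπk : ∀ k' : ℕ, ∫⁻ x, ‖iteratedFDeriv ℝ k' π x‖ₑ ^ 2 < ⊤ := fun k' => by
    rw [hπdef]
    exact lintegral_enorm_sq_lt_top_of_norm_le
      (fun x => norm_iteratedFDeriv_fderiv_apply_basisFun_le hπ' k' (by exact_mod_cast le_top) x i)
      (hπ'k (k' + 1))
  have hW0 : ∫⁻ x, ‖W x‖ₑ ^ 2 < ⊤ := by
    refine lt_of_le_of_lt (le_of_eq (lintegral_congr fun x => ?_)) (hWk 0)
    rw [← ofReal_norm, ← ofReal_norm, norm_iteratedFDeriv_zero]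
  have hπ0 : ∫⁻ x, ‖π x‖ₑ ^ 2 < ⊤ := by
    refine lt_of_le_of_lt (le_of_eq (lintegral_congr fun x => ?_)) (hπk 0)
    rw [← ofReal_norm, ← ofReal_norm, norm_iteratedFDeriv_zero]
  -- `Δw`, `∇π` in `L²`
  have n_Δ : ∀ x, ‖(Δ w) x‖ ≤ ‖(3 : ℝ) • iteratedFDeriv ℝ 2 w x‖ := fun x => by
    rw [norm_smul, Real.norm_of_nonneg (by norm_num : (0 : ℝ) ≤ 3)]
    exact norm_laplacian_le_three_mul_norm_iteratedFDeriv_two (hw.of_le (by norm_cast)) x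
  have l2Δ : ∫⁻ x, ‖(Δ w) x‖ₑ ^ 2 < ⊤ :=
    lintegral_enorm_sq_lt_top_of_norm_le n_Δ (r3rob_lintegral_sq_smul_lt_top 3 (hwk 2))
  have n_gπ : ∀ x, ‖gradient π x‖ = ‖iteratedFDeriv ℝ 1 π x‖ := fun x => by
    rw [gradient, LinearIsometryEquiv.norm_map, ← norm_iteratedFDeriv_fderiv, norm_iteratedFDeriv_zero]
  have l2gπ : ∫⁻ x, ‖gradient π x‖ₑ ^ 2 < ⊤ :=
    lintegral_enorm_sq_lt_top_of_norm_le (fun x => (n_gπ x).le) (hπk 1)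
  -- `R = W − νΔw + ∇π ∈ L²`
  have hRalt : ∀ x, R x = (W x - ν • (Δ w) x) + gradient π x := fun x => by
    rw [hEq x]; abel
  have hR0 : ∫⁻ x, ‖R x‖ₑ ^ 2 < ⊤ := by
    obtain ⟨a, hadef⟩ : ∃ a : EuclideanSpace ℝ (Fin 3) → EuclideanSpace ℝ (Fin 3),
        a = fun x => W x - ν • (Δ w) x := ⟨_, rfl⟩
    have ca : Continuous a := by rw [hadef]; exact cW.sub (cΔ.const_smul ν)
    have hνΔ : ∫⁻ x, ‖ν • (Δ w) x‖ₑ ^ 2 < ⊤ := r3rob_lintegral_sq_smul_lt_top ν l2Δ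
    have h1 : ∫⁻ x, ‖a x‖ₑ ^ 2 < ⊤ := by
      rw [hadef]
      exact r3rob_lintegral_sq_sub_lt_top cW.aestronglyMeasurable hW0 hνΔ
    have h2 : ∫⁻ x, ‖a x + gradient π x‖ₑ ^ 2 < ⊤ :=
      r3rob_lintegral_sq_add_lt_top ca.aestronglyMeasurable h1 l2gπ
    refine lt_of_le_of_lt (le_of_eq (lintegral_congr fun x => ?_)) h2
    rw [hRalt x, hadef]
  -- `∂ᵢ(f − g) ∈ L²`, `∂ᵢN ∈ L²`
  have hDk : ∀ x, fderiv ℝ k x (e i) = fderiv ℝ (f t) x (e i) - fderiv ℝ (g t) x (e i) := by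
    intro x
    rw [hkdef, fderiv_fun_sub ((hft.differentiable (by simp)) x) ((hgt.differentiable (by simp)) x),
      FunLike.coe_sub, Pi.sub_apply]
  have l2Df : ∫⁻ x, ‖fderiv ℝ (f t) x (e i)‖ₑ ^ 2 < ⊤ :=
    lintegral_enorm_sq_lt_top_of_norm_le
      (fun x => by simpa [he1] using (fderiv ℝ (f t) x).le_opNorm (e i)) (hfD t ht)
  have l2Dg : ∫⁻ x, ‖fderiv ℝ (g t) x (e i)‖ₑ ^ 2 < ⊤ :=
    lintegral_enorm_sq_lt_top_of_norm_le
      (fun x => by simpa [he1] using (fderiv ℝ (g t) x).le_opNorm (e i)) (hgD t ht)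
  have cDf : Continuous (fun x => fderiv ℝ (f t) x (e i)) :=
    ((hft.of_le (by norm_cast) : ContDiff ℝ 1 (f t)).continuous_fderiv one_ne_zero).clm_apply
      continuous_const
  have l2Dk : ∫⁻ x, ‖fderiv ℝ k x (e i)‖ₑ ^ 2 < ⊤ := by
    refine lt_of_le_of_lt (le_of_eq (lintegral_congr fun x => by rw [hDk x])) ?_
    exact r3rob_lintegral_sq_sub_lt_top cDf.aestronglyMeasurable l2Df l2Dg
  have l2DN : ∫⁻ x, ‖fderiv ℝ N x (e i)‖ₑ ^ 2 < ⊤ := by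
    have eN : ∀ x, fderiv ℝ N x (e i) = -(fderiv ℝ k x (e i)) - R x := fun x => by
      simp only [hRdef]; abel
    have l2nk : ∫⁻ x, ‖-(fderiv ℝ k x (e i))‖ₑ ^ 2 < ⊤ := by simp_rw [enorm_neg]; exact l2Dk
    refine lt_of_le_of_lt (le_of_eq (lintegral_congr fun x => by rw [eN x])) ?_
    exact r3rob_lintegral_sq_sub_lt_top cDk.neg.aestronglyMeasurable l2nk hR0
  -- integrability of the two pairings
  have iΔN : Integrable (fun x => ⟪(Δ w) x, fderiv ℝ N x (e i)⟫) volume :=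
    integrable_of_norm_le_mul_of_lintegral_sq (cΔ.inner cDN).aestronglyMeasurable cΔ cDN l2Δ l2DN
      fun x => norm_inner_le_norm _ _
  have iΔk : Integrable (fun x => ⟪(Δ w) x, fderiv ℝ k x (e i)⟫) volume :=
    integrable_of_norm_le_mul_of_lintegral_sq (cΔ.inner cDk).aestronglyMeasurable cΔ cDk l2Δ l2Dk
      fun x => norm_inner_le_norm _ _
  -- the slice identity
  have hslice := integral_sum_inner_fderiv_fderiv_eq_of_eq_laplacian (ν := ν) hw3 hW1 hπ1 cR hdivw
    hEq (hwk 1) (hwk 2) (hwk 3) hW0 (hWk 1) hπ0 (hπk 1) hR0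
  -- bookkeeping of the right-hand side
  have hR_split : ∫ x, ⟪(Δ w) x, R x⟫ =
      -(∫ x, ⟪(Δ w) x, fderiv ℝ k x (e i)⟫) - ∫ x, ⟪(Δ w) x, fderiv ℝ N x (e i)⟫ := by
    have iΔk' : Integrable (fun x => -⟪(Δ w) x, fderiv ℝ k x (e i)⟫) volume := iΔk.neg
    rw [← integral_neg, ← integral_sub iΔk' iΔN]
    refine integral_congr_ae (Eventually.of_forall fun x => ?_)
    show ⟪(Δ w) x, R x⟫ = -⟪(Δ w) x, fderiv ℝ k x (e i)⟫ - ⟪(Δ w) x, fderiv ℝ N x (e i)⟫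
    simp only [hRdef, inner_sub_right, inner_neg_right]
  have hN_comm : ∫ x, ⟪(Δ w) x, fderiv ℝ N x (e i)⟫ = ∫ x, ⟪fderiv ℝ N x (e i), (Δ w) x⟫ :=
    integral_congr_ae (Eventually.of_forall fun x => real_inner_comm _ _)
  have hk_comm : ∫ x, ⟪(Δ w) x, fderiv ℝ k x (e i)⟫ = ∫ x, ⟪fderiv ℝ k x (e i), (Δ w) x⟫ :=
    integral_congr_ae (Eventually.of_forall fun x => real_inner_comm _ _)
  rw [integral_const_mul, hslice, hR_split, hN_comm, hk_comm]
  ring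

end FluxH2


/-! ## §D The `H²` balance of the difference along two classical solutions -/

section BalanceH2

variable {ν T : ℝ} {f g u v : ℝ → EuclideanSpace ℝ (Fin 3) → EuclideanSpace ℝ (Fin 3)}
variable {p q : ℝ → EuclideanSpace ℝ (Fin 3) → ℝ}

/-- **`H²` balance of the difference of two classical solutions of the class, flux identified**
(Dashti–Robinson 2008, proof of Thm 2, integrated in time, on `ℝ³`): with `wᵢ = ∂ᵢ(v − u)`,
`Z(t) = Σᵢ∫|∇wᵢ(t)|²_F` and the `H²` flux
`F(t) = Σᵢ[−2ν∫‖Δwᵢ‖² + 2∫⟪∂ᵢN, Δwᵢ⟫ + 2∫⟪∂ᵢ(f − g), Δwᵢ⟫]`, `F` is integrable on `[0, T]`,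
`Z` is continuous on `[0, T]`, and `Z(b) = Z(0) + ∫₀ᵇ F` for `b ∈ [0, T]`
(`IsSmoothSpaceTimeOn.enstrophy_balance` on the three families `∂ᵢ(v − u)` and
`IsClassicalNSSolutionOn.flux_identity_H2_sub_forces`). [cite: DashtiRobinson2008, Thm 2 (proof)] -/
theorem IsClassicalNSSolutionOn.hessian_sub_balance_forces (hT : 0 < T)
    (hv : IsClassicalNSSolutionOn (Icc 0 T) ν g v q) (hu : IsClassicalNSSolutionOn (Icc 0 T) ν f u p)
    (hU : HasBoundedSobolevNormsOn (Icc 0 T) u)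
    (hUt : HasBoundedSobolevNormsOn (Icc 0 T) (timeDerivWithin (Icc 0 T) u))
    (hp : ∀ n : ℕ, ∃ C : ℝ≥0, ∀ t ∈ Icc 0 T, ∫⁻ x, ‖iteratedFDeriv ℝ n (p t) x‖ₑ ^ 2 ≤ C)
    (hV : HasBoundedSobolevNormsOn (Icc 0 T) v)
    (hVt : HasBoundedSobolevNormsOn (Icc 0 T) (timeDerivWithin (Icc 0 T) v))
    (hq : ∀ n : ℕ, ∃ C : ℝ≥0, ∀ t ∈ Icc 0 T, ∫⁻ x, ‖iteratedFDeriv ℝ n (q t) x‖ₑ ^ 2 ≤ C)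
    (hfD : ∀ t ∈ Icc 0 T, ∫⁻ x, ‖fderiv ℝ (f t) x‖ₑ ^ 2 < ⊤)
    (hgD : ∀ t ∈ Icc 0 T, ∫⁻ x, ‖fderiv ℝ (g t) x‖ₑ ^ 2 < ⊤) :
    IntegrableOn (fun t => ∑ i,
        (-(2 * ν * ∫ x, ‖(Δ (fun y => fderiv ℝ ((v - u) t) y
            (EuclideanSpace.basisFun (Fin 3) ℝ i))) x‖ ^ 2) +
          2 * (∫ x, ⟪fderiv ℝ (fun y => convect (v t) ((v - u) t) y + convect ((v - u) t) (u t) y) x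
              (EuclideanSpace.basisFun (Fin 3) ℝ i),
            (Δ (fun y => fderiv ℝ ((v - u) t) y (EuclideanSpace.basisFun (Fin 3) ℝ i))) x⟫) +
          2 * (∫ x, ⟪fderiv ℝ (fun y => f t y - g t y) x (EuclideanSpace.basisFun (Fin 3) ℝ i),
            (Δ (fun y => fderiv ℝ ((v - u) t) y (EuclideanSpace.basisFun (Fin 3) ℝ i))) x⟫)))
      (Icc 0 T) ∧
    ContinuousOn (fun t => ∑ i, ∫ x, frobeniusNormSq
      (fderiv ℝ (fun y => fderiv ℝ ((v - u) t) y (EuclideanSpace.basisFun (Fin 3) ℝ i)) x)) (Icc 0 T) ∧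
    ∀ b ∈ Icc 0 T, (∑ i, ∫ x, frobeniusNormSq
        (fderiv ℝ (fun y => fderiv ℝ ((v - u) b) y (EuclideanSpace.basisFun (Fin 3) ℝ i)) x)) =
      (∑ i, ∫ x, frobeniusNormSq
        (fderiv ℝ (fun y => fderiv ℝ ((v - u) 0) y (EuclideanSpace.basisFun (Fin 3) ℝ i)) x)) +
        ∫ t in (0 : ℝ)..b, ∑ i,
          (-(2 * ν * ∫ x, ‖(Δ (fun y => fderiv ℝ ((v - u) t) y
              (EuclideanSpace.basisFun (Fin 3) ℝ i))) x‖ ^ 2) +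
            2 * (∫ x, ⟪fderiv ℝ (fun y => convect (v t) ((v - u) t) y + convect ((v - u) t) (u t) y) x
                (EuclideanSpace.basisFun (Fin 3) ℝ i),
              (Δ (fun y => fderiv ℝ ((v - u) t) y (EuclideanSpace.basisFun (Fin 3) ℝ i))) x⟫) +
            2 * (∫ x, ⟪fderiv ℝ (fun y => f t y - g t y) x (EuclideanSpace.basisFun (Fin 3) ℝ i),
              (Δ (fun y => fderiv ℝ ((v - u) t) y (EuclideanSpace.basisFun (Fin 3) ℝ i))) x⟫)) := by
  have hU' : UniqueDiffOn ℝ (Icc 0 T) := uniqueDiffOn_Icc hT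
  have hcl : Icc 0 T ⊆ closure (interior (Icc 0 T)) := by
    rw [interior_Icc, closure_Ioo hT.ne]
  set e := EuclideanSpace.basisFun (Fin 3) ℝ with he
  have hwsm : IsSmoothSpaceTimeOn (Icc 0 T) (v - u) := hv.smooth_velocity.sub hu.smooth_velocity
  have hwsob : ∀ n : ℕ, ∃ C : ℝ≥0, ∀ s ∈ Icc 0 T, ∫⁻ x, ‖iteratedFDeriv ℝ n ((v - u) s) x‖ₑ ^ 2 ≤ C :=
    r3rob_sobolev_sub (fun s _ x => rfl) (fun s hs => hv.contDiff_velocity hs)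
      (fun s hs => hu.contDiff_velocity hs) hV hU
  have hWsob : ∀ n : ℕ, ∃ C : ℝ≥0, ∀ s ∈ Icc 0 T,
      ∫⁻ x, ‖iteratedFDeriv ℝ n (timeDerivWithin (Icc 0 T) (v - u) s) x‖ₑ ^ 2 ≤ C :=
    r3rob_sobolev_sub (fun s hs x => hv.smooth_velocity.timeDerivWithin_sub hu.smooth_velocity hs x)
      (fun s hs => (hv.smooth_velocity.timeDerivWithin hU').contDiff_slice hs)
      (fun s hs => (hu.smooth_velocity.timeDerivWithin hU').contDiff_slice hs) hVt hUt
  -- enorm comparison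
  have enorm_le : ∀ {a b : ℝ}, 0 ≤ a → a ≤ b → ENNReal.ofReal a ^ 2 ≤ ENNReal.ofReal b ^ 2 :=
    fun ha hab => pow_le_pow_left' (ENNReal.ofReal_le_ofReal hab) 2
  -- per direction: the balance of the family `∂ᵢ(v − u)`
  have hdir : ∀ i,
      IntegrableOn (fun t =>
        (-(2 * ν * ∫ x, ‖(Δ (fun y => fderiv ℝ ((v - u) t) y (e i))) x‖ ^ 2) +
          2 * (∫ x, ⟪fderiv ℝ (fun y => convect (v t) ((v - u) t) y + convect ((v - u) t) (u t) y) x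
              (e i), (Δ (fun y => fderiv ℝ ((v - u) t) y (e i))) x⟫) +
          2 * (∫ x, ⟪fderiv ℝ (fun y => f t y - g t y) x (e i),
            (Δ (fun y => fderiv ℝ ((v - u) t) y (e i))) x⟫))) (Icc 0 T) ∧
      ContinuousOn (fun t => ∫ x, frobeniusNormSq
        (fderiv ℝ (fun y => fderiv ℝ ((v - u) t) y (e i)) x)) (Icc 0 T) ∧
      ∀ b ∈ Icc 0 T, (∫ x, frobeniusNormSq (fderiv ℝ (fun y => fderiv ℝ ((v - u) b) y (e i)) x)) =
        (∫ x, frobeniusNormSq (fderiv ℝ (fun y => fderiv ℝ ((v - u) 0) y (e i)) x)) +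
          ∫ t in (0 : ℝ)..b,
            (-(2 * ν * ∫ x, ‖(Δ (fun y => fderiv ℝ ((v - u) t) y (e i))) x‖ ^ 2) +
              2 * (∫ x, ⟪fderiv ℝ (fun y => convect (v t) ((v - u) t) y +
                  convect ((v - u) t) (u t) y) x (e i),
                (Δ (fun y => fderiv ℝ ((v - u) t) y (e i))) x⟫) +
              2 * (∫ x, ⟪fderiv ℝ (fun y => f t y - g t y) x (e i),
                (Δ (fun y => fderiv ℝ ((v - u) t) y (e i))) x⟫)) := by
    intro i
    have hUism : IsSmoothSpaceTimeOn (Icc 0 T) (fun s y => fderiv ℝ ((v - u) s) y (e i)) :=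
      hwsm.fderiv_slice_apply hU' (e i)
    obtain ⟨C₁, hC₁⟩ := hwsob 2
    obtain ⟨C₂, hC₂⟩ := hWsob 2
    have hC₁' : ∀ t ∈ Icc 0 T,
        ∫⁻ x, ‖iteratedFDeriv ℝ 1 ((fun s y => fderiv ℝ ((v - u) s) y (e i)) t) x‖ₑ ^ 2 ≤ C₁ := by
      intro t ht
      refine le_trans (lintegral_mono fun x => ?_) (hC₁ t ht)
      rw [← ofReal_norm, ← ofReal_norm]
      exact enorm_le (norm_nonneg _)
        (norm_iteratedFDeriv_fderiv_apply_basisFun_le (hwsm.contDiff_slice ht) 1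
          (by exact_mod_cast le_top) x i)
    have hfam : ∀ t ∈ Icc 0 T,
        timeDerivWithin (Icc 0 T) (fun s y => fderiv ℝ ((v - u) s) y (e i)) t =
          fun x => fderiv ℝ (timeDerivWithin (Icc 0 T) (v - u) t) x (e i) := fun t ht => by
      funext x
      exact hwsm.timeDerivWithin_fderiv_slice_apply hU' hcl ht x (e i)
    have hC₂' : ∀ t ∈ Icc 0 T,
        ∫⁻ x, ‖iteratedFDeriv ℝ 1 (timeDerivWithin (Icc 0 T)
          (fun s y => fderiv ℝ ((v - u) s) y (e i)) t) x‖ₑ ^ 2 ≤ C₂ := by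
      intro t ht
      rw [hfam t ht]
      refine le_trans (lintegral_mono fun x => ?_) (hC₂ t ht)
      rw [← ofReal_norm, ← ofReal_norm]
      exact enorm_le (norm_nonneg _)
        (norm_iteratedFDeriv_fderiv_apply_basisFun_le
          ((hwsm.timeDerivWithin hU').contDiff_slice ht) 1 (by exact_mod_cast le_top) x i)
    obtain ⟨hint, hcont, hbal⟩ := hUism.enstrophy_balance hT hC₁' hC₂'
    have hid : ∀ t ∈ Icc 0 T,
        (∫ x, 2 * ∑ j, ⟪fderiv ℝ ((fun s y => fderiv ℝ ((v - u) s) y (e i)) t) x (e j),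
          fderiv ℝ (timeDerivWithin (Icc 0 T) (fun s y => fderiv ℝ ((v - u) s) y (e i)) t) x
            (e j)⟫) =
        -(2 * ν * ∫ x, ‖(Δ (fun y => fderiv ℝ ((v - u) t) y (e i))) x‖ ^ 2) +
          2 * (∫ x, ⟪fderiv ℝ (fun y => convect (v t) ((v - u) t) y + convect ((v - u) t) (u t) y) x
              (e i), (Δ (fun y => fderiv ℝ ((v - u) t) y (e i))) x⟫) +
          2 * (∫ x, ⟪fderiv ℝ (fun y => f t y - g t y) x (e i),
            (Δ (fun y => fderiv ℝ ((v - u) t) y (e i))) x⟫) := fun t ht =>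
      hv.flux_identity_H2_sub_forces hT hu hU hUt hp hV hVt hq hfD hgD ht i
    refine ⟨?_, hcont, fun b hb => ?_⟩
    · rw [integrableOn_Icc_iff_integrableOn_Ioo]
      exact hint.congr_fun (fun t ht => hid t (Ioo_subset_Icc_self ht)) measurableSet_Ioo
    · rcases eq_or_lt_of_le hb.1 with h0b | h0b
      · rw [← h0b, intervalIntegral.integral_same, add_zero]
      · rw [hbal b ⟨h0b, hb.2⟩]
        congr 1
        refine intervalIntegral.integral_congr fun t ht => ?_
        rw [uIcc_of_le h0b.le] at ht
        exact hid t ⟨ht.1, ht.2.trans hb.2⟩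
  refine ⟨?_, continuousOn_finsetSum _ fun i _ => (hdir i).2.1, fun b hb => ?_⟩
  · exact integrable_finsetSum _ fun i _ => (hdir i).1
  · have hii : ∀ i, IntervalIntegrable (fun t =>
        (-(2 * ν * ∫ x, ‖(Δ (fun y => fderiv ℝ ((v - u) t) y (e i))) x‖ ^ 2) +
          2 * (∫ x, ⟪fderiv ℝ (fun y => convect (v t) ((v - u) t) y + convect ((v - u) t) (u t) y) x
              (e i), (Δ (fun y => fderiv ℝ ((v - u) t) y (e i))) x⟫) +
          2 * (∫ x, ⟪fderiv ℝ (fun y => f t y - g t y) x (e i),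
            (Δ (fun y => fderiv ℝ ((v - u) t) y (e i))) x⟫))) volume 0 b := fun i =>
      ((hdir i).1.mono_set (by rw [uIcc_of_le hb.1]; exact Icc_subset_Icc_right hb.2)).intervalIntegrable
    rw [intervalIntegral.integral_finsetSum fun i _ => hii i, ← Finset.sum_add_distrib]
    exact Finset.sum_congr rfl fun i _ => (hdir i).2.2 b hb

end BalanceH2


/-! ## §E Robustness of regularity at the `H²` level on `ℝ³`, strain form, a priori -/

section RobustnessH2

variable {ν T : ℝ} {f g u v : ℝ → EuclideanSpace ℝ (Fin 3) → EuclideanSpace ℝ (Fin 3)}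
variable {p q : ℝ → EuclideanSpace ℝ (Fin 3) → ℝ}

/-- **Robustness of regularity on `ℝ³` at the `H²` level in STRAIN form, a priori (Dashti–Robinson
2008, Thm 2, the a-priori estimate of its proof, with the reference's `H³` rate replaced by the
strain currency `(G, σ₂, σ₃)`).** Let `(u, p)` (force `f`) and `(v, q)` (force `g`) be classical
solutions on `[0, T] × ℝ³` in the `L²`-Sobolev class, the forces with square-integrable first
derivatives, `wᵢ = ∂ᵢ(v − u)`, `Z(t) = Σᵢ∫|∇wᵢ(t)|²_F` (`= ∫|D²(v − u)(t)|²_F`). Let continuous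
majorants on `[0, T]` be given: `−⟪Du(s,x)ξ, ξ⟫ ≤ G(s)‖ξ‖²`, `‖D²u(s,x)‖ ≤ σ₂(s)`,
`‖D³u(s,x)‖ ≤ σ₃(s)`, `‖(v − u)(s)‖_{L²} ≤ L(s)`, `∫|∇(v − u)(s)|²_F ≤ X₁(s)` (the `L²` and `H¹`
levels, e.g. from `classicalNS_robustness_strain_R3`), `∫‖D(f − g)(s)‖² ≤ H₁(s)`; free lengths
`κ, μ > 0`; rate `l = 6G + 9κσ₂ + 3κ²σ₃ + 3A²X₁/(νμ) + 27A⁴X₁²/(16ν³)` (`A = agmonConst`),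
`β = A²μ/ν`, source `ψ = 27σ₂X₁/κ + 9σ₃L²/κ² + 6H₁/ν`, envelopes `Λ' = l`, `Λ(0) = 0`,
`Φ' = φ ≥ e^{−Λ}ψ`, `Φ(0) = 0`, `η = Z(0) + Φ(T)`. If `βe^{Λ(T)}ηT < 1` then
`Z(t) ≤ e^{Λ(t)}η/(1 − βe^{Λ(T)}ηt)` on `[0, T]` (the Riccati comparison, Dashti–Robinson's
Lemma 1 with `n = 1`, after `2A²√(X₁·∫‖Δw‖²)Z/ν ≤ 2A²√(3X₁Z)Z/ν ≤ (A²μ/ν)Z² + (3A²X₁/(νμ))Z`).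
[cite: DashtiRobinson2008, Thm 2 (proof) and Lemma 1] -/
theorem classicalNS_robustness_H2_strain_R3 (hν : 0 < ν) (hT : 0 < T)
    (hv : IsClassicalNSSolutionOn (Icc 0 T) ν g v q) (hu : IsClassicalNSSolutionOn (Icc 0 T) ν f u p)
    (hU : HasBoundedSobolevNormsOn (Icc 0 T) u)
    (hUt : HasBoundedSobolevNormsOn (Icc 0 T) (timeDerivWithin (Icc 0 T) u))
    (hp : ∀ n : ℕ, ∃ C : ℝ≥0, ∀ t ∈ Icc 0 T, ∫⁻ x, ‖iteratedFDeriv ℝ n (p t) x‖ₑ ^ 2 ≤ C)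
    (hV : HasBoundedSobolevNormsOn (Icc 0 T) v)
    (hVt : HasBoundedSobolevNormsOn (Icc 0 T) (timeDerivWithin (Icc 0 T) v))
    (hq : ∀ n : ℕ, ∃ C : ℝ≥0, ∀ t ∈ Icc 0 T, ∫⁻ x, ‖iteratedFDeriv ℝ n (q t) x‖ₑ ^ 2 ≤ C)
    (hfD : ∀ t ∈ Icc 0 T, ∫⁻ x, ‖fderiv ℝ (f t) x‖ₑ ^ 2 < ⊤)
    (hgD : ∀ t ∈ Icc 0 T, ∫⁻ x, ‖fderiv ℝ (g t) x‖ₑ ^ 2 < ⊤)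
    {G σ₂ σ₃ L X₁ H₁ Λ Φ φ : ℝ → ℝ} {κ μ : ℝ} (hκ : 0 < κ) (hμ : 0 < μ)
    (hG : ∀ s ∈ Icc 0 T, ∀ (x ξ : EuclideanSpace ℝ (Fin 3)), -⟪fderiv ℝ (u s) x ξ, ξ⟫ ≤ G s * ‖ξ‖ ^ 2)
    (hσ₂ : ∀ s ∈ Icc 0 T, ∀ x, ‖iteratedFDeriv ℝ 2 (u s) x‖ ≤ σ₂ s)
    (hσ₃ : ∀ s ∈ Icc 0 T, ∀ x, ‖iteratedFDeriv ℝ 3 (u s) x‖ ≤ σ₃ s)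
    (hL : ∀ s ∈ Icc 0 T, Real.sqrt (∫ x, ‖(v - u) s x‖ ^ 2) ≤ L s)
    (hX₁ : ∀ s ∈ Icc 0 T, ∫ x, frobeniusNormSq (fderiv ℝ ((v - u) s) x) ≤ X₁ s)
    (hH₁ : ∀ s ∈ Icc 0 T, ∫ x, ‖fderiv ℝ (fun y => f s y - g s y) x‖ ^ 2 ≤ H₁ s)
    (hGc : ContinuousOn G (Icc 0 T)) (hσ₂c : ContinuousOn σ₂ (Icc 0 T))
    (hσ₃c : ContinuousOn σ₃ (Icc 0 T)) (hLc : ContinuousOn L (Icc 0 T))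
    (hX₁c : ContinuousOn X₁ (Icc 0 T)) (hH₁c : ContinuousOn H₁ (Icc 0 T))
    (hΛ : ∀ s ∈ Icc 0 T, HasDerivWithinAt Λ (6 * G s + 9 * κ * σ₂ s + 3 * κ ^ 2 * σ₃ s +
      3 * agmonConst ^ 2 * X₁ s / (ν * μ) + 27 * agmonConst ^ 4 * X₁ s ^ 2 / (16 * ν ^ 3)) (Icc 0 T) s)
    (hΛ0 : Λ 0 = 0)
    (hΦ : ∀ s ∈ Icc 0 T, HasDerivWithinAt Φ (φ s) (Icc 0 T) s) (hΦ0 : Φ 0 = 0)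
    (hφ : ∀ s ∈ Icc 0 T, Real.exp (-Λ s) *
      (27 * σ₂ s / κ * X₁ s + 9 * σ₃ s / κ ^ 2 * L s ^ 2 + 6 / ν * H₁ s) ≤ φ s)
    (hsmall : agmonConst ^ 2 * μ / ν * Real.exp (Λ T) *
      ((∑ i, ∫ x, frobeniusNormSq (fderiv ℝ (fun y => fderiv ℝ ((v - u) 0) y
        (EuclideanSpace.basisFun (Fin 3) ℝ i)) x)) + Φ T) * T < 1)
    {t : ℝ} (ht : t ∈ Icc 0 T) :
    (∑ i, ∫ x, frobeniusNormSq (fderiv ℝ (fun y => fderiv ℝ ((v - u) t) y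
        (EuclideanSpace.basisFun (Fin 3) ℝ i)) x)) ≤
      Real.exp (Λ t) * ((∑ i, ∫ x, frobeniusNormSq (fderiv ℝ (fun y => fderiv ℝ ((v - u) 0) y
          (EuclideanSpace.basisFun (Fin 3) ℝ i)) x)) + Φ T) /
        (1 - agmonConst ^ 2 * μ / ν * Real.exp (Λ T) *
          ((∑ i, ∫ x, frobeniusNormSq (fderiv ℝ (fun y => fderiv ℝ ((v - u) 0) y
            (EuclideanSpace.basisFun (Fin 3) ℝ i)) x)) + Φ T) * t) := by
  have hU' : UniqueDiffOn ℝ (Icc 0 T) := uniqueDiffOn_Icc hT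
  set e := EuclideanSpace.basisFun (Fin 3) ℝ with he
  have hA : 0 ≤ agmonConst := agmonConst_nonneg
  -- the balance and the two functions `Z`, `F`
  obtain ⟨hFi, hZc, hbal⟩ := hv.hessian_sub_balance_forces hT hu hU hUt hp hV hVt hq hfD hgD
  obtain ⟨Z, hZ⟩ : ∃ Z : ℝ → ℝ, Z = fun t => ∑ i, ∫ x, frobeniusNormSq
      (fderiv ℝ (fun y => fderiv ℝ ((v - u) t) y (e i)) x) := ⟨_, rfl⟩
  obtain ⟨F, hF⟩ : ∃ F : ℝ → ℝ, F = fun t => ∑ i,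
      (-(2 * ν * ∫ x, ‖(Δ (fun y => fderiv ℝ ((v - u) t) y (e i))) x‖ ^ 2) +
        2 * (∫ x, ⟪fderiv ℝ (fun y => convect (v t) ((v - u) t) y + convect ((v - u) t) (u t) y) x
            (e i), (Δ (fun y => fderiv ℝ ((v - u) t) y (e i))) x⟫) +
        2 * (∫ x, ⟪fderiv ℝ (fun y => f t y - g t y) x (e i),
          (Δ (fun y => fderiv ℝ ((v - u) t) y (e i))) x⟫)) := ⟨_, rfl⟩
  have hZc' : ContinuousOn Z (Icc 0 T) := by rw [hZ]; exact hZc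
  have hFi' : IntegrableOn F (Icc 0 T) := by rw [hF]; exact hFi
  have hbal' : ∀ b ∈ Ioc 0 T, Z b = Z 0 + ∫ s in (0 : ℝ)..b, F s := fun b hb => by
    rw [hZ, hF]; exact hbal b ⟨hb.1.le, hb.2⟩
  have hZ0 : ∀ s ∈ Icc 0 T, 0 ≤ Z s := fun s _ => by
    rw [hZ]
    exact Finset.sum_nonneg fun i _ => integral_nonneg fun x => frobeniusNormSq_nonneg _
  -- (qualitative) sup bounds of the reference field, the difference and their derivatives
  obtain ⟨Bu, hBu⟩ := linfty_bound_of_hasBoundedSobolevNormsOn_holds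
    (fun s hs => (hu.contDiff_velocity hs).of_le (by norm_cast)) hU
  obtain ⟨B₁, -, hB₁⟩ := exists_forall_norm_fderiv_le_of_hasBoundedSobolevNormsOn
    (fun s hs => (hu.contDiff_velocity hs).of_le (by norm_cast)) hU
  have hwsm : IsSmoothSpaceTimeOn (Icc 0 T) (v - u) := hv.smooth_velocity.sub hu.smooth_velocity
  have hwsob : HasBoundedSobolevNormsOn (Icc 0 T) (v - u) :=
    r3rob_sobolev_sub (fun s _ x => rfl) (fun s hs => hv.contDiff_velocity hs)
      (fun s hs => hu.contDiff_velocity hs) hV hU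
  obtain ⟨Bw₁, -, hBw₁⟩ := exists_forall_norm_fderiv_le_of_hasBoundedSobolevNormsOn
    (fun s hs => (hwsm.contDiff_slice hs).of_le (by norm_cast)) hwsob
  obtain ⟨Bw₂, -, hBw₂'⟩ := exists_forall_norm_fderiv_fderiv_le_of_hasBoundedSobolevNormsOn
    (fun s hs => (hwsm.contDiff_slice hs).of_le (by norm_cast)) hwsob
  have hBw₂ : ∀ s ∈ Icc 0 T, ∀ x, ‖iteratedFDeriv ℝ 2 ((v - u) s) x‖ ≤ Bw₂ := fun s hs x => by
    rw [← norm_iteratedFDeriv_fderiv, ← norm_iteratedFDeriv_fderiv, norm_iteratedFDeriv_zero]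
    exact hBw₂' s hs x
  have hfsm : IsSmoothSpaceTimeOn (Icc 0 T) f := hu.isSmoothSpaceTimeOn_force hU'
  have hgsm : IsSmoothSpaceTimeOn (Icc 0 T) g := hv.isSmoothSpaceTimeOn_force hU'
  -- signs and continuity of the rates
  have hG0 : ∀ s ∈ Icc 0 T, 0 ≤ G s := fun s hs =>
    r3rob_compressionRate_nonneg (hu.divFree s hs) (hG s hs)
  have hσ₂0 : ∀ s ∈ Icc 0 T, 0 ≤ σ₂ s := fun s hs => (norm_nonneg _).trans (hσ₂ s hs 0)
  have hσ₃0 : ∀ s ∈ Icc 0 T, 0 ≤ σ₃ s := fun s hs => (norm_nonneg _).trans (hσ₃ s hs 0)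
  have hX₁0 : ∀ s ∈ Icc 0 T, 0 ≤ X₁ s := fun s hs =>
    (integral_nonneg fun x => frobeniusNormSq_nonneg _).trans (hX₁ s hs)
  have hH₁0 : ∀ s ∈ Icc 0 T, 0 ≤ H₁ s := fun s hs =>
    (integral_nonneg fun x => sq_nonneg _).trans (hH₁ s hs)
  have hl0 : ∀ s ∈ Icc 0 T, 0 ≤ 6 * G s + 9 * κ * σ₂ s + 3 * κ ^ 2 * σ₃ s +
      3 * agmonConst ^ 2 * X₁ s / (ν * μ) + 27 * agmonConst ^ 4 * X₁ s ^ 2 / (16 * ν ^ 3) :=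
    fun s hs => by
      have := hG0 s hs; have := hσ₂0 s hs; have := hσ₃0 s hs; have := hX₁0 s hs
      positivity
  have hψ0 : ∀ s ∈ Icc 0 T, 0 ≤ 27 * σ₂ s / κ * X₁ s + 9 * σ₃ s / κ ^ 2 * L s ^ 2 + 6 / ν * H₁ s :=
    fun s hs => by
      have := hσ₂0 s hs; have := hσ₃0 s hs; have := hX₁0 s hs; have := hH₁0 s hs
      positivity
  have hlc : ContinuousOn (fun s => 6 * G s + 9 * κ * σ₂ s + 3 * κ ^ 2 * σ₃ s +
      3 * agmonConst ^ 2 * X₁ s / (ν * μ) + 27 * agmonConst ^ 4 * X₁ s ^ 2 / (16 * ν ^ 3))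
      (Icc 0 T) :=
    ((((continuousOn_const.mul hGc).add (continuousOn_const.mul hσ₂c)).add
      (continuousOn_const.mul hσ₃c)).add
      ((continuousOn_const.mul hX₁c).div_const _)).add
      ((continuousOn_const.mul (hX₁c.pow 2)).div_const _)
  have hψc : ContinuousOn
      (fun s => 27 * σ₂ s / κ * X₁ s + 9 * σ₃ s / κ ^ 2 * L s ^ 2 + 6 / ν * H₁ s) (Icc 0 T) :=
    ((((continuousOn_const.mul hσ₂c).div_const _).mul hX₁c).add
      (((continuousOn_const.mul hσ₃c).div_const _).mul (hLc.pow 2))).add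
      (continuousOn_const.mul hH₁c)
  -- the slice bound along the two solutions, weakened to the majorants
  have hFle : ∀ s ∈ Icc 0 T, F s ≤
      (6 * G s + 9 * κ * σ₂ s + 3 * κ ^ 2 * σ₃ s + 3 * agmonConst ^ 2 * X₁ s / (ν * μ) +
          27 * agmonConst ^ 4 * X₁ s ^ 2 / (16 * ν ^ 3)) * Z s +
        agmonConst ^ 2 * μ / ν * Z s ^ (1 + 1) +
        (27 * σ₂ s / κ * X₁ s + 9 * σ₃ s / κ ^ 2 * L s ^ 2 + 6 / ν * H₁ s) := by
    intro s hs
    have hw : ContDiff ℝ ∞ ((v - u) s) := hwsm.contDiff_slice hs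
    have hft : ContDiff ℝ ∞ (f s) := hfsm.contDiff_slice hs
    have hgt : ContDiff ℝ ∞ (g s) := hgsm.contDiff_slice hs
    have hh : ContDiff ℝ 1 (fun y => f s y - g s y) := (hft.sub hgt).of_le (by norm_cast)
    have hh1 : ∫⁻ x, ‖fderiv ℝ (fun y => f s y - g s y) x‖ₑ ^ 2 < ⊤ := by
      have eD : ∀ x, fderiv ℝ (fun y => f s y - g s y) x = fderiv ℝ (f s) x - fderiv ℝ (g s) x :=
        fun x => fderiv_fun_sub ((hft.differentiable (by simp)) x) ((hgt.differentiable (by simp)) x)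
      refine lt_of_le_of_lt (le_of_eq (lintegral_congr fun x => by rw [eD x])) ?_
      exact r3rob_lintegral_sq_sub_lt_top
        (((hft.of_le (by norm_cast) : ContDiff ℝ 1 (f s)).continuous_fderiv
          one_ne_zero).aestronglyMeasurable) (hfD s hs) (hgD s hs)
    have key := robustness_flux_H2_le_strain_R3 hν (hu.contDiff_velocity hs) hw hh (hu.divFree s hs)
      (r3rob_fin hs 0 (hwsob 0)) (r3rob_fin hs 1 (hwsob 1)) (r3rob_fin hs 2 (hwsob 2))
      (r3rob_fin hs 3 (hwsob 3)) (r3rob_fin hs 4 (hwsob 4)) hh1 (hBu s hs) (hB₁ s hs)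
      (r3rob_fin hs 1 (hU 1)) (r3rob_fin hs 2 (hU 2)) (hBw₁ s hs) (hBw₂ s hs) (hG s hs)
      (hσ₂ s hs) (hσ₃ s hs) (hL s hs) hκ
    have ev : (fun z => u s z + (v - u) s z) = v s := by
      funext z
      simp only [Pi.sub_apply]
      abel
    rw [ev] at key
    -- `∫‖Δw‖² ≤ 3Z`
    have hFr : ∀ i, Integrable (fun x => frobeniusNormSq
        (fderiv ℝ (fun y => fderiv ℝ ((v - u) s) y (e i)) x)) volume := fun i =>
      r3rob_integrable_frobeniusNormSq
        (((hw.fderiv_right (m := ∞) (by simp)).clm_apply contDiff_const).of_le (by norm_cast))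
        (lintegral_enorm_sq_lt_top_of_norm_le
          (fun x => norm_iteratedFDeriv_fderiv_apply_basisFun_le hw 1 (by exact_mod_cast le_top) x i)
          (r3rob_fin hs 2 (hwsob 2)))
    have hY := r3rob_integral_laplacian_sq_le_three_mul_sum hw hFr
    have hZs : Z s = ∑ i, ∫ x, frobeniusNormSq (fderiv ℝ (fun y => fderiv ℝ ((v - u) s) y (e i)) x) :=
      by rw [hZ]
    have hFs : F s = ∑ i,
        (-(2 * ν * ∫ x, ‖(Δ (fun y => fderiv ℝ ((v - u) s) y (e i))) x‖ ^ 2) +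
          2 * (∫ x, ⟪fderiv ℝ (fun y => convect (v s) ((v - u) s) y + convect ((v - u) s) (u s) y) x
              (e i), (Δ (fun y => fderiv ℝ ((v - u) s) y (e i))) x⟫) +
          2 * (∫ x, ⟪fderiv ℝ (fun y => f s y - g s y) x (e i),
            (Δ (fun y => fderiv ℝ ((v - u) s) y (e i))) x⟫)) := by rw [hF]
    rw [← hZs] at key hY
    rw [← hFs] at key
    have hXa0 : 0 ≤ ∫ x, frobeniusNormSq (fderiv ℝ ((v - u) s) x) :=
      integral_nonneg fun x => frobeniusNormSq_nonneg _
    have hY0 : 0 ≤ ∫ x, ‖(Δ ((v - u) s)) x‖ ^ 2 := integral_nonneg fun x => sq_nonneg _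
    have hHa0 : 0 ≤ ∫ x, ‖fderiv ℝ (fun y => f s y - g s y) x‖ ^ 2 :=
      integral_nonneg fun x => sq_nonneg _
    have hXa := hX₁ s hs
    have hHa := hH₁ s hs
    have hZ0s := hZ0 s hs
    have hG0s := hG0 s hs
    have hσ₂0s := hσ₂0 s hs
    have hσ₃0s := hσ₃0 s hs
    have hX0s := hX₁0 s hs
    generalize (∫ x, frobeniusNormSq (fderiv ℝ ((v - u) s) x)) = Xa at key hXa hXa0
    generalize (∫ x, ‖(Δ ((v - u) s)) x‖ ^ 2) = Y at key hY hY0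
    generalize (∫ x, ‖fderiv ℝ (fun y => f s y - g s y) x‖ ^ 2) = H at key hHa hHa0
    generalize Z s = Zs at key hY hZ0s ⊢
    generalize F s = Fs at key ⊢
    generalize G s = G' at key hG0s ⊢
    generalize σ₂ s = σ₂' at key hσ₂0s ⊢
    generalize σ₃ s = σ₃' at key hσ₃0s ⊢
    generalize X₁ s = Xb at hXa hX0s ⊢
    generalize H₁ s = Hb at hHa ⊢
    generalize L s = L' at key ⊢
    -- the weakening steps
    have hA2ν : 0 ≤ agmonConst ^ 2 / ν := by positivity
    have s1 : Real.sqrt (Xa * Y) ≤ Real.sqrt (3 * Xb * Zs) := by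
      refine Real.sqrt_le_sqrt ?_
      have := mul_le_mul hXa hY hY0 hX0s
      linarith
    have s2 : 2 * Real.sqrt (3 * Xb * Zs) ≤ μ * Zs + 3 * Xb / μ := by
      have h := r3rob_two_mul_le_kappa (L := Real.sqrt (3 * Xb)) (s := Real.sqrt Zs) hμ
      rw [Real.sq_sqrt hZ0s, Real.sq_sqrt (by positivity), mul_assoc,
        ← Real.sqrt_mul (by positivity)] at h
      linarith
    have s3 : 2 * agmonConst ^ 2 * Real.sqrt (Xa * Y) / ν * Zs ≤
        agmonConst ^ 2 * μ / ν * Zs ^ 2 + 3 * agmonConst ^ 2 * Xb / (ν * μ) * Zs := by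
      have h1 : 2 * agmonConst ^ 2 * Real.sqrt (Xa * Y) / ν * Zs ≤
          2 * agmonConst ^ 2 * Real.sqrt (3 * Xb * Zs) / ν * Zs := by
        have := mul_le_mul_of_nonneg_left s1 hA2ν
        have := mul_le_mul_of_nonneg_right this hZ0s
        have e1 : 2 * agmonConst ^ 2 * Real.sqrt (Xa * Y) / ν * Zs =
            2 * (agmonConst ^ 2 / ν * Real.sqrt (Xa * Y) * Zs) := by ring
        have e2 : 2 * agmonConst ^ 2 * Real.sqrt (3 * Xb * Zs) / ν * Zs =
            2 * (agmonConst ^ 2 / ν * Real.sqrt (3 * Xb * Zs) * Zs) := by ring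
        rw [e1, e2]
        linarith
      have h2 : 2 * agmonConst ^ 2 * Real.sqrt (3 * Xb * Zs) / ν * Zs ≤
          agmonConst ^ 2 * μ / ν * Zs ^ 2 + 3 * agmonConst ^ 2 * Xb / (ν * μ) * Zs := by
        have := mul_le_mul_of_nonneg_left s2 (mul_nonneg hA2ν hZ0s)
        have e1 : 2 * agmonConst ^ 2 * Real.sqrt (3 * Xb * Zs) / ν * Zs =
            agmonConst ^ 2 / ν * Zs * (2 * Real.sqrt (3 * Xb * Zs)) := by ring
        have e2 : agmonConst ^ 2 * μ / ν * Zs ^ 2 + 3 * agmonConst ^ 2 * Xb / (ν * μ) * Zs =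
            agmonConst ^ 2 / ν * Zs * (μ * Zs + 3 * Xb / μ) := by
          ring
        rw [e1, e2]
        exact this
      exact h1.trans h2
    have s4 : 27 * agmonConst ^ 4 * Xa ^ 2 / (16 * ν ^ 3) * Zs ≤
        27 * agmonConst ^ 4 * Xb ^ 2 / (16 * ν ^ 3) * Zs := by
      have := pow_le_pow_left₀ hXa0 hXa 2
      have h16 : 0 ≤ 27 * agmonConst ^ 4 / (16 * ν ^ 3) * Zs := by positivity
      have := mul_le_mul_of_nonneg_left this h16
      have e1 : 27 * agmonConst ^ 4 * Xa ^ 2 / (16 * ν ^ 3) * Zs =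
          27 * agmonConst ^ 4 / (16 * ν ^ 3) * Zs * Xa ^ 2 := by ring
      have e2 : 27 * agmonConst ^ 4 * Xb ^ 2 / (16 * ν ^ 3) * Zs =
          27 * agmonConst ^ 4 / (16 * ν ^ 3) * Zs * Xb ^ 2 := by ring
      rw [e1, e2]
      exact this
    have s5 : 27 * σ₂' / κ * Xa ≤ 27 * σ₂' / κ * Xb :=
      mul_le_mul_of_nonneg_left hXa (by positivity)
    have s6 : 6 / ν * H ≤ 6 / ν * Hb := mul_le_mul_of_nonneg_left hHa (by positivity)
    have hidL : (6 * G' + 9 * κ * σ₂' + 3 * κ ^ 2 * σ₃' + 2 * agmonConst ^ 2 * Real.sqrt (Xa * Y) / ν +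
          27 * agmonConst ^ 4 * Xa ^ 2 / (16 * ν ^ 3)) * Zs =
        (6 * G' + 9 * κ * σ₂' + 3 * κ ^ 2 * σ₃') * Zs +
          2 * agmonConst ^ 2 * Real.sqrt (Xa * Y) / ν * Zs +
          27 * agmonConst ^ 4 * Xa ^ 2 / (16 * ν ^ 3) * Zs := by ring
    have hidR : (6 * G' + 9 * κ * σ₂' + 3 * κ ^ 2 * σ₃' + 3 * agmonConst ^ 2 * Xb / (ν * μ) +
          27 * agmonConst ^ 4 * Xb ^ 2 / (16 * ν ^ 3)) * Zs =
        (6 * G' + 9 * κ * σ₂' + 3 * κ ^ 2 * σ₃') * Zs +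
          3 * agmonConst ^ 2 * Xb / (ν * μ) * Zs +
          27 * agmonConst ^ 4 * Xb ^ 2 / (16 * ν ^ 3) * Zs := by ring
    have hsq : Zs ^ (1 + 1) = Zs ^ 2 := by norm_num
    rw [hidL] at key
    rw [hidR, hsq]
    linarith [key, s3, s4, s5, s6]
  -- the comparison (Dashti–Robinson's Lemma 1, `n = 1`)
  have hsmall' : ((1 : ℕ) : ℝ) * (agmonConst ^ 2 * μ / ν * Real.exp (((1 : ℕ) : ℝ) * Λ T)) *
      (Z 0 + Φ T) ^ (1 : ℕ) * T < 1 := by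
    rw [hZ]
    simpa using hsmall
  have H := Literature.Analysis.ODE.pow_le_of_integral_balance_le_linear_add_pow_succ_add
    (n := 1) one_pos hT (by positivity : (0 : ℝ) ≤ agmonConst ^ 2 * μ / ν) hZc' hFi' hbal' hFle hZ0
    hlc hψc hl0 hψ0 hΛ hΛ0 hΦ hΦ0 hφ hsmall' ht
  simp only [pow_one, Nat.cast_one, one_mul] at H
  rw [hZ] at H
  exact H

end RobustnessH2


/-! ## §F The sup-norm readout of the `H¹` and `H²` distances (Agmon) -/

section SupReadout

variable {ν T : ℝ} {f g u v : ℝ → EuclideanSpace ℝ (Fin 3) → EuclideanSpace ℝ (Fin 3)}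
variable {p q : ℝ → EuclideanSpace ℝ (Fin 3) → ℝ}

/-- **Sup-norm readout** (RRS 2016, Thm 1.20 = Agmon, in the quantities of the two robustness
theorems): for a `C^∞` field `w` on `ℝ³` with `w, Dw, D²w, D³w ∈ L²` and majorants
`∫|∇w|²_F ≤ X₁`, `Σᵢ∫|∇∂ᵢw|²_F ≤ Z`: `‖w(x)‖ ≤ A(3X₁Z)^{1/4}` (`A = agmonConst`; Agmon
`‖w‖_∞ ≤ A(∫|∇w|²_F·∫‖Δw‖²)^{1/4}` and `∫‖Δw‖² ≤ 3Z`).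
[cite: RobinsonRodrigoSadowskiCUP2016, Thm 1.20] -/
theorem norm_le_agmonConst_mul_rpow_of_le {w : EuclideanSpace ℝ (Fin 3) → EuclideanSpace ℝ (Fin 3)}
    (hw : ContDiff ℝ ∞ w)
    (h0 : ∫⁻ x, ‖iteratedFDeriv ℝ 0 w x‖ₑ ^ 2 < ⊤) (h1 : ∫⁻ x, ‖iteratedFDeriv ℝ 1 w x‖ₑ ^ 2 < ⊤)
    (h2 : ∫⁻ x, ‖iteratedFDeriv ℝ 2 w x‖ₑ ^ 2 < ⊤) (h3 : ∫⁻ x, ‖iteratedFDeriv ℝ 3 w x‖ₑ ^ 2 < ⊤)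
    {X₁ Z : ℝ} (hX₁ : ∫ x, frobeniusNormSq (fderiv ℝ w x) ≤ X₁)
    (hZ : (∑ i, ∫ x, frobeniusNormSq
      (fderiv ℝ (fun y => fderiv ℝ w y (EuclideanSpace.basisFun (Fin 3) ℝ i)) x)) ≤ Z)
    (x : EuclideanSpace ℝ (Fin 3)) :
    ‖w x‖ ≤ agmonConst * (3 * X₁ * Z) ^ (1 / 4 : ℝ) := by
  have hA := norm_le_agmonConst_mul_rpow hw h0 h1 h2 h3 x
  have hFr : ∀ i, Integrable (fun x => frobeniusNormSq
      (fderiv ℝ (fun y => fderiv ℝ w y (EuclideanSpace.basisFun (Fin 3) ℝ i)) x)) volume := fun i =>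
    r3rob_integrable_frobeniusNormSq
      (((hw.fderiv_right (m := ∞) (by simp)).clm_apply contDiff_const).of_le (by norm_cast))
      (lintegral_enorm_sq_lt_top_of_norm_le
        (fun x => norm_iteratedFDeriv_fderiv_apply_basisFun_le hw 1 (by exact_mod_cast le_top) x i) h2)
  have hY := r3rob_integral_laplacian_sq_le_three_mul_sum hw hFr
  have hX0 : 0 ≤ ∫ x, frobeniusNormSq (fderiv ℝ w x) := integral_nonneg fun x => frobeniusNormSq_nonneg _
  have hY0 : 0 ≤ ∫ y, ‖(Δ w) y‖ ^ 2 := integral_nonneg fun x => sq_nonneg _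
  have hprod : (∫ y, frobeniusNormSq (fderiv ℝ w y)) * (∫ y, ‖(Δ w) y‖ ^ 2) ≤ 3 * X₁ * Z := by
    have h1 := mul_le_mul hX₁ hY hY0 (hX0.trans hX₁)
    have h2 : X₁ * (3 * ∑ i, ∫ x, frobeniusNormSq
        (fderiv ℝ (fun y => fderiv ℝ w y (EuclideanSpace.basisFun (Fin 3) ℝ i)) x)) ≤
        X₁ * (3 * Z) := mul_le_mul_of_nonneg_left (by linarith) (hX0.trans hX₁)
    linarith
  exact hA.trans (mul_le_mul_of_nonneg_left
    (Real.rpow_le_rpow (mul_nonneg hX0 hY0) hprod (by norm_num)) agmonConst_nonneg)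

/-- **Sup-norm distance of two classical solutions from the `H¹` and `H²` certificates** (the
readout the strain-currency doors use): in the `L²`-Sobolev class, if at time `t ∈ [0, T]`
`∫|∇(v − u)(t)|²_F ≤ X₁` and `Σᵢ∫|∇∂ᵢ(v − u)(t)|²_F ≤ Z` (e.g. the bounds of
`classicalNS_robustness_strain_R3` and `classicalNS_robustness_H2_strain_R3`), then
`‖v(t,x) − u(t,x)‖ ≤ A(3X₁Z)^{1/4}` for every `x`. [cite: RobinsonRodrigoSadowskiCUP2016, Thm 1.20 and Thm 9.1] -/
theorem classicalNS_norm_sub_le_of_H1_H2_R3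
    (hv : IsClassicalNSSolutionOn (Icc 0 T) ν g v q) (hu : IsClassicalNSSolutionOn (Icc 0 T) ν f u p)
    (hU : HasBoundedSobolevNormsOn (Icc 0 T) u) (hV : HasBoundedSobolevNormsOn (Icc 0 T) v)
    {t : ℝ} (ht : t ∈ Icc 0 T) {X₁ Z : ℝ}
    (hX₁ : ∫ x, frobeniusNormSq (fderiv ℝ ((v - u) t) x) ≤ X₁)
    (hZ : (∑ i, ∫ x, frobeniusNormSq
      (fderiv ℝ (fun y => fderiv ℝ ((v - u) t) y (EuclideanSpace.basisFun (Fin 3) ℝ i)) x)) ≤ Z)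
    (x : EuclideanSpace ℝ (Fin 3)) :
    ‖v t x - u t x‖ ≤ agmonConst * (3 * X₁ * Z) ^ (1 / 4 : ℝ) := by
  have hwsm : IsSmoothSpaceTimeOn (Icc 0 T) (v - u) := hv.smooth_velocity.sub hu.smooth_velocity
  have hwsob : HasBoundedSobolevNormsOn (Icc 0 T) (v - u) :=
    r3rob_sobolev_sub (fun s _ x => rfl) (fun s hs => hv.contDiff_velocity hs)
      (fun s hs => hu.contDiff_velocity hs) hV hU
  have h := norm_le_agmonConst_mul_rpow_of_le (hwsm.contDiff_slice ht) (r3rob_fin ht 0 (hwsob 0))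
    (r3rob_fin ht 1 (hwsob 1)) (r3rob_fin ht 2 (hwsob 2)) (r3rob_fin ht 3 (hwsob 3)) hX₁ hZ x
  simpa only [Pi.sub_apply] using h

end SupReadout


/-! ## §G Window-generic form with integral envelopes (the shape a windowed certificate checks) -/

section WindowH2

variable {ν t₀ t₁ : ℝ} {f g u v : ℝ → EuclideanSpace ℝ (Fin 3) → EuclideanSpace ℝ (Fin 3)}
variable {p q : ℝ → EuclideanSpace ℝ (Fin 3) → ℝ}

/-- Slicewise Sobolev bounds translate in time. [folklore] -/
private theorem r3rob_bounds_comp_add {G' : Type*} [NormedAddCommGroup G'] [NormedSpace ℝ G']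
    {w : ℝ → EuclideanSpace ℝ (Fin 3) → G'} {a b s : ℝ}
    (h : ∀ n : ℕ, ∃ C : ℝ≥0, ∀ t ∈ Icc (a + s) (b + s), ∫⁻ x, ‖iteratedFDeriv ℝ n (w t) x‖ₑ ^ 2 ≤ C) :
    ∀ n : ℕ, ∃ C : ℝ≥0, ∀ t ∈ Icc a b, ∫⁻ x, ‖iteratedFDeriv ℝ n (w (t + s)) x‖ₑ ^ 2 ≤ C :=
  fun n => (h n).imp fun _ hC t ht => hC (t + s) ⟨by linarith [ht.1], by linarith [ht.2]⟩

/-- FTC within `[0, T]`: for `φ` continuous on `[0, T]`, `r ↦ ∫₀ʳ φ` has the one-sided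
derivative `φ(t)` within `[0, T]` at every `t ∈ [0, T]`. [folklore] -/
private theorem r3rob_hasDerivWithinAt_intervalIntegral {φ : ℝ → ℝ} {T t : ℝ}
    (hφ : ContinuousOn φ (Icc 0 T)) (ht : t ∈ Icc 0 T) :
    HasDerivWithinAt (fun r => ∫ x in (0 : ℝ)..r, φ x) (φ t) (Icc 0 T) t := by
  haveI : Fact (t ∈ Icc 0 T) := ⟨ht⟩
  have hint : IntervalIntegrable φ volume 0 t :=
    (hφ.mono (Icc_subset_Icc_right ht.2)).intervalIntegrable_of_Icc ht.1
  exact intervalIntegral.integral_hasDerivWithinAt_right hint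
    (hφ.stronglyMeasurableAtFilter_nhdsWithin measurableSet_Icc t) (hφ t ht)

/-- **Robustness of regularity at the `H²` level in strain form on an arbitrary window
`[t₀, t₁]`, with the accumulated envelopes written as integrals (Dashti–Robinson 2008, Thm 2's
estimate in the currency `(G, σ₂, σ₃)`), a priori, explicit.** In the setting of
`classicalNS_robustness_H2_strain_R3` transported to `[t₀, t₁]` (`t₀ < t₁`), with a continuous
majorant `ψ ≥ 27σ₂X₁/κ + 9σ₃L²/κ² + 6H₁/ν` of the source, rate
`l = 6G + 9κσ₂ + 3κ²σ₃ + 3A²X₁/(νμ) + 27A⁴X₁²/(16ν³)`, `β = A²μ/ν`,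
`η = Z(t₀) + ∫_{t₀}^{t₁} ψ`: if `βe^{∫_{t₀}^{t₁} l}η(t₁ − t₀) < 1` then for `t ∈ [t₀, t₁]`
`Z(t) ≤ e^{∫_{t₀}^{t} l}η/(1 − βe^{∫_{t₀}^{t₁} l}η(t − t₀))`
(`classicalNS_robustness_H2_strain_R3` after the time translation
`IsClassicalNSSolutionOn.comp_add_right`, with `Φ = ∫ψ ≥ ∫e^{−Λ}ψ`).
[cite: DashtiRobinson2008, Thm 2 (proof) and Lemma 1] -/
theorem classicalNS_robustness_H2_strain_window_R3 (hν : 0 < ν) (ht₀₁ : t₀ < t₁)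
    (hv : IsClassicalNSSolutionOn (Icc t₀ t₁) ν g v q)
    (hu : IsClassicalNSSolutionOn (Icc t₀ t₁) ν f u p)
    (hU : HasBoundedSobolevNormsOn (Icc t₀ t₁) u)
    (hUt : HasBoundedSobolevNormsOn (Icc t₀ t₁) (timeDerivWithin (Icc t₀ t₁) u))
    (hp : ∀ n : ℕ, ∃ C : ℝ≥0, ∀ t ∈ Icc t₀ t₁, ∫⁻ x, ‖iteratedFDeriv ℝ n (p t) x‖ₑ ^ 2 ≤ C)
    (hV : HasBoundedSobolevNormsOn (Icc t₀ t₁) v)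
    (hVt : HasBoundedSobolevNormsOn (Icc t₀ t₁) (timeDerivWithin (Icc t₀ t₁) v))
    (hq : ∀ n : ℕ, ∃ C : ℝ≥0, ∀ t ∈ Icc t₀ t₁, ∫⁻ x, ‖iteratedFDeriv ℝ n (q t) x‖ₑ ^ 2 ≤ C)
    (hfD : ∀ t ∈ Icc t₀ t₁, ∫⁻ x, ‖fderiv ℝ (f t) x‖ₑ ^ 2 < ⊤)
    (hgD : ∀ t ∈ Icc t₀ t₁, ∫⁻ x, ‖fderiv ℝ (g t) x‖ₑ ^ 2 < ⊤)
    {G σ₂ σ₃ L X₁ H₁ ψ : ℝ → ℝ} {κ μ : ℝ} (hκ : 0 < κ) (hμ : 0 < μ)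
    (hG : ∀ s ∈ Icc t₀ t₁, ∀ (x ξ : EuclideanSpace ℝ (Fin 3)),
      -⟪fderiv ℝ (u s) x ξ, ξ⟫ ≤ G s * ‖ξ‖ ^ 2)
    (hσ₂ : ∀ s ∈ Icc t₀ t₁, ∀ x, ‖iteratedFDeriv ℝ 2 (u s) x‖ ≤ σ₂ s)
    (hσ₃ : ∀ s ∈ Icc t₀ t₁, ∀ x, ‖iteratedFDeriv ℝ 3 (u s) x‖ ≤ σ₃ s)
    (hL : ∀ s ∈ Icc t₀ t₁, Real.sqrt (∫ x, ‖(v - u) s x‖ ^ 2) ≤ L s)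
    (hX₁ : ∀ s ∈ Icc t₀ t₁, ∫ x, frobeniusNormSq (fderiv ℝ ((v - u) s) x) ≤ X₁ s)
    (hH₁ : ∀ s ∈ Icc t₀ t₁, ∫ x, ‖fderiv ℝ (fun y => f s y - g s y) x‖ ^ 2 ≤ H₁ s)
    (hψ : ∀ s ∈ Icc t₀ t₁,
      27 * σ₂ s / κ * X₁ s + 9 * σ₃ s / κ ^ 2 * L s ^ 2 + 6 / ν * H₁ s ≤ ψ s)
    (hGc : ContinuousOn G (Icc t₀ t₁)) (hσ₂c : ContinuousOn σ₂ (Icc t₀ t₁))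
    (hσ₃c : ContinuousOn σ₃ (Icc t₀ t₁)) (hLc : ContinuousOn L (Icc t₀ t₁))
    (hX₁c : ContinuousOn X₁ (Icc t₀ t₁)) (hH₁c : ContinuousOn H₁ (Icc t₀ t₁))
    (hψc : ContinuousOn ψ (Icc t₀ t₁))
    (hsmall : agmonConst ^ 2 * μ / ν *
        Real.exp (∫ s in t₀..t₁, (6 * G s + 9 * κ * σ₂ s + 3 * κ ^ 2 * σ₃ s +
          3 * agmonConst ^ 2 * X₁ s / (ν * μ) + 27 * agmonConst ^ 4 * X₁ s ^ 2 / (16 * ν ^ 3))) *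
      ((∑ i, ∫ x, frobeniusNormSq (fderiv ℝ (fun y => fderiv ℝ ((v - u) t₀) y
        (EuclideanSpace.basisFun (Fin 3) ℝ i)) x)) + ∫ s in t₀..t₁, ψ s) * (t₁ - t₀) < 1)
    {t : ℝ} (ht : t ∈ Icc t₀ t₁) :
    (∑ i, ∫ x, frobeniusNormSq (fderiv ℝ (fun y => fderiv ℝ ((v - u) t) y
        (EuclideanSpace.basisFun (Fin 3) ℝ i)) x)) ≤
      Real.exp (∫ s in t₀..t, (6 * G s + 9 * κ * σ₂ s + 3 * κ ^ 2 * σ₃ s +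
          3 * agmonConst ^ 2 * X₁ s / (ν * μ) + 27 * agmonConst ^ 4 * X₁ s ^ 2 / (16 * ν ^ 3))) *
          ((∑ i, ∫ x, frobeniusNormSq (fderiv ℝ (fun y => fderiv ℝ ((v - u) t₀) y
            (EuclideanSpace.basisFun (Fin 3) ℝ i)) x)) + ∫ s in t₀..t₁, ψ s) /
        (1 - agmonConst ^ 2 * μ / ν *
          Real.exp (∫ s in t₀..t₁, (6 * G s + 9 * κ * σ₂ s + 3 * κ ^ 2 * σ₃ s +
            3 * agmonConst ^ 2 * X₁ s / (ν * μ) + 27 * agmonConst ^ 4 * X₁ s ^ 2 / (16 * ν ^ 3))) *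
          ((∑ i, ∫ x, frobeniusNormSq (fderiv ℝ (fun y => fderiv ℝ ((v - u) t₀) y
            (EuclideanSpace.basisFun (Fin 3) ℝ i)) x)) + ∫ s in t₀..t₁, ψ s) * (t - t₀)) := by
  have hT : 0 < t₁ - t₀ := sub_pos.2 ht₀₁
  -- the rate as one function
  obtain ⟨l, hl⟩ : ∃ l : ℝ → ℝ, l = fun s => 6 * G s + 9 * κ * σ₂ s + 3 * κ ^ 2 * σ₃ s +
      3 * agmonConst ^ 2 * X₁ s / (ν * μ) + 27 * agmonConst ^ 4 * X₁ s ^ 2 / (16 * ν ^ 3) :=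
    ⟨_, rfl⟩
  have hl' : ∀ s, 6 * G s + 9 * κ * σ₂ s + 3 * κ ^ 2 * σ₃ s +
      3 * agmonConst ^ 2 * X₁ s / (ν * μ) + 27 * agmonConst ^ 4 * X₁ s ^ 2 / (16 * ν ^ 3) = l s :=
    fun s => by rw [hl]
  simp only [hl'] at hsmall ⊢
  -- the translated window `[0, t₁ − t₀]`
  have hpre : (fun s => s + t₀) ⁻¹' Icc t₀ t₁ = Icc 0 (t₁ - t₀) := by
    rw [Set.preimage_add_const_Icc, sub_self]
  have hmem : ∀ {s}, s ∈ Icc 0 (t₁ - t₀) → s + t₀ ∈ Icc t₀ t₁ := fun hs =>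
    ⟨by linarith [hs.1], by linarith [hs.2]⟩
  have hmaps : MapsTo (fun s => s + t₀) (Icc 0 (t₁ - t₀)) (Icc t₀ t₁) := fun s hs => hmem hs
  have hu' : IsClassicalNSSolutionOn (Icc 0 (t₁ - t₀)) ν (fun s => f (s + t₀)) (fun s => u (s + t₀))
      (fun s => p (s + t₀)) := by
    have h := hu.comp_add_right t₀
    rwa [hpre] at h
  have hv' : IsClassicalNSSolutionOn (Icc 0 (t₁ - t₀)) ν (fun s => g (s + t₀)) (fun s => v (s + t₀))
      (fun s => q (s + t₀)) := by
    have h := hv.comp_add_right t₀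
    rwa [hpre] at h
  have hIcc : Icc t₀ t₁ = Icc (0 + t₀) (t₁ - t₀ + t₀) := by rw [zero_add, sub_add_cancel]
  have hU' : HasBoundedSobolevNormsOn (Icc 0 (t₁ - t₀)) (fun s => u (s + t₀)) := by
    rw [hIcc] at hU
    exact r3rob_bounds_comp_add hU
  have hV' : HasBoundedSobolevNormsOn (Icc 0 (t₁ - t₀)) (fun s => v (s + t₀)) := by
    rw [hIcc] at hV
    exact r3rob_bounds_comp_add hV
  have hWeq : ∀ (w : ℝ → EuclideanSpace ℝ (Fin 3) → EuclideanSpace ℝ (Fin 3)),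
      timeDerivWithin (Icc 0 (t₁ - t₀)) (fun s => w (s + t₀)) =
        fun s => timeDerivWithin (Icc t₀ t₁) w (s + t₀) := by
    intro w
    funext s x
    rw [← hpre]
    exact timeDerivWithin_comp_add_right (Icc t₀ t₁) w t₀ s x
  have hUt' : HasBoundedSobolevNormsOn (Icc 0 (t₁ - t₀))
      (timeDerivWithin (Icc 0 (t₁ - t₀)) (fun s => u (s + t₀))) := by
    rw [hWeq u]
    have h2 : ∀ n : ℕ, ∃ C : ℝ≥0, ∀ s ∈ Icc (0 + t₀) (t₁ - t₀ + t₀),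
        ∫⁻ x, ‖iteratedFDeriv ℝ n (timeDerivWithin (Icc t₀ t₁) u s) x‖ₑ ^ 2 ≤ C := by
      rw [← hIcc]; exact hUt
    exact r3rob_bounds_comp_add h2
  have hVt' : HasBoundedSobolevNormsOn (Icc 0 (t₁ - t₀))
      (timeDerivWithin (Icc 0 (t₁ - t₀)) (fun s => v (s + t₀))) := by
    rw [hWeq v]
    have h2 : ∀ n : ℕ, ∃ C : ℝ≥0, ∀ s ∈ Icc (0 + t₀) (t₁ - t₀ + t₀),
        ∫⁻ x, ‖iteratedFDeriv ℝ n (timeDerivWithin (Icc t₀ t₁) v s) x‖ₑ ^ 2 ≤ C := by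
      rw [← hIcc]; exact hVt
    exact r3rob_bounds_comp_add h2
  have hp' : ∀ n : ℕ, ∃ C : ℝ≥0, ∀ s ∈ Icc 0 (t₁ - t₀),
      ∫⁻ x, ‖iteratedFDeriv ℝ n (p (s + t₀)) x‖ₑ ^ 2 ≤ C := by
    rw [hIcc] at hp
    exact r3rob_bounds_comp_add hp
  have hq' : ∀ n : ℕ, ∃ C : ℝ≥0, ∀ s ∈ Icc 0 (t₁ - t₀),
      ∫⁻ x, ‖iteratedFDeriv ℝ n (q (s + t₀)) x‖ₑ ^ 2 ≤ C := by
    rw [hIcc] at hq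
    exact r3rob_bounds_comp_add hq
  have hfD' : ∀ s ∈ Icc 0 (t₁ - t₀), ∫⁻ x, ‖fderiv ℝ ((fun s => f (s + t₀)) s) x‖ₑ ^ 2 < ⊤ :=
    fun s hs => hfD (s + t₀) (hmem hs)
  have hgD' : ∀ s ∈ Icc 0 (t₁ - t₀), ∫⁻ x, ‖fderiv ℝ ((fun s => g (s + t₀)) s) x‖ₑ ^ 2 < ⊤ :=
    fun s hs => hgD (s + t₀) (hmem hs)
  -- the translated majorants and envelopes
  have cadd : Continuous fun s : ℝ => s + t₀ := continuous_id.add continuous_const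
  have hlcW : ContinuousOn l (Icc t₀ t₁) := by
    rw [hl]
    exact ((((continuousOn_const.mul hGc).add (continuousOn_const.mul hσ₂c)).add
      (continuousOn_const.mul hσ₃c)).add
      ((continuousOn_const.mul hX₁c).div_const _)).add
      ((continuousOn_const.mul (hX₁c.pow 2)).div_const _)
  have hlc : ContinuousOn (fun s => l (s + t₀)) (Icc 0 (t₁ - t₀)) := hlcW.comp cadd.continuousOn hmaps
  have hψc' : ContinuousOn (fun s => ψ (s + t₀)) (Icc 0 (t₁ - t₀)) :=
    hψc.comp cadd.continuousOn hmaps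
  have hG0 : ∀ s ∈ Icc t₀ t₁, 0 ≤ G s := fun s hs =>
    r3rob_compressionRate_nonneg (hu.divFree s hs) (hG s hs)
  have hσ₂0 : ∀ s ∈ Icc t₀ t₁, 0 ≤ σ₂ s := fun s hs => (norm_nonneg _).trans (hσ₂ s hs 0)
  have hσ₃0 : ∀ s ∈ Icc t₀ t₁, 0 ≤ σ₃ s := fun s hs => (norm_nonneg _).trans (hσ₃ s hs 0)
  have hX₁0 : ∀ s ∈ Icc t₀ t₁, 0 ≤ X₁ s := fun s hs =>
    (integral_nonneg fun x => frobeniusNormSq_nonneg _).trans (hX₁ s hs)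
  have hH₁0 : ∀ s ∈ Icc t₀ t₁, 0 ≤ H₁ s := fun s hs =>
    (integral_nonneg fun x => sq_nonneg _).trans (hH₁ s hs)
  have hl0 : ∀ s ∈ Icc t₀ t₁, 0 ≤ l s := fun s hs => by
    rw [hl]
    have := hG0 s hs; have := hσ₂0 s hs; have := hσ₃0 s hs; have := hX₁0 s hs
    positivity
  have hsrc0 : ∀ s ∈ Icc t₀ t₁,
      0 ≤ 27 * σ₂ s / κ * X₁ s + 9 * σ₃ s / κ ^ 2 * L s ^ 2 + 6 / ν * H₁ s := fun s hs => by
    have := hσ₂0 s hs; have := hσ₃0 s hs; have := hX₁0 s hs; have := hH₁0 s hs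
    positivity
  have hΛ : ∀ s ∈ Icc 0 (t₁ - t₀),
      HasDerivWithinAt (fun r => ∫ x in (0 : ℝ)..r, l (x + t₀)) (l (s + t₀)) (Icc 0 (t₁ - t₀)) s :=
    fun s hs => r3rob_hasDerivWithinAt_intervalIntegral hlc hs
  have hΦ : ∀ s ∈ Icc 0 (t₁ - t₀),
      HasDerivWithinAt (fun r => ∫ x in (0 : ℝ)..r, ψ (x + t₀)) (ψ (s + t₀)) (Icc 0 (t₁ - t₀)) s :=
    fun s hs => r3rob_hasDerivWithinAt_intervalIntegral hψc' hs
  have hΛnn : ∀ s ∈ Icc 0 (t₁ - t₀), 0 ≤ ∫ x in (0 : ℝ)..s, l (x + t₀) := fun s hs =>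
    intervalIntegral.integral_nonneg hs.1 fun x hx => hl0 (x + t₀) (hmem ⟨hx.1, hx.2.trans hs.2⟩)
  have hφ : ∀ s ∈ Icc 0 (t₁ - t₀),
      Real.exp (-(fun r => ∫ x in (0 : ℝ)..r, l (x + t₀)) s) *
        (27 * σ₂ (s + t₀) / κ * X₁ (s + t₀) + 9 * σ₃ (s + t₀) / κ ^ 2 * L (s + t₀) ^ 2 +
          6 / ν * H₁ (s + t₀)) ≤ ψ (s + t₀) := fun s hs =>
    (mul_le_of_le_one_left (hsrc0 (s + t₀) (hmem hs))
      (Real.exp_le_one_iff.2 (neg_nonpos.2 (hΛnn s hs)))).trans (hψ (s + t₀) (hmem hs))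
  -- change of variables in the envelopes
  have eΛ : ∀ r, (∫ x in (0 : ℝ)..r, l (x + t₀)) = ∫ s in t₀..(r + t₀), l s := fun r => by
    rw [intervalIntegral.integral_comp_add_right l, zero_add]
  have eΦ : ∀ r, (∫ x in (0 : ℝ)..r, ψ (x + t₀)) = ∫ s in t₀..(r + t₀), ψ s := fun r => by
    rw [intervalIntegral.integral_comp_add_right ψ, zero_add]
  -- the translated slices at `t − t₀` and `0`
  have hr : t - t₀ ∈ Icc 0 (t₁ - t₀) := ⟨sub_nonneg.2 ht.1, sub_le_sub_right ht.2 _⟩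
  have e1 : ((fun s => v (s + t₀)) - fun s => u (s + t₀)) (t - t₀) = (v - u) t := by
    funext x
    simp only [Pi.sub_apply, sub_add_cancel]
  have e0 : ((fun s => v (s + t₀)) - fun s => u (s + t₀)) 0 = (v - u) t₀ := by
    funext x
    simp only [Pi.sub_apply, zero_add]
  have hΛ' : ∀ s ∈ Icc 0 (t₁ - t₀),
      HasDerivWithinAt (fun r => ∫ x in (0 : ℝ)..r, l (x + t₀))
        (6 * G (s + t₀) + 9 * κ * σ₂ (s + t₀) + 3 * κ ^ 2 * σ₃ (s + t₀) +
          3 * agmonConst ^ 2 * X₁ (s + t₀) / (ν * μ) +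
          27 * agmonConst ^ 4 * X₁ (s + t₀) ^ 2 / (16 * ν ^ 3)) (Icc 0 (t₁ - t₀)) s := fun s hs => by
    rw [hl']; exact hΛ s hs
  have key := classicalNS_robustness_H2_strain_R3 hν hT hv' hu' hU' hUt' hp' hV' hVt' hq' hfD' hgD'
    (G := fun s => G (s + t₀)) (σ₂ := fun s => σ₂ (s + t₀)) (σ₃ := fun s => σ₃ (s + t₀))
    (L := fun s => L (s + t₀)) (X₁ := fun s => X₁ (s + t₀)) (H₁ := fun s => H₁ (s + t₀))
    (Λ := fun r => ∫ x in (0 : ℝ)..r, l (x + t₀))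
    (Φ := fun r => ∫ x in (0 : ℝ)..r, ψ (x + t₀)) (φ := fun s => ψ (s + t₀)) hκ hμ
    (fun s hs => hG (s + t₀) (hmem hs)) (fun s hs => hσ₂ (s + t₀) (hmem hs))
    (fun s hs => hσ₃ (s + t₀) (hmem hs)) (fun s hs => hL (s + t₀) (hmem hs))
    (fun s hs => hX₁ (s + t₀) (hmem hs)) (fun s hs => hH₁ (s + t₀) (hmem hs))
    (hGc.comp cadd.continuousOn hmaps) (hσ₂c.comp cadd.continuousOn hmaps)
    (hσ₃c.comp cadd.continuousOn hmaps) (hLc.comp cadd.continuousOn hmaps)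
    (hX₁c.comp cadd.continuousOn hmaps) (hH₁c.comp cadd.continuousOn hmaps) hΛ'
    (by simp only [intervalIntegral.integral_same]) hΦ
    (by simp only [intervalIntegral.integral_same]) hφ ?_ hr
  · -- unpack the translated conclusion
    rw [e1, e0] at key
    simp only [eΛ, eΦ, sub_add_cancel] at key
    exact key
  · rw [e0]
    simp only [eΛ, eΦ, sub_add_cancel]
    exact hsmall

end WindowH2

end Literature.Analysis.FluidPDE

end
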